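import Mathlib
import Literature.Analysis.FluidPDE.GaussianVortexPlanar
import Literature.Analysis.FluidPDE.GaussianVortexPlanarProofs
import Literature.Analysis.FluidPDE.BiotSavart2DSymmetry
import Literature.Analysis.FluidPDE.GaussianVortexKernelRadial
import Literature.Analysis.FluidPDE.PlanarPolarCoords
import Literature.Analysis.FluidPDE.ArnoldCoercivityGaussianVortex
import Literature.Analysis.FluidPDE.PineauVicolWeightedIdentity
import Mathlib.MeasureTheory.Integral.IntegralEqImproper
import Mathlib.Analysis.SpecialFunctions.Integrals.Basic
import Mathlib.Analysis.SpecialFunctions.Gaussian.GaussianIntegral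
import Literature.Analysis.FluidPDE.GaussianVortexArnoldModeOne
import Literature.Analysis.FluidPDE.GaussianVortexArnoldModeSplit
import HarnessLib

/-!
# Arnold coercivity of the Gaussian vortex, file 3 of 3: log-potential energy, Hardy–Wirtinger, high modes — `GallaySverak2021_thm25_gaussian` HOLDS (re-homed proofs)

**T. Gallay, V. Šverák, *Arnold's variational principle and its application to the stability of planar vortices*, arXiv:2110.13739
(Anal. PDE, 2024), Theorem 2.5 with Remark 2.7 and §4.1 (the Gaussian weight) [GallaySverak2021]: Arnold-type coercivity of the
quadratic form of the Oseen (Gaussian) vortex — for continuous, odd densities of Gaussian class with vanishing first moments,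
`γ ∫ Φ⁻¹ ω² ≤ ∫ Φ⁻¹ ω² + ∫ ω ψ_ω` with `ψ_ω = (2π)⁻¹ log|·| ∗ ω` and some `γ > 0`.**  The named fact
`Literature.Analysis.FluidPDE.GallaySverak2021_thm25_gaussian` (`ArnoldCoercivityGaussianVortex.lean`) is PROVED in the tree by the
Navier–Stokes / anomalous-dissipation cells (the angular Fourier splitting `ω = a(r) cos θ + b(r) sin θ + ω_r`, a one-dimensional
constrained coercivity for the `n = ±1` modes, an explicit coercivity for the modes `|n| ≥ 2`, and the logarithmic-potential
toolkit: Green's function, decay, energy identities, Hardy–Wirtinger) — until now Summits-side only (`stub_gallaySverak2021` in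
`Summits/NavierStokesRegularity/NavierStokesRegularity/Theorems/FilamentSkeletonRssCoreLinearInvertibilityArnoldGaussian.lean`).
RE-HOMED into `Literature/` by the Hodge foundations lane (`lit-hodgefound`, prover p20, generation 39) as THREE files: verbatim
DECLARATION-LEVEL ports (the 200 theorems the discharge needs, in dependency order; each Part header lists the declarations of its
source module that are NOT carried) of 33 Summits modules `Summits/NavierStokesRegularity/NavierStokesRegularity/Theorems/FilamentSkeletonRssCoreLinearInvertibility*.lean`
and `Summits/AnomalousDissipation/AnomalousDissipation/Theorems/MarginalStabilityChainStretchedVortexRowsStub*.lean`, namespaces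
`Summit.NavierStokesRegularity.NavierStokesRegularity.Theorems{,.…}` → `Literature.Analysis.GaussianVortexArnold{,.…}` and
`Summit.AnomalousDissipation.AnomalousDissipation.Theorems.MarginalStabilityChainStretchedVortexRows` → `Literature.Analysis.GaussianVortexArnold.StretchedVortexRows`
(a root outside `Literature.Analysis.FluidPDE` on purpose: namespace-prefix resolution would otherwise shadow the cone's lemmas by
same-named `FluidPDE` lemmas); theorems only (kernel path), imports from `Literature/` and Mathlib only; no `sorry`, no new axiom, NO
named fact (D-0026).  PROVENANCE CONVENTION: docstrings byte-for-byte; the cell's cites kept; `[folklore]`-tagged and untagged cell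
lemmas carry the Part's tag `[cite: GallaySverak2021, <loc> (source of the ARGUMENT implemented / context; this declaration is the
cell's own lemma, NOT a printed statement)]`, because the gate does not admit a public Literature theorem without a cite tag.

THIS FILE (3 of 3) ports: MarginalStabilityChainStretchedVortexRowsStubLogPotentialEnergy, MarginalStabilityChainStretchedVortexRowsStubLogPotentialGainA, MarginalStabilityChainStretchedVortexRowsStubLogPotentialGain, FilamentSkeletonRssCoreLinearInvertibilityArnoldHighModesToolsA, MarginalStabilityChainStretchedVortexRowsStubHardyWirtingerEven, MarginalStabilityChainStretchedVortexRowsStubCoreInverseTools, MarginalStabilityChainStretchedVortexRowsStubCircAvgPolar, MarginalStabilityChainStretchedVortexRowsStubLogPotentialSymmetry, MarginalStabilityChainStretchedVortexRowsStubCoreRotationCoercivity, FilamentSkeletonRssCoreLinearInvertibilityArnoldHighModesToolsB, FilamentSkeletonRssCoreLinearInvertibilityArnoldHighModesToolsC, FilamentSkeletonRssCoreLinearInvertibilityArnoldHighModes, FilamentSkeletonRssCoreLinearInvertibilityArnoldGaussian.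
-/

noncomputable section

/-!
## Part 1 — port of `Summits/AnomalousDissipation/AnomalousDissipation/Theorems/MarginalStabilityChainStretchedVortexRowsStubLogPotentialEnergy.lean` (4 declarations kept)

# Helper `logPotential_energy_identity` toward stub `stub_coreInverse` of the line
# `braid-closed-large-circulation-gluing` (crux stmt-AnomalousDissipation-3009, `MarginalStabilityChain.StretchedVortexRows`)

The energy identity `∫ ‖∇ψ‖² = −∫ ψ g` for the logarithmic potential `ψ = N ∗ g` of a NEUTRAL `C¹` Gaussian-class
density on `ℝ² = EuclideanSpace ℝ (Fin 2)` (wave 3, toward `logPotential_neutral_energy`), from the weak Poisson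
equation `∫ ⟪∇ψ, ∇φ⟫ = −∫ g φ` (helper `logPotential_weak_poisson`) tested against the cut-offs `φ_n = χ_n ψ`,
`χ_n(ξ) = χ(ξ/(n+1))`, `χ` a fixed smooth bump equal to `1` on the unit ball and supported in the ball of radius `2`:

* `∫ χ_n ‖∇ψ‖² + ∫ ψ ⟪∇χ_n, ∇ψ⟫ = −∫ g χ_n ψ` for every `n`;
* `∫ χ_n ‖∇ψ‖² → ∫ ‖∇ψ‖²` and `∫ g χ_n ψ → ∫ g ψ` by dominated convergence (`‖∇ψ‖ ≤ C/(1+‖ξ‖)²` from the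
  NEUTRALITY, helper `logPotential_gradient_decay`; `|ψ| ≤ C(1 + log(1 + ‖ξ‖))`);
* the error `∫ ψ ⟪∇χ_n, ∇ψ⟫ → 0`: `‖∇χ_n(ξ)‖ ≤ 4M/(1 + ‖ξ‖)` uniformly in `n` and `∇χ_n(ξ) = 0` eventually, so the
  integrand is dominated by `K (1 + ‖ξ‖)^{−5/2} ∈ L¹(ℝ²)` (`1 + log(1+t) ≤ 2(1+t)^{1/2}`) and tends to `0` pointwise.

Not carried from this source module (not needed by the declarations re-homed here; their consumers are Summits-side): `contDiff_and_continuous_gradient`, `integrable_norm_gradient_sq`, `integrable_logPotential_mul`, `integral_norm_gradient_sq_eq`, `logPotential_energy_identity`.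
-/

section Part1

open scoped RealInnerProductSpace _root_.Topology
open _root_.MeasureTheory WithLp _root_.Function _root_.Metric _root_.Filter _root_.Set

namespace Literature.Analysis.GaussianVortexArnold.StretchedVortexRows

open Literature.Analysis.FluidPDE

/-! ### Scaled cut-offs -/

/-- **Scaled cut-offs.** For `χ ∈ C¹_c` with `χ = 1` on the unit ball, `χ = 0` outside the ball of radius `2` and
`‖Dχ‖ ≤ M`, the rescaled `χ_R = χ(·/R)` (`R ≥ 1`) is `C¹` with compact support, equals `1` on `‖ξ‖ < R`, has
`Dχ_R(ξ) = 0` for `‖ξ‖ < R`, and `‖Dχ_R(ξ)‖ ≤ 4M/(1 + ‖ξ‖)` everywhere. [folklore]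
[cite: GallaySverak2021, §2 and §4.1 (context: potential theory of the planar Biot–Savart / logarithmic potential used in the proof of Thm 2.5; this declaration is the cell’s own lemma, NOT a printed statement)] -/
theorem scaledCutoff_props {χ : EuclideanSpace ℝ (Fin 2) → ℝ} (hχ : ContDiff ℝ 1 χ) (hχc : HasCompactSupport χ)
    (h1 : ∀ x, ‖x‖ ≤ 1 → χ x = 1) (h0 : ∀ x, 2 ≤ ‖x‖ → χ x = 0) {M : ℝ} (hM : ∀ x, ‖fderiv ℝ χ x‖ ≤ M)
    {R : ℝ} (hR : 1 ≤ R) :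
    ContDiff ℝ 1 (fun x : EuclideanSpace ℝ (Fin 2) => χ (R⁻¹ • x)) ∧
      HasCompactSupport (fun x : EuclideanSpace ℝ (Fin 2) => χ (R⁻¹ • x)) ∧
      (∀ x : EuclideanSpace ℝ (Fin 2), ‖x‖ < R → χ (R⁻¹ • x) = 1) ∧
      (∀ x : EuclideanSpace ℝ (Fin 2), ‖x‖ < R → fderiv ℝ (fun x : EuclideanSpace ℝ (Fin 2) => χ (R⁻¹ • x)) x = 0) ∧
      ∀ x : EuclideanSpace ℝ (Fin 2), ‖fderiv ℝ (fun x : EuclideanSpace ℝ (Fin 2) => χ (R⁻¹ • x)) x‖ ≤ 4 * M / (1 + ‖x‖) := by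
  have hR0 : 0 < R := by linarith
  have hRi : 0 < R⁻¹ := inv_pos.2 hR0
  have hM0 : 0 ≤ M := (norm_nonneg _).trans (hM 0)
  have hnorm : ∀ x : EuclideanSpace ℝ (Fin 2), ‖R⁻¹ • x‖ = R⁻¹ * ‖x‖ := fun x => by
    rw [norm_smul, Real.norm_of_nonneg hRi.le]
  have hdiff : ContDiff ℝ 1 (fun x : EuclideanSpace ℝ (Fin 2) => χ (R⁻¹ • x)) :=
    hχ.comp (contDiff_id.const_smul R⁻¹)
  have hone : ∀ x : EuclideanSpace ℝ (Fin 2), ‖x‖ < R → χ (R⁻¹ • x) = 1 := fun x hx => by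
    refine h1 _ ?_
    rw [hnorm, inv_mul_le_iff₀ hR0]
    linarith
  have hzero : ∀ x : EuclideanSpace ℝ (Fin 2), 2 * R < ‖x‖ → χ (R⁻¹ • x) = 0 := fun x hx => by
    refine h0 _ ?_
    rw [hnorm, le_inv_mul_iff₀ hR0]
    linarith
  -- the derivative
  have hderiv : ∀ x : EuclideanSpace ℝ (Fin 2), HasFDerivAt (fun x : EuclideanSpace ℝ (Fin 2) => χ (R⁻¹ • x))
      ((fderiv ℝ χ (R⁻¹ • x)).comp (R⁻¹ • ContinuousLinearMap.id ℝ (EuclideanSpace ℝ (Fin 2)))) x := fun x =>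
    ((hχ.differentiable one_ne_zero) _).hasFDerivAt.comp x ((hasFDerivAt_id x).const_smul R⁻¹)
  have hbd : ∀ x : EuclideanSpace ℝ (Fin 2), ‖fderiv ℝ (fun x : EuclideanSpace ℝ (Fin 2) => χ (R⁻¹ • x)) x‖ ≤ M * R⁻¹ := by
    intro x
    rw [(hderiv x).fderiv]
    refine (ContinuousLinearMap.opNorm_comp_le _ _).trans ?_
    rw [norm_smul, Real.norm_of_nonneg hRi.le]
    calc ‖fderiv ℝ χ (R⁻¹ • x)‖ * (R⁻¹ * ‖ContinuousLinearMap.id ℝ (EuclideanSpace ℝ (Fin 2))‖)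
        ≤ M * (R⁻¹ * 1) := by
          gcongr
          · exact hM _
          · exact ContinuousLinearMap.norm_id_le
      _ = M * R⁻¹ := by ring
  -- local constancy
  have hfd_in : ∀ x : EuclideanSpace ℝ (Fin 2), ‖x‖ < R →
      fderiv ℝ (fun x : EuclideanSpace ℝ (Fin 2) => χ (R⁻¹ • x)) x = 0 := by
    intro x hx
    have hev : (fun x : EuclideanSpace ℝ (Fin 2) => χ (R⁻¹ • x)) =ᶠ[𝓝 x] fun _ => (1:ℝ) := by
      filter_upwards [(isOpen_lt continuous_norm continuous_const).mem_nhds hx] with y hy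
      exact hone y hy
    rw [hev.fderiv_eq, fderiv_const_apply]
  have hfd_out : ∀ x : EuclideanSpace ℝ (Fin 2), 2 * R < ‖x‖ →
      fderiv ℝ (fun x : EuclideanSpace ℝ (Fin 2) => χ (R⁻¹ • x)) x = 0 := by
    intro x hx
    have hev : (fun x : EuclideanSpace ℝ (Fin 2) => χ (R⁻¹ • x)) =ᶠ[𝓝 x] fun _ => (0:ℝ) := by
      filter_upwards [(isOpen_lt continuous_const continuous_norm).mem_nhds hx] with y hy
      exact hzero y hy
    rw [hev.fderiv_eq, fderiv_const_apply]
  refine ⟨hdiff, ?_, hone, hfd_in, fun x => ?_⟩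
  · have : (fun x : EuclideanSpace ℝ (Fin 2) => χ (R⁻¹ • x)) = χ ∘ (Homeomorph.smulOfNeZero R⁻¹ hRi.ne') := rfl
    rw [this]
    exact hχc.comp_homeomorph _
  · have hpos : 0 < 1 + ‖x‖ := by positivity
    by_cases hin : ‖x‖ < R
    · rw [hfd_in x hin, norm_zero]; positivity
    by_cases hout : 2 * R < ‖x‖
    · rw [hfd_out x hout, norm_zero]; positivity
    rw [not_lt] at hin hout
    refine (hbd x).trans ?_
    rw [le_div_iff₀ hpos]
    have h2 : ‖x‖ * R⁻¹ ≤ 2 := by rw [mul_inv_le_iff₀ hR0]; linarith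
    nlinarith [mul_nonneg hM0 hRi.le]

/-- A fixed `C¹` bump on `ℝ²`: `χ = 1` on the closed unit ball, `χ = 0` outside the ball of radius `2`, with bounded
derivative. [folklore]
[cite: GallaySverak2021, §2 and §4.1 (context: potential theory of the planar Biot–Savart / logarithmic potential used in the proof of Thm 2.5; this declaration is the cell’s own lemma, NOT a printed statement)] -/
theorem exists_bump :
    ∃ (χ : EuclideanSpace ℝ (Fin 2) → ℝ) (M : ℝ), ContDiff ℝ 1 χ ∧ HasCompactSupport χ ∧
      (∀ x, ‖x‖ ≤ 1 → χ x = 1) ∧ (∀ x, 2 ≤ ‖x‖ → χ x = 0) ∧ (∀ x, 0 ≤ χ x ∧ χ x ≤ 1) ∧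
      ∀ x, ‖fderiv ℝ χ x‖ ≤ M := by
  let χ₀ : ContDiffBump (0 : EuclideanSpace ℝ (Fin 2)) := ⟨1, 2, one_pos, one_lt_two⟩
  have hc : ContDiff ℝ 1 (χ₀ : EuclideanSpace ℝ (Fin 2) → ℝ) := χ₀.contDiff
  have hs : HasCompactSupport (χ₀ : EuclideanSpace ℝ (Fin 2) → ℝ) := χ₀.hasCompactSupport
  obtain ⟨M, hM⟩ := (hc.continuous_fderiv one_ne_zero).bounded_above_of_compact_support (hs.fderiv (𝕜 := ℝ))
  refine ⟨χ₀, M, hc, hs, fun x hx => χ₀.one_of_mem_closedBall (by simpa using hx),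
    fun x hx => χ₀.zero_of_le_dist (by simpa using hx), fun x => ⟨χ₀.nonneg, χ₀.le_one⟩, hM⟩

/-! ### Two elementary estimates -/

/-- `1 + log(1 + t) ≤ 2 √(1 + t)` for `t ≥ 0`. [folklore]
[cite: GallaySverak2021, §2 and §4.1 (context: potential theory of the planar Biot–Savart / logarithmic potential used in the proof of Thm 2.5; this declaration is the cell’s own lemma, NOT a printed statement)] -/
theorem one_add_log_le_two_sqrt {t : ℝ} (ht : 0 ≤ t) : 1 + Real.log (1 + t) ≤ 2 * Real.sqrt (1 + t) := by
  have h1 : 0 < Real.sqrt (1 + t) := Real.sqrt_pos.2 (by linarith)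
  have h2 : Real.log (1 + t) = 2 * Real.log (Real.sqrt (1 + t)) := by
    rw [Real.log_sqrt (by linarith)]; ring
  have h3 := Real.log_le_sub_one_of_pos h1
  have h4 : 1 ≤ Real.sqrt (1 + t) :=
    calc (1:ℝ) = Real.sqrt 1 := Real.sqrt_one.symm
      _ ≤ Real.sqrt (1 + t) := Real.sqrt_le_sqrt (by linarith)
  linarith

/-- `(1 + log(1+‖ξ‖)) (1+‖ξ‖)⁻¹ ((1+‖ξ‖)²)⁻¹ ≤ 2 (1 + ‖ξ‖)^{−5/2}`. [folklore]
[cite: GallaySverak2021, §2 and §4.1 (context: potential theory of the planar Biot–Savart / logarithmic potential used in the proof of Thm 2.5; this declaration is the cell’s own lemma, NOT a printed statement)] -/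
theorem log_weight_le_rpow (ξ : EuclideanSpace ℝ (Fin 2)) :
    (1 + Real.log (1 + ‖ξ‖)) * ((1 + ‖ξ‖)⁻¹ * ((1 + ‖ξ‖) ^ 2)⁻¹) ≤ 2 * (1 + ‖ξ‖) ^ (-(5 / 2 : ℝ)) := by
  have ht : 0 < 1 + ‖ξ‖ := by positivity
  have h1 := one_add_log_le_two_sqrt (norm_nonneg ξ)
  have h2 : Real.sqrt (1 + ‖ξ‖) * ((1 + ‖ξ‖)⁻¹ * ((1 + ‖ξ‖) ^ 2)⁻¹) = (1 + ‖ξ‖) ^ (-(5 / 2 : ℝ)) := by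
    rw [Real.sqrt_eq_rpow, ← Real.rpow_neg_one, ← Real.rpow_natCast, ← Real.rpow_neg ht.le,
      ← Real.rpow_add ht, ← Real.rpow_add ht]
    norm_num
  calc (1 + Real.log (1 + ‖ξ‖)) * ((1 + ‖ξ‖)⁻¹ * ((1 + ‖ξ‖) ^ 2)⁻¹)
      ≤ (2 * Real.sqrt (1 + ‖ξ‖)) * ((1 + ‖ξ‖)⁻¹ * ((1 + ‖ξ‖) ^ 2)⁻¹) :=
        mul_le_mul_of_nonneg_right h1 (by positivity)
    _ = 2 * (1 + ‖ξ‖) ^ (-(5 / 2 : ℝ)) := by rw [mul_assoc, h2]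

/-! ### The energy identity -/

section Energy

variable {B : ℝ} {g : EuclideanSpace ℝ (Fin 2) → ℝ} (hg : ContDiff ℝ 1 g)
  (hg0 : ∀ η, |g η| ≤ B * Real.exp (-(1 / 8) * ‖η‖ ^ 2))
  (hg1 : ∀ η, ‖fderiv ℝ g η‖ ≤ B * Real.exp (-(1 / 8) * ‖η‖ ^ 2)) (hneutral : ∫ η, g η = 0)
  {ψ : EuclideanSpace ℝ (Fin 2) → ℝ}
  (hψ : ψ = fun ξ : EuclideanSpace ℝ (Fin 2) => ∫ η, (2 * Real.pi)⁻¹ * Real.log ‖ξ - η‖ * g η)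
include hg hg0 hg1 hψ

end Energy

/-! ### The registered helper -/

end Literature.Analysis.GaussianVortexArnold.StretchedVortexRows

end Part1

/-!
## Part 2 — port of `Summits/AnomalousDissipation/AnomalousDissipation/Theorems/MarginalStabilityChainStretchedVortexRowsStubLogPotentialGainA.lean` (13 declarations kept)

# Helper `logPotential_gain_hasFDerivAt` toward the stub `logPotential_gain`
(crux stmt-AnomalousDissipation-3009 `MarginalStabilityChain.StretchedVortexRows`, line `braid-closed-large-circulation-gluing`)

The logarithmic potential `ψ = N ∗ g`, `N = (2π)⁻¹ log ‖·‖`, of a merely **bounded measurable** density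
`|g(η)| ≤ B e^{−‖η‖²/8}` on `ℝ² = EuclideanSpace ℝ (Fin 2)` is differentiable everywhere with the continuous derivative
`Dψ(ξ) = ∫ g(η) DN(ξ − η) dη`, `DN(z) = (2π‖z‖²)⁻¹ ⟪z, ·⟫`: the derivative is *gained from the kernel*.

Route (classical): regularise `N_ε(z) = (4π)⁻¹ log(‖z‖² + ε²)`, `ψ_ε = N_ε ∗ g`.
* `ψ_ε` is differentiable, `Dψ_ε(ξ) = ∫ g(η) DN_ε(ξ − η) dη` with the **bounded** kernel
  `DN_ε(z) = (2π)⁻¹ (‖z‖² + ε²)⁻¹ ⟪z, ·⟫`, `‖DN_ε‖ ≤ (4πε)⁻¹` (differentiation under the integral sign), and `Dψ_ε` is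
  continuous (dominated convergence);
* `Dψ_ε → ∫ g DN(· − η)` **uniformly** on `ℝ²`: `‖DN_ε(z) − DN(z)‖ = (2π)⁻¹ ε² / ((‖z‖² + ε²)‖z‖)` is `≤ (2π)⁻¹‖z‖⁻¹` on the
  unit ball (dominated convergence there) and `≤ (2π)⁻¹ ε²` off it;
* `ψ_ε → ψ` pointwise (dominated convergence, `|log(‖z‖² + ε²)| ≤ 2|log ‖z‖| + ‖z‖²`);
* the uniform-limit-of-derivatives theorem (`hasFDerivAt_of_tendstoUniformly`) along `ε_n = (n+1)⁻¹`.
-/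

section Part2

open scoped _root_.BigOperators _root_.Topology RealInnerProductSpace
open _root_.Filter _root_.Set _root_.Function _root_.MeasureTheory WithLp _root_.Metric

namespace Literature.Analysis.GaussianVortexArnold.StretchedVortexRows

open Literature.Analysis.FluidPDE

/-! ### The regularised gradient kernel `DN_ε(z) = (2π)⁻¹ (‖z‖² + ε²)⁻¹ ⟪z, ·⟫` -/

/-- `‖c ⟪z, ·⟫‖ = |c| ‖z‖`. [folklore]
[cite: GallaySverak2021, §2 and §4.1 (context: potential theory of the planar Biot–Savart / logarithmic potential used in the proof of Thm 2.5; this declaration is the cell’s own lemma, NOT a printed statement)] -/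
theorem gain_norm_smul_innerSL (c : ℝ) (z : EuclideanSpace ℝ (Fin 2)) :
    ‖c • innerSL ℝ z‖ = |c| * ‖z‖ := by
  rw [norm_smul, innerSL_apply_norm, Real.norm_eq_abs]

/-- `‖DN_ε(z)‖ ≤ ‖DN(z)‖ = (2π)⁻¹ ‖z‖⁻¹` for every `ε` (with `0⁻¹ = 0`). [folklore]
[cite: GallaySverak2021, §2 and §4.1 (context: potential theory of the planar Biot–Savart / logarithmic potential used in the proof of Thm 2.5; this declaration is the cell’s own lemma, NOT a printed statement)] -/
theorem gain_kernelReg_le_inv (ε : ℝ) (z : EuclideanSpace ℝ (Fin 2)) :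
    |(2 * Real.pi)⁻¹ * (‖z‖ ^ 2 + ε ^ 2)⁻¹| * ‖z‖ ≤ (2 * Real.pi)⁻¹ * ‖z‖⁻¹ := by
  rcases eq_or_ne z 0 with rfl | hz
  · simp
  have hn : 0 < ‖z‖ := norm_pos_iff.2 hz
  have hpos : 0 < ‖z‖ ^ 2 + ε ^ 2 := by positivity
  rw [abs_of_nonneg (by positivity), mul_assoc]
  refine mul_le_mul_of_nonneg_left ?_ (by positivity)
  rw [inv_mul_le_iff₀ hpos, le_mul_inv_iff₀ hn]
  nlinarith [sq_nonneg ε]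

/-- The regularised kernel is bounded: `‖DN_ε(z)‖ ≤ (2π)⁻¹ (2ε)⁻¹`. [folklore]
[cite: GallaySverak2021, §2 and §4.1 (context: potential theory of the planar Biot–Savart / logarithmic potential used in the proof of Thm 2.5; this declaration is the cell’s own lemma, NOT a printed statement)] -/
theorem gain_kernelReg_le_eps {ε : ℝ} (hε : 0 < ε) (z : EuclideanSpace ℝ (Fin 2)) :
    |(2 * Real.pi)⁻¹ * (‖z‖ ^ 2 + ε ^ 2)⁻¹| * ‖z‖ ≤ (2 * Real.pi)⁻¹ * (2 * ε)⁻¹ := by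
  have hpos : 0 < ‖z‖ ^ 2 + ε ^ 2 := by positivity
  rw [abs_of_nonneg (by positivity), mul_assoc]
  refine mul_le_mul_of_nonneg_left ?_ (by positivity)
  rw [inv_mul_le_iff₀ hpos, le_mul_inv_iff₀ (by positivity : (0:ℝ) < 2 * ε)]
  nlinarith [sq_nonneg (‖z‖ - ε)]

/-- `‖DN_ε(z) − DN(z)‖ = (2π)⁻¹ ε² / ((‖z‖² + ε²) ‖z‖)`. [folklore]
[cite: GallaySverak2021, §2 and §4.1 (context: potential theory of the planar Biot–Savart / logarithmic potential used in the proof of Thm 2.5; this declaration is the cell’s own lemma, NOT a printed statement)] -/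
theorem gain_kernelReg_sub_kernel (ε : ℝ) (z : EuclideanSpace ℝ (Fin 2)) :
    |(2 * Real.pi)⁻¹ * (‖z‖ ^ 2 + ε ^ 2)⁻¹ - (2 * Real.pi)⁻¹ * (‖z‖ ^ 2)⁻¹| * ‖z‖ =
      (2 * Real.pi)⁻¹ * (ε ^ 2 / ((‖z‖ ^ 2 + ε ^ 2) * ‖z‖)) := by
  rcases eq_or_ne z 0 with rfl | hz
  · simp
  have hn : 0 < ‖z‖ := norm_pos_iff.2 hz
  have hn' : ‖z‖ ≠ 0 := hn.ne'
  have hpos : 0 < ‖z‖ ^ 2 + ε ^ 2 := by positivity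
  rw [← mul_sub, abs_mul, abs_of_pos (by positivity : (0:ℝ) < (2 * Real.pi)⁻¹),
    inv_sub_inv hpos.ne' (by positivity), abs_div, abs_of_pos (by positivity : (0:ℝ) < (‖z‖ ^ 2 + ε ^ 2) * ‖z‖ ^ 2)]
  have : |‖z‖ ^ 2 - (‖z‖ ^ 2 + ε ^ 2)| = ε ^ 2 := by
    rw [show ‖z‖ ^ 2 - (‖z‖ ^ 2 + ε ^ 2) = -ε ^ 2 by ring, abs_neg, abs_of_nonneg (sq_nonneg ε)]
  rw [this, mul_assoc]
  congr 1
  field_simp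

/-- The Gaussian weight `e^{−‖η‖²/8}` is integrable on `ℝ²`. [folklore]
[cite: GallaySverak2021, §2 and §4.1 (context: potential theory of the planar Biot–Savart / logarithmic potential used in the proof of Thm 2.5; this declaration is the cell’s own lemma, NOT a printed statement)] -/
theorem gain_integrable_exp :
    Integrable fun η : EuclideanSpace ℝ (Fin 2) => Real.exp (-(1 / 8) * ‖η‖ ^ 2) := by
  simpa using integrable_one_add_norm_pow_mul_exp_eighth 0

/-! ### The regularised potential of a bounded measurable density -/

section Density

variable {B : ℝ} {g : EuclideanSpace ℝ (Fin 2) → ℝ} (hg : Measurable g)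
  (hg0 : ∀ η, |g η| ≤ B * Real.exp (-(1 / 8) * ‖η‖ ^ 2))
include hg hg0

omit hg0 in
/-- Measurability of the integrand `g(η) DN_ε(ξ − η)` (all `ε`, `ε = 0` included). [folklore]
[cite: GallaySverak2021, §2 and §4.1 (context: potential theory of the planar Biot–Savart / logarithmic potential used in the proof of Thm 2.5; this declaration is the cell’s own lemma, NOT a printed statement)] -/
theorem gain_aestronglyMeasurable_kernelCLM (ε : ℝ) (ξ : EuclideanSpace ℝ (Fin 2)) :
    AEStronglyMeasurable (fun η : EuclideanSpace ℝ (Fin 2) =>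
      (g η * ((2 * Real.pi)⁻¹ * (‖ξ - η‖ ^ 2 + ε ^ 2)⁻¹)) • innerSL ℝ (ξ - η)) volume := by
  refine (hg.mul ?_).aestronglyMeasurable.smul
    (((innerSL ℝ (E := EuclideanSpace ℝ (Fin 2))).continuous.comp
      (continuous_const.sub continuous_id)).aestronglyMeasurable)
  fun_prop

/-- `N_ε(ξ − ·) g` is integrable for a bounded measurable Gaussian-class `g`. [folklore]
[cite: GallaySverak2021, §2 and §4.1 (context: potential theory of the planar Biot–Savart / logarithmic potential used in the proof of Thm 2.5; this declaration is the cell’s own lemma, NOT a printed statement)] -/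
theorem gain_integrable_logReg_mul {ε : ℝ} (hε : 0 < ε) (ξ : EuclideanSpace ℝ (Fin 2)) :
    Integrable fun η : EuclideanSpace ℝ (Fin 2) => (4 * Real.pi)⁻¹ * Real.log (‖ξ - η‖ ^ 2 + ε ^ 2) * g η := by
  -- adapted from `integrable_logReg_mul` (continuity of `g` replaced by measurability)
  set c : ℝ := |Real.log (ε ^ 2)| + 2 * ‖ξ‖ ^ 2 / ε ^ 2 + 2 / ε ^ 2 with hc
  refine (((integrable_one_add_norm_pow_mul_exp_eighth 2).const_mul ((4 * Real.pi)⁻¹ * c * B))).mono' ?_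
    (Eventually.of_forall fun η => ?_)
  · exact (((differentiable_logReg_sub hε ξ).continuous.measurable).mul hg).aestronglyMeasurable
  rw [Real.norm_eq_abs, abs_mul, abs_mul, abs_of_pos (by positivity : (0:ℝ) < (4 * Real.pi)⁻¹)]
  have h1 := abs_log_normSq_add_sq_le hε (ξ - η)
  have h2 : ‖ξ - η‖ ^ 2 ≤ 2 * ‖ξ‖ ^ 2 + 2 * ‖η‖ ^ 2 := by
    have ha : ‖ξ - η‖ ^ 2 ≤ (‖ξ‖ + ‖η‖) ^ 2 := pow_le_pow_left₀ (norm_nonneg _) (norm_sub_le ξ η) 2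
    nlinarith [sq_nonneg (‖ξ‖ - ‖η‖)]
  have h3 : |Real.log (‖ξ - η‖ ^ 2 + ε ^ 2)| ≤ c * (1 + ‖η‖) ^ 2 := by
    have hε2 : 0 < ε ^ 2 := by positivity
    calc |Real.log (‖ξ - η‖ ^ 2 + ε ^ 2)| ≤ |Real.log (ε ^ 2)| + (2 * ‖ξ‖ ^ 2 + 2 * ‖η‖ ^ 2) / ε ^ 2 := by
          refine h1.trans ?_; gcongr
      _ = (|Real.log (ε ^ 2)| + 2 * ‖ξ‖ ^ 2 / ε ^ 2) * 1 + 2 / ε ^ 2 * ‖η‖ ^ 2 := by field_simp; ring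
      _ ≤ (|Real.log (ε ^ 2)| + 2 * ‖ξ‖ ^ 2 / ε ^ 2) * (1 + ‖η‖) ^ 2 + 2 / ε ^ 2 * (1 + ‖η‖) ^ 2 := by
          gcongr <;> nlinarith [norm_nonneg η]
      _ = c * (1 + ‖η‖) ^ 2 := by simp only [hc]; ring
  calc (4 * Real.pi)⁻¹ * |Real.log (‖ξ - η‖ ^ 2 + ε ^ 2)| * |g η|
      ≤ (4 * Real.pi)⁻¹ * (c * (1 + ‖η‖) ^ 2) * (B * Real.exp (-(1 / 8) * ‖η‖ ^ 2)) := by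
        gcongr; exact hg0 η
    _ = _ := by ring

/-- The Biot–Savart-type integrand `g(η) DN_ε(ξ − η)` is integrable for every `ε` (`ε = 0` included):
`‖·‖ ≤ (2π)⁻¹ B ‖ξ − η‖⁻¹ e^{−‖η‖²/8}`. [folklore]
[cite: GallaySverak2021, §2 and §4.1 (context: potential theory of the planar Biot–Savart / logarithmic potential used in the proof of Thm 2.5; this declaration is the cell’s own lemma, NOT a printed statement)] -/
theorem gain_integrable_kernelCLM (ε : ℝ) (ξ : EuclideanSpace ℝ (Fin 2)) :
    Integrable fun η : EuclideanSpace ℝ (Fin 2) =>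
      (g η * ((2 * Real.pi)⁻¹ * (‖ξ - η‖ ^ 2 + ε ^ 2)⁻¹)) • innerSL ℝ (ξ - η) := by
  have hB : 0 ≤ B := (abs_nonneg _).trans ((hg0 0).trans (le_of_eq (by simp)))
  refine ((integrable_inv_norm_sub_mul_exp ξ).const_mul ((2 * Real.pi)⁻¹ * B)).mono'
    (gain_aestronglyMeasurable_kernelCLM hg ε ξ) (Eventually.of_forall fun η => ?_)
  rw [gain_norm_smul_innerSL, abs_mul, mul_assoc]
  calc |g η| * (|(2 * Real.pi)⁻¹ * (‖ξ - η‖ ^ 2 + ε ^ 2)⁻¹| * ‖ξ - η‖)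
      ≤ B * Real.exp (-(1 / 8) * ‖η‖ ^ 2) * ((2 * Real.pi)⁻¹ * ‖ξ - η‖⁻¹) :=
        mul_le_mul (hg0 η) (gain_kernelReg_le_inv ε _) (by positivity) (by positivity)
    _ = _ := by ring

/-- **Differentiation under the integral sign** for the regularised potential:
`D ψ_ε(ξ₀) = ∫ g(η) DN_ε(ξ₀ − η) dη` (`ε > 0`; dominating function `(4πε)⁻¹ B e^{−‖η‖²/8}`). [folklore]
[cite: GallaySverak2021, §2 and §4.1 (context: potential theory of the planar Biot–Savart / logarithmic potential used in the proof of Thm 2.5; this declaration is the cell’s own lemma, NOT a printed statement)] -/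
theorem gain_hasFDerivAt_logReg {ε : ℝ} (hε : 0 < ε) (ξ₀ : EuclideanSpace ℝ (Fin 2)) :
    HasFDerivAt (fun ξ : EuclideanSpace ℝ (Fin 2) => ∫ η, (4 * Real.pi)⁻¹ * Real.log (‖ξ - η‖ ^ 2 + ε ^ 2) * g η)
      (∫ η, (g η * ((2 * Real.pi)⁻¹ * (‖ξ₀ - η‖ ^ 2 + ε ^ 2)⁻¹)) • innerSL ℝ (ξ₀ - η)) ξ₀ := by
  have hB : 0 ≤ B := (abs_nonneg _).trans ((hg0 0).trans (le_of_eq (by simp)))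
  refine hasFDerivAt_integral_of_dominated_of_fderiv_le
    (F' := fun (ξ : EuclideanSpace ℝ (Fin 2)) (η : EuclideanSpace ℝ (Fin 2)) =>
      (g η * ((2 * Real.pi)⁻¹ * (‖ξ - η‖ ^ 2 + ε ^ 2)⁻¹)) • innerSL ℝ (ξ - η))
    (bound := fun η => B * Real.exp (-(1 / 8) * ‖η‖ ^ 2) * ((2 * Real.pi)⁻¹ * (2 * ε)⁻¹))
    univ_mem (Eventually.of_forall fun ξ => (gain_integrable_logReg_mul hg hg0 hε ξ).aestronglyMeasurable)
    (gain_integrable_logReg_mul hg hg0 hε ξ₀) (gain_aestronglyMeasurable_kernelCLM hg ε ξ₀)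
    (Eventually.of_forall fun η ξ _ => ?_) ((gain_integrable_exp.const_mul B).mul_const _)
    (Eventually.of_forall fun η ξ _ => ?_)
  · rw [gain_norm_smul_innerSL, abs_mul, mul_assoc]
    exact mul_le_mul (hg0 η) (gain_kernelReg_le_eps hε _) (by positivity) (by positivity)
  · have h1 : HasFDerivAt (fun ξ : EuclideanSpace ℝ (Fin 2) => (4 * Real.pi)⁻¹ * Real.log (‖ξ - η‖ ^ 2 + ε ^ 2))
        (((2 * Real.pi)⁻¹ * (‖ξ - η‖ ^ 2 + ε ^ 2)⁻¹) • innerSL ℝ (ξ - η)) ξ := by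
      have h := (hasFDerivAt_logReg hε (ξ - η)).comp ξ (hasFDerivAt_sub_const η)
      rwa [ContinuousLinearMap.comp_id] at h
    have h2 := h1.mul_const (g η)
    rwa [smul_smul] at h2

/-- The regularised gradient `ξ ↦ ∫ g(η) DN_ε(ξ − η) dη` is continuous (`ε > 0`). [folklore]
[cite: GallaySverak2021, §2 and §4.1 (context: potential theory of the planar Biot–Savart / logarithmic potential used in the proof of Thm 2.5; this declaration is the cell’s own lemma, NOT a printed statement)] -/
theorem gain_continuous_integral_kernelReg {ε : ℝ} (hε : 0 < ε) :
    Continuous fun ξ : EuclideanSpace ℝ (Fin 2) =>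
      ∫ η, (g η * ((2 * Real.pi)⁻¹ * (‖ξ - η‖ ^ 2 + ε ^ 2)⁻¹)) • innerSL ℝ (ξ - η) := by
  have hB : 0 ≤ B := (abs_nonneg _).trans ((hg0 0).trans (le_of_eq (by simp)))
  refine continuous_of_dominated (fun ξ => gain_aestronglyMeasurable_kernelCLM hg ε ξ)
    (fun ξ => Eventually.of_forall fun η => ?_) ((gain_integrable_exp.const_mul B).mul_const
      ((2 * Real.pi)⁻¹ * (2 * ε)⁻¹)) (Eventually.of_forall fun η => ?_)
  · rw [gain_norm_smul_innerSL, abs_mul, mul_assoc]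
    exact mul_le_mul (hg0 η) (gain_kernelReg_le_eps hε _) (by positivity) (by positivity)
  · have hc : Continuous fun ξ : EuclideanSpace ℝ (Fin 2) => (‖ξ - η‖ ^ 2 + ε ^ 2)⁻¹ :=
      (by fun_prop : Continuous fun ξ : EuclideanSpace ℝ (Fin 2) => ‖ξ - η‖ ^ 2 + ε ^ 2).inv₀
        fun ξ => (by positivity : (0:ℝ) < ‖ξ - η‖ ^ 2 + ε ^ 2).ne'
    exact (continuous_const.mul (continuous_const.mul hc)).smul
      ((innerSL ℝ (E := EuclideanSpace ℝ (Fin 2))).continuous.comp (continuous_id.sub continuous_const))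

/-- **Uniform convergence of the regularised gradients**: `∫ g DN_{ε_n}(ξ − ·) → ∫ g DN(ξ − ·)` uniformly in
`ξ ∈ ℝ²` along `ε_n = (n+1)⁻¹` (`‖DN_ε − DN‖ ≤ (2π)⁻¹ ‖z‖⁻¹` on the unit ball, `≤ (2π)⁻¹ ε²` off it). [folklore]
[cite: GallaySverak2021, §2 and §4.1 (context: potential theory of the planar Biot–Savart / logarithmic potential used in the proof of Thm 2.5; this declaration is the cell’s own lemma, NOT a printed statement)] -/
theorem gain_tendstoUniformly_fderiv :
    TendstoUniformly
      (fun (n : ℕ) (ξ : EuclideanSpace ℝ (Fin 2)) => ∫ η,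
        (g η * ((2 * Real.pi)⁻¹ * (‖ξ - η‖ ^ 2 + (((n:ℝ) + 1)⁻¹) ^ 2)⁻¹)) • innerSL ℝ (ξ - η))
      (fun ξ : EuclideanSpace ℝ (Fin 2) => ∫ η,
        (g η * ((2 * Real.pi)⁻¹ * (‖ξ - η‖ ^ 2)⁻¹)) • innerSL ℝ (ξ - η)) atTop := by
  have hB : 0 ≤ B := (abs_nonneg _).trans ((hg0 0).trans (le_of_eq (by simp)))
  have h0 : Tendsto (fun n : ℕ => ((n:ℝ) + 1)⁻¹) atTop (𝓝 0) := by
    simpa [one_div] using tendsto_one_div_add_atTop_nhds_zero_nat (𝕜 := ℝ)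
  -- the singular part: `h(ε) = ∫_{‖z‖<1} ε²/((‖z‖²+ε²)‖z‖) dz → 0`
  set k : ℕ → EuclideanSpace ℝ (Fin 2) → ℝ := fun n z => (ball (0 : EuclideanSpace ℝ (Fin 2)) 1).indicator
    (fun z => (((n:ℝ) + 1)⁻¹) ^ 2 / ((‖z‖ ^ 2 + (((n:ℝ) + 1)⁻¹) ^ 2) * ‖z‖)) z with hk
  have hk0 : ∀ n z, 0 ≤ k n z := fun n z => indicator_nonneg (fun z _ => by positivity) z
  have hkle : ∀ n z, k n z ≤ (ball (0 : EuclideanSpace ℝ (Fin 2)) 1).indicator (fun z => ‖z‖⁻¹) z := by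
    intro n z
    by_cases hz : z ∈ ball (0 : EuclideanSpace ℝ (Fin 2)) 1
    · simp only [hk, indicator_of_mem hz]
      rcases eq_or_ne z 0 with rfl | hz0
      · simp
      have hn : 0 < ‖z‖ := norm_pos_iff.2 hz0
      have hn' : ‖z‖ ≠ 0 := hn.ne'
      rw [div_le_iff₀ (by positivity)]
      calc (((n:ℝ) + 1)⁻¹) ^ 2 ≤ ‖z‖ ^ 2 + (((n:ℝ) + 1)⁻¹) ^ 2 := le_add_of_nonneg_left (sq_nonneg _)
        _ = ‖z‖⁻¹ * ((‖z‖ ^ 2 + (((n:ℝ) + 1)⁻¹) ^ 2) * ‖z‖) := by field_simp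
    · simp only [hk, indicator_of_notMem hz, le_refl]
  have hkm : ∀ n, AEStronglyMeasurable (k n) volume := fun n =>
    (Measurable.indicator (by fun_prop) measurableSet_ball).aestronglyMeasurable
  have hki : ∀ n, Integrable (k n) := fun n =>
    integrable_indicator_inv_norm.mono' (hkm n) (Eventually.of_forall fun z => by
      rw [Real.norm_of_nonneg (hk0 n z)]; exact hkle n z)
  have hkt : Tendsto (fun n => ∫ z, k n z) atTop (𝓝 0) := by
    have h := tendsto_integral_of_dominated_convergence (F := k) (f := fun _ => 0)
      ((ball (0 : EuclideanSpace ℝ (Fin 2)) 1).indicator fun z => ‖z‖⁻¹) hkm integrable_indicator_inv_norm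
      (fun n => Eventually.of_forall fun z => by rw [Real.norm_of_nonneg (hk0 n z)]; exact hkle n z)
      (Eventually.of_forall fun z => ?_)
    · simpa using h
    by_cases hz : z ∈ ball (0 : EuclideanSpace ℝ (Fin 2)) 1
    · simp only [hk, indicator_of_mem hz]
      rcases eq_or_ne z 0 with rfl | hz0
      · simp
      have hn : 0 < ‖z‖ := norm_pos_iff.2 hz0
      have h3 : Tendsto (fun n : ℕ => (((n:ℝ) + 1)⁻¹) ^ 2 / ((‖z‖ ^ 2 + (((n:ℝ) + 1)⁻¹) ^ 2) * ‖z‖)) atTop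
          (𝓝 (0 ^ 2 / ((‖z‖ ^ 2 + 0 ^ 2) * ‖z‖))) :=
        (h0.pow 2).div (((h0.pow 2).const_add (‖z‖ ^ 2)).mul_const ‖z‖) (by positivity)
      simpa using h3
    · simp only [hk, indicator_of_notMem hz]
      exact tendsto_const_nhds
  -- the main estimate, uniform in `ξ`
  set I : ℝ := ∫ η : EuclideanSpace ℝ (Fin 2), Real.exp (-(1 / 8) * ‖η‖ ^ 2) with hI
  have hmain : ∀ (n : ℕ) (ξ : EuclideanSpace ℝ (Fin 2)),
      ‖(∫ η, (g η * ((2 * Real.pi)⁻¹ * (‖ξ - η‖ ^ 2)⁻¹)) • innerSL ℝ (ξ - η)) -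
        ∫ η, (g η * ((2 * Real.pi)⁻¹ * (‖ξ - η‖ ^ 2 + (((n:ℝ) + 1)⁻¹) ^ 2)⁻¹)) • innerSL ℝ (ξ - η)‖ ≤
        (2 * Real.pi)⁻¹ * B * ((∫ z, k n z) + (((n:ℝ) + 1)⁻¹) ^ 2 * I) := by
    intro n ξ
    have hint0 := gain_integrable_kernelCLM hg hg0 0 ξ
    simp only [ne_eq, OfNat.ofNat_ne_zero, not_false_eq_true, zero_pow, add_zero] at hint0
    rw [← integral_sub hint0 (gain_integrable_kernelCLM hg hg0 _ ξ)]
    have hkξ : Integrable fun η => k n (ξ - η) := (hki n).comp_sub_left ξ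
    have hbi : Integrable fun η : EuclideanSpace ℝ (Fin 2) => (2 * Real.pi)⁻¹ * B *
        (k n (ξ - η) + (((n:ℝ) + 1)⁻¹) ^ 2 * Real.exp (-(1 / 8) * ‖η‖ ^ 2)) :=
      (hkξ.add (gain_integrable_exp.const_mul _)).const_mul _
    refine (norm_integral_le_of_norm_le hbi (Eventually.of_forall fun η => ?_)).trans (le_of_eq ?_)
    · rw [← sub_smul, ← mul_sub, gain_norm_smul_innerSL, abs_mul, mul_assoc, abs_sub_comm,
        gain_kernelReg_sub_kernel]
      have he1 : Real.exp (-(1 / 8) * ‖η‖ ^ 2) ≤ 1 := Real.exp_le_one_iff.2 (by nlinarith [norm_nonneg η])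
      by_cases hz : ξ - η ∈ ball (0 : EuclideanSpace ℝ (Fin 2)) 1
      · have hkz : k n (ξ - η) = (((n:ℝ) + 1)⁻¹) ^ 2 / ((‖ξ - η‖ ^ 2 + (((n:ℝ) + 1)⁻¹) ^ 2) * ‖ξ - η‖) := by
          simp only [hk, indicator_of_mem hz]
        have hg1 : |g η| ≤ B := (hg0 η).trans (mul_le_of_le_one_right hB he1)
        calc |g η| * ((2 * Real.pi)⁻¹ * ((((n:ℝ) + 1)⁻¹) ^ 2 / ((‖ξ - η‖ ^ 2 + (((n:ℝ) + 1)⁻¹) ^ 2) * ‖ξ - η‖)))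
            ≤ B * ((2 * Real.pi)⁻¹ * ((((n:ℝ) + 1)⁻¹) ^ 2 / ((‖ξ - η‖ ^ 2 + (((n:ℝ) + 1)⁻¹) ^ 2) * ‖ξ - η‖))) :=
              mul_le_mul_of_nonneg_right hg1 (by positivity)
          _ = (2 * Real.pi)⁻¹ * B * (k n (ξ - η) + 0) := by rw [hkz]; ring
          _ ≤ _ := by gcongr; positivity
      · have hkz : k n (ξ - η) = 0 := by simp only [hk, indicator_of_notMem hz]
        have h1 : 1 ≤ ‖ξ - η‖ := by simpa [mem_ball_zero_iff] using hz
        have hD : 1 ≤ (‖ξ - η‖ ^ 2 + (((n:ℝ) + 1)⁻¹) ^ 2) * ‖ξ - η‖ :=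
          one_le_mul_of_one_le_of_one_le (by nlinarith [sq_nonneg (((n:ℝ) + 1)⁻¹)]) h1
        have hq : (((n:ℝ) + 1)⁻¹) ^ 2 / ((‖ξ - η‖ ^ 2 + (((n:ℝ) + 1)⁻¹) ^ 2) * ‖ξ - η‖) ≤ (((n:ℝ) + 1)⁻¹) ^ 2 :=
          div_le_self (sq_nonneg _) hD
        calc |g η| * ((2 * Real.pi)⁻¹ * ((((n:ℝ) + 1)⁻¹) ^ 2 / ((‖ξ - η‖ ^ 2 + (((n:ℝ) + 1)⁻¹) ^ 2) * ‖ξ - η‖)))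
            ≤ B * Real.exp (-(1 / 8) * ‖η‖ ^ 2) * ((2 * Real.pi)⁻¹ * (((n:ℝ) + 1)⁻¹) ^ 2) :=
              mul_le_mul (hg0 η) (by gcongr) (by positivity) (by positivity)
          _ = _ := by rw [hkz]; ring
    · rw [integral_const_mul, integral_add hkξ (gain_integrable_exp.const_mul _), integral_const_mul,
        integral_sub_left_eq_self (k n) volume ξ]
  -- conclusion
  rw [Metric.tendstoUniformly_iff]
  intro e he
  have hlim : Tendsto (fun n : ℕ => (2 * Real.pi)⁻¹ * B * ((∫ z, k n z) + (((n:ℝ) + 1)⁻¹) ^ 2 * I))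
      atTop (𝓝 0) := by
    have h := (hkt.add ((h0.pow 2).mul_const I)).const_mul ((2 * Real.pi)⁻¹ * B)
    simpa using h
  filter_upwards [(tendsto_order.1 hlim).2 e he] with n hn ξ
  rw [dist_eq_norm]
  exact (hmain n ξ).trans_lt hn

/-- **Pointwise convergence of the regularised potentials**: `ψ_{ε_n}(ξ) → ψ(ξ)` (dominated convergence:
`|log(‖z‖² + ε²)| ≤ 2|log ‖z‖| + ‖z‖²` off the origin, `|log ‖ξ − η‖| ≤ L₀(ξ − η) + log(1 + ‖ξ‖) + ‖η‖`). [folklore]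
[cite: GallaySverak2021, §2 and §4.1 (context: potential theory of the planar Biot–Savart / logarithmic potential used in the proof of Thm 2.5; this declaration is the cell’s own lemma, NOT a printed statement)] -/
theorem gain_tendsto_logRegPotential (ξ : EuclideanSpace ℝ (Fin 2)) :
    Tendsto (fun n : ℕ => ∫ η, (4 * Real.pi)⁻¹ * Real.log (‖ξ - η‖ ^ 2 + (((n:ℝ) + 1)⁻¹) ^ 2) * g η)
      atTop (𝓝 (∫ η, (2 * Real.pi)⁻¹ * Real.log ‖ξ - η‖ * g η)) := by
  -- adapted from the proof of `integral_logKernel_mul_fderiv_eq`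
  have hB : 0 ≤ B := (abs_nonneg _).trans ((hg0 0).trans (le_of_eq (by simp)))
  have hεn : ∀ n : ℕ, (0:ℝ) < ((n:ℝ) + 1)⁻¹ := fun n => by positivity
  have hεn1 : ∀ n : ℕ, ((n:ℝ) + 1)⁻¹ ≤ 1 := fun n =>
    inv_le_one_of_one_le₀ (by linarith [n.cast_nonneg (α := ℝ)])
  have h0 : Tendsto (fun n : ℕ => ((n:ℝ) + 1)⁻¹) atTop (𝓝 0) := by
    simpa [one_div] using tendsto_one_div_add_atTop_nhds_zero_nat (𝕜 := ℝ)
  have hae : ∀ᵐ η ∂(volume : Measure (EuclideanSpace ℝ (Fin 2))), η ≠ ξ := by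
    rw [ae_iff]
    simp
  set cξ : ℝ := Real.log (1 + ‖ξ‖) + ‖ξ‖ ^ 2 with hcξ
  have hcξ0 : 0 ≤ cξ := add_nonneg (Real.log_nonneg (by linarith [norm_nonneg ξ])) (sq_nonneg _)
  have hi0 : Integrable fun η : EuclideanSpace ℝ (Fin 2) =>
      (ball (0 : EuclideanSpace ℝ (Fin 2)) 1).indicator (fun z => -Real.log ‖z‖) (ξ - η) :=
    integrable_indicator_neg_log_norm.comp_sub_left ξ
  have hi2 := integrable_one_add_norm_pow_mul_exp_eighth 2
  refine tendsto_integral_of_dominated_convergence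
    (fun η => (4 * Real.pi)⁻¹ * (2 * B) *
      ((ball (0 : EuclideanSpace ℝ (Fin 2)) 1).indicator (fun z => -Real.log ‖z‖) (ξ - η) +
        (cξ + 1) * ((1 + ‖η‖) ^ 2 * Real.exp (-(1 / 8) * ‖η‖ ^ 2))))
    (fun n => (gain_integrable_logReg_mul hg hg0 (hεn n) ξ).aestronglyMeasurable)
    ((hi0.add (hi2.const_mul _)).const_mul _) (fun n => ?_) ?_
  · filter_upwards [hae] with η hη
    have hz : ξ - η ≠ 0 := sub_ne_zero.2 (Ne.symm hη)
    rw [Real.norm_eq_abs, abs_mul, abs_mul, abs_of_pos (by positivity : (0:ℝ) < (4 * Real.pi)⁻¹)]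
    have h1 := abs_log_normSq_add_sq_le_unif (hεn n) (hεn1 n) hz
    have h2 := abs_log_norm_sub_le ξ η
    have h4 := indicator_neg_log_norm_nonneg (ξ - η)
    have he : Real.exp (-(1 / 8) * ‖η‖ ^ 2) ≤ 1 := Real.exp_le_one_iff.2 (by nlinarith [norm_nonneg η])
    have he0 : 0 ≤ Real.exp (-(1 / 8) * ‖η‖ ^ 2) := (Real.exp_pos _).le
    set L0 := (ball (0 : EuclideanSpace ℝ (Fin 2)) 1).indicator (fun z => -Real.log ‖z‖) (ξ - η) with hL0
    set e := Real.exp (-(1 / 8) * ‖η‖ ^ 2) with he'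
    have h5 : 2 * |Real.log ‖ξ - η‖| + ‖ξ - η‖ ^ 2 ≤ 2 * L0 + 2 * (cξ + 1) * (1 + ‖η‖) ^ 2 := by
      have h3 : ‖ξ - η‖ ^ 2 ≤ 2 * ‖ξ‖ ^ 2 + 2 * ‖η‖ ^ 2 := by
        have ha : ‖ξ - η‖ ^ 2 ≤ (‖ξ‖ + ‖η‖) ^ 2 := pow_le_pow_left₀ (norm_nonneg _) (norm_sub_le ξ η) 2
        nlinarith [sq_nonneg (‖ξ‖ - ‖η‖)]
      have : Real.log (1 + ‖ξ‖) ≤ cξ := by simp only [hcξ]; nlinarith [norm_nonneg ξ]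
      nlinarith [norm_nonneg η, norm_nonneg ξ]
    calc (4 * Real.pi)⁻¹ * |Real.log (‖ξ - η‖ ^ 2 + (((n:ℝ) + 1)⁻¹) ^ 2)| * |g η|
        ≤ (4 * Real.pi)⁻¹ * (2 * L0 + 2 * (cξ + 1) * (1 + ‖η‖) ^ 2) * (B * e) := by
          gcongr
          · exact h1.trans h5
          · exact hg0 η
      _ = (4 * Real.pi)⁻¹ * (2 * B) * (L0 * e + (cξ + 1) * ((1 + ‖η‖) ^ 2 * e)) := by ring
      _ ≤ (4 * Real.pi)⁻¹ * (2 * B) * (L0 + (cξ + 1) * ((1 + ‖η‖) ^ 2 * e)) := by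
          gcongr; exact mul_le_of_le_one_right h4 he
  · filter_upwards [hae] with η hη
    have hz : ξ - η ≠ 0 := sub_ne_zero.2 (Ne.symm hη)
    have hn2 : (0:ℝ) < ‖ξ - η‖ ^ 2 := by positivity
    have hlim : Tendsto (fun n : ℕ => ‖ξ - η‖ ^ 2 + (((n:ℝ) + 1)⁻¹) ^ 2) atTop (𝓝 (‖ξ - η‖ ^ 2)) := by
      have := (h0.pow 2).const_add (‖ξ - η‖ ^ 2)
      rwa [zero_pow two_ne_zero, add_zero] at this
    have hlog := ((Real.continuousAt_log hn2.ne').tendsto.comp hlim).const_mul (4 * Real.pi)⁻¹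
    have he : (4 * Real.pi)⁻¹ * Real.log (‖ξ - η‖ ^ 2) = (2 * Real.pi)⁻¹ * Real.log ‖ξ - η‖ := by
      rw [Real.log_pow, Nat.cast_ofNat]; ring
    rw [he] at hlog
    exact hlog.mul_const _

end Density

/-! ### The registered helper -/

/-- **The derivative of the logarithmic potential of a bounded measurable density is gained from the kernel**:
for `g` measurable with `|g(η)| ≤ B e^{−‖η‖²/8}` and `ψ(ξ) = ∫ (2π)⁻¹ log ‖ξ − η‖ g(η) dη`, the Biot–Savart-type
integrand `g(η) DN(ξ − η)`, `DN(z) = (2π)⁻¹ (‖z‖²)⁻¹ ⟪z, ·⟫`, is integrable for every `ξ`, `ψ` has the Fréchet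
derivative `∫ g(η) DN(ξ − η) dη` at every `ξ`, and this derivative is continuous in `ξ` (registered helper toward
`logPotential_gain`; regularisation `N_ε = (4π)⁻¹ log(‖·‖² + ε²)`, uniform convergence of the regularised gradients,
`hasFDerivAt_of_tendstoUniformly`). [folklore]
[cite: GallaySverak2021, §2 and §4.1 (context: potential theory of the planar Biot–Savart / logarithmic potential used in the proof of Thm 2.5; this declaration is the cell’s own lemma, NOT a printed statement)] -/
theorem logPotential_gain_hasFDerivAt :
    ∀ (B : ℝ) (g : EuclideanSpace ℝ (Fin 2) → ℝ), Measurable g →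
      (∀ η, |g η| ≤ B * Real.exp (-(1 / 8) * ‖η‖ ^ 2)) →
      (∀ ξ : EuclideanSpace ℝ (Fin 2), MeasureTheory.Integrable (fun η : EuclideanSpace ℝ (Fin 2) =>
        (g η * ((2 * Real.pi)⁻¹ * (‖ξ - η‖ ^ 2)⁻¹)) • innerSL ℝ (ξ - η))) ∧
      (∀ ξ : EuclideanSpace ℝ (Fin 2),
        HasFDerivAt (fun ξ : EuclideanSpace ℝ (Fin 2) => ∫ η, (2 * Real.pi)⁻¹ * Real.log ‖ξ - η‖ * g η)
          (∫ η, (g η * ((2 * Real.pi)⁻¹ * (‖ξ - η‖ ^ 2)⁻¹)) • innerSL ℝ (ξ - η)) ξ) ∧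
      Continuous (fun ξ : EuclideanSpace ℝ (Fin 2) => ∫ η,
        (g η * ((2 * Real.pi)⁻¹ * (‖ξ - η‖ ^ 2)⁻¹)) • innerSL ℝ (ξ - η)) := by
  intro B g hg hg0
  have hεn : ∀ n : ℕ, (0:ℝ) < ((n:ℝ) + 1)⁻¹ := fun n => by positivity
  have hU := gain_tendstoUniformly_fderiv hg hg0
  refine ⟨fun ξ => ?_, fun ξ => ?_, ?_⟩
  · have h := gain_integrable_kernelCLM hg hg0 0 ξ
    simpa only [ne_eq, OfNat.ofNat_ne_zero, not_false_eq_true, zero_pow, add_zero] using h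
  · exact hasFDerivAt_of_tendstoUniformly hU (fun n ξ => gain_hasFDerivAt_logReg hg hg0 (hεn n) ξ)
      (fun ξ => gain_tendsto_logRegPotential hg hg0 ξ) ξ
  · exact hU.continuous (Frequently.of_forall fun n => gain_continuous_integral_kernelReg hg hg0 (hεn n))

end Literature.Analysis.GaussianVortexArnold.StretchedVortexRows

end Part2

/-!
## Part 3 — port of `Summits/AnomalousDissipation/AnomalousDissipation/Theorems/MarginalStabilityChainStretchedVortexRowsStubLogPotentialGain.lean` (3 declarations kept)

# `logPotential_gain` — registered helper stub toward `stub_cellStreamSolvability`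
(crux stmt-AnomalousDissipation-3009 `MarginalStabilityChain.StretchedVortexRows`, line `braid-closed-large-circulation-gluing`)

For a merely **bounded measurable** density `|g(η)| ≤ B e^{−‖η‖²/8}` on `ℝ² = EuclideanSpace ℝ (Fin 2)` the logarithmic
potential `ψ = N ∗ g`, `N = (2π)⁻¹ log ‖·‖`, is `C¹`, its gradient is the absolutely convergent Biot–Savart-type integral
`∇ψ(ξ) = ∫ g(η) DN(ξ − η) dη`, `DN(z) = (2π‖z‖²)⁻¹ z`, and `|ψ(ξ)| ≤ C (1 + log(1 + ‖ξ‖))`, `‖∇ψ(ξ)‖ ≤ C`.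

The derivative is gained from the kernel (helper file `…StubLogPotentialGainA`: regularisation
`N_ε = (4π)⁻¹ log(‖·‖² + ε²)`, differentiation under the integral sign for `ψ_ε = N_ε ∗ g`, uniform convergence of the
regularised gradients and `hasFDerivAt_of_tendstoUniformly`); here the `C¹` property (`contDiff_one_iff_fderiv`), the
gradient formula (Riesz identification `gradient = toDual.symm ∘ fderiv`, `ContinuousLinearMap.integral_apply`,
`integral_inner`) and the two bounds (`abs_logPotential_le`; `‖∇ψ‖ ≤ ∫ ‖g DN(ξ − ·)‖ ≤ M` uniformly, as the kernel is
`≤ (2π)⁻¹(𝟙_{‖z‖<1}‖z‖⁻¹ + 1)`) are assembled.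
-/

section Part3

open scoped _root_.BigOperators _root_.Topology RealInnerProductSpace _root_.ContDiff Laplacian
open _root_.Filter _root_.Set _root_.Function _root_.MeasureTheory WithLp _root_.Metric

namespace Literature.Analysis.GaussianVortexArnold.StretchedVortexRows

open Literature.Analysis.FluidPDE

/-- The Biot–Savart-type integrand `g(η) DN(ξ − η)` of a bounded measurable Gaussian-class density is integrable. [folklore]
[cite: GallaySverak2021, §2 and §4.1 (context: potential theory of the planar Biot–Savart / logarithmic potential used in the proof of Thm 2.5; this declaration is the cell’s own lemma, NOT a printed statement)] -/
theorem gain_integrable_smul_gradLogKernel {B : ℝ} {g : EuclideanSpace ℝ (Fin 2) → ℝ} (hg : Measurable g)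
    (hg0 : ∀ η, |g η| ≤ B * Real.exp (-(1 / 8) * ‖η‖ ^ 2)) (ξ : EuclideanSpace ℝ (Fin 2)) :
    Integrable fun η : EuclideanSpace ℝ (Fin 2) => g η • ((2 * Real.pi * ‖ξ - η‖ ^ 2)⁻¹ • (ξ - η)) := by
  -- adapted from `integrable_smul_gradLogKernel` (continuity of `g` replaced by measurability)
  have hB : 0 ≤ B := (abs_nonneg _).trans ((hg0 0).trans (le_of_eq (by simp)))
  refine ((integrable_inv_norm_sub_mul_exp ξ).const_mul ((2 * Real.pi)⁻¹ * B)).mono' ?_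
    (Eventually.of_forall fun η => ?_)
  · exact (hg.smul ((((measurable_const.mul ((measurable_norm.comp
      (measurable_const.sub measurable_id)).pow_const 2)).inv).smul
      (measurable_const.sub measurable_id)))).aestronglyMeasurable
  rw [norm_smul, norm_gradLogKernel, Real.norm_eq_abs]
  calc |g η| * ((2 * Real.pi)⁻¹ * ‖ξ - η‖⁻¹) ≤ B * Real.exp (-(1 / 8) * ‖η‖ ^ 2) * ((2 * Real.pi)⁻¹ * ‖ξ - η‖⁻¹) :=
        mul_le_mul_of_nonneg_right (hg0 η) (by positivity)
    _ = _ := by ring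

/-- Uniform bound for the absolutely convergent gradient integrals of a bounded measurable Gaussian-class density:
`∫ ‖g(η) DN(ξ − η)‖ dη ≤ M` for all `ξ` (`‖DN(z)‖ e^{−‖η‖²/8} ≤ (2π)⁻¹ (𝟙_{‖z‖<1} ‖z‖⁻¹ + e^{−‖η‖²/8})`). [folklore]
[cite: GallaySverak2021, §2 and §4.1 (context: potential theory of the planar Biot–Savart / logarithmic potential used in the proof of Thm 2.5; this declaration is the cell’s own lemma, NOT a printed statement)] -/
theorem gain_exists_integral_norm_le {B : ℝ} {g : EuclideanSpace ℝ (Fin 2) → ℝ} (hg : Measurable g)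
    (hg0 : ∀ η, |g η| ≤ B * Real.exp (-(1 / 8) * ‖η‖ ^ 2)) :
    ∃ M : ℝ, ∀ ξ : EuclideanSpace ℝ (Fin 2),
      ∫ η, ‖g η • ((2 * Real.pi * ‖ξ - η‖ ^ 2)⁻¹ • (ξ - η))‖ ≤ M := by
  -- adapted from `exists_integral_norm_smul_gradLogKernel_le` (continuity of `g` replaced by measurability)
  have hB : 0 ≤ B := (abs_nonneg _).trans ((hg0 0).trans (le_of_eq (by simp)))
  have hI := gain_integrable_exp
  refine ⟨(2 * Real.pi)⁻¹ * B *
    ((∫ z, (ball (0 : EuclideanSpace ℝ (Fin 2)) 1).indicator (fun z => ‖z‖⁻¹) z) +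
      ∫ η : EuclideanSpace ℝ (Fin 2), Real.exp (-(1 / 8) * ‖η‖ ^ 2)), fun ξ => ?_⟩
  have h1 : Integrable fun η : EuclideanSpace ℝ (Fin 2) =>
      (ball (0 : EuclideanSpace ℝ (Fin 2)) 1).indicator (fun z => ‖z‖⁻¹) (ξ - η) :=
    integrable_indicator_inv_norm.comp_sub_left ξ
  have hle : ∀ η, ‖g η • ((2 * Real.pi * ‖ξ - η‖ ^ 2)⁻¹ • (ξ - η))‖ ≤ (2 * Real.pi)⁻¹ * B *
      ((ball (0 : EuclideanSpace ℝ (Fin 2)) 1).indicator (fun z => ‖z‖⁻¹) (ξ - η) +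
        Real.exp (-(1 / 8) * ‖η‖ ^ 2)) := by
    intro η
    rw [norm_smul, norm_gradLogKernel, Real.norm_eq_abs]
    have he : Real.exp (-(1 / 8) * ‖η‖ ^ 2) ≤ 1 := Real.exp_le_one_iff.2 (by nlinarith [norm_nonneg η])
    have he0 : 0 ≤ Real.exp (-(1 / 8) * ‖η‖ ^ 2) := (Real.exp_pos _).le
    have hi0 : 0 ≤ ‖ξ - η‖⁻¹ := inv_nonneg.2 (norm_nonneg _)
    have key : ‖ξ - η‖⁻¹ * Real.exp (-(1 / 8) * ‖η‖ ^ 2) ≤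
        (ball (0 : EuclideanSpace ℝ (Fin 2)) 1).indicator (fun z => ‖z‖⁻¹) (ξ - η) +
          Real.exp (-(1 / 8) * ‖η‖ ^ 2) := by
      by_cases hb : ξ - η ∈ ball (0 : EuclideanSpace ℝ (Fin 2)) 1
      · rw [indicator_of_mem hb]; nlinarith
      · rw [indicator_of_notMem hb, zero_add]
        have h3 : ‖ξ - η‖⁻¹ ≤ 1 := inv_le_one_of_one_le₀ (by simpa [mem_ball_zero_iff] using hb)
        nlinarith
    calc |g η| * ((2 * Real.pi)⁻¹ * ‖ξ - η‖⁻¹)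
        ≤ B * Real.exp (-(1 / 8) * ‖η‖ ^ 2) * ((2 * Real.pi)⁻¹ * ‖ξ - η‖⁻¹) :=
          mul_le_mul_of_nonneg_right (hg0 η) (by positivity)
      _ = (2 * Real.pi)⁻¹ * B * (‖ξ - η‖⁻¹ * Real.exp (-(1 / 8) * ‖η‖ ^ 2)) := by ring
      _ ≤ _ := mul_le_mul_of_nonneg_left key (by positivity)
  calc ∫ η, ‖g η • ((2 * Real.pi * ‖ξ - η‖ ^ 2)⁻¹ • (ξ - η))‖
      ≤ ∫ η, (2 * Real.pi)⁻¹ * B * ((ball (0 : EuclideanSpace ℝ (Fin 2)) 1).indicator (fun z => ‖z‖⁻¹) (ξ - η) +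
          Real.exp (-(1 / 8) * ‖η‖ ^ 2)) :=
        integral_mono (gain_integrable_smul_gradLogKernel hg hg0 ξ).norm ((h1.add hI).const_mul _) hle
    _ = _ := by
        rw [integral_const_mul, integral_add h1 hI,
          integral_sub_left_eq_self ((ball (0 : EuclideanSpace ℝ (Fin 2)) 1).indicator fun z => ‖z‖⁻¹) volume ξ]

/-- **The logarithmic potential of a bounded measurable Gaussian-class density** (registered helper toward
`stub_cellStreamSolvability`): for `g` measurable with `|g(η)| ≤ B e^{−‖η‖²/8}`, `ψ = N ∗ g` (`N = (2π)⁻¹ log ‖·‖`) is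
`C¹` on `ℝ²`; for every `ξ` the Biot–Savart-type integrand `g(η) DN(ξ − η)`, `DN(z) = (2π‖z‖²)⁻¹ z`, is integrable and
`∇ψ(ξ) = ∫ g(η) DN(ξ − η) dη`; and `|ψ(ξ)| ≤ C (1 + log(1 + ‖ξ‖))`, `‖∇ψ(ξ)‖ ≤ C` for one constant `C`. The derivative is
gained from the kernel: regularisation `N_ε = (4π)⁻¹ log(‖·‖² + ε²)`, uniform convergence of the regularised gradients,
and the uniform-limit-of-derivatives theorem. [folklore]
[cite: GallaySverak2021, §2 and §4.1 (context: potential theory of the planar Biot–Savart / logarithmic potential used in the proof of Thm 2.5; this declaration is the cell’s own lemma, NOT a printed statement)] -/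
theorem logPotential_gain :
    ∀ (B : ℝ) (g : EuclideanSpace ℝ (Fin 2) → ℝ), Measurable g →
      (∀ η, |g η| ≤ B * Real.exp (-(1 / 8) * ‖η‖ ^ 2)) →
      ContDiff ℝ 1 (fun ξ : EuclideanSpace ℝ (Fin 2) => ∫ η, (2 * Real.pi)⁻¹ * Real.log ‖ξ - η‖ * g η) ∧
      (∀ ξ : EuclideanSpace ℝ (Fin 2),
        Integrable (fun η : EuclideanSpace ℝ (Fin 2) => g η • ((2 * Real.pi * ‖ξ - η‖ ^ 2)⁻¹ • (ξ - η))) ∧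
          gradient (fun ξ : EuclideanSpace ℝ (Fin 2) => ∫ η, (2 * Real.pi)⁻¹ * Real.log ‖ξ - η‖ * g η) ξ =
            ∫ η, g η • ((2 * Real.pi * ‖ξ - η‖ ^ 2)⁻¹ • (ξ - η))) ∧
      ∃ C : ℝ, ∀ ξ : EuclideanSpace ℝ (Fin 2),
        |∫ η, (2 * Real.pi)⁻¹ * Real.log ‖ξ - η‖ * g η| ≤ C * (1 + Real.log (1 + ‖ξ‖)) ∧
        ‖gradient (fun ξ : EuclideanSpace ℝ (Fin 2) => ∫ η, (2 * Real.pi)⁻¹ * Real.log ‖ξ - η‖ * g η) ξ‖ ≤ C := by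
  intro B g hg hg0
  obtain ⟨hint, hD, hcont⟩ := logPotential_gain_hasFDerivAt B g hg hg0
  have hintv := fun ξ => gain_integrable_smul_gradLogKernel hg hg0 ξ
  have hfd : fderiv ℝ (fun ξ : EuclideanSpace ℝ (Fin 2) => ∫ η, (2 * Real.pi)⁻¹ * Real.log ‖ξ - η‖ * g η) =
      fun ξ => ∫ η, (g η * ((2 * Real.pi)⁻¹ * (‖ξ - η‖ ^ 2)⁻¹)) • innerSL ℝ (ξ - η) :=
    funext fun ξ => (hD ξ).fderiv
  have hgrad : ∀ ξ : EuclideanSpace ℝ (Fin 2),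
      gradient (fun ξ : EuclideanSpace ℝ (Fin 2) => ∫ η, (2 * Real.pi)⁻¹ * Real.log ‖ξ - η‖ * g η) ξ =
        ∫ η, g η • ((2 * Real.pi * ‖ξ - η‖ ^ 2)⁻¹ • (ξ - η)) := by
    intro ξ
    refine ext_inner_left ℝ fun v => ?_
    rw [← integral_inner (hintv ξ) v, real_inner_comm, gradient, InnerProductSpace.toDual_symm_apply,
      (hD ξ).fderiv, ContinuousLinearMap.integral_apply (hint ξ) v]
    refine integral_congr_ae (Eventually.of_forall fun η => ?_)
    simp only [_root_.smul_apply, innerSL_apply_apply, smul_eq_mul, real_inner_smul_right, mul_inv]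
    rw [real_inner_comm (ξ - η) v]
    ring
  refine ⟨?_, fun ξ => ⟨hintv ξ, hgrad ξ⟩, ?_⟩
  · rw [contDiff_one_iff_fderiv, hfd]
    exact ⟨fun ξ => (hD ξ).differentiableAt, hcont⟩
  · obtain ⟨C₁, -, hC₁⟩ := abs_logPotential_le hg0
    obtain ⟨M, hM⟩ := gain_exists_integral_norm_le hg hg0
    refine ⟨max C₁ M, fun ξ => ⟨?_, ?_⟩⟩
    · have hl : 0 ≤ 1 + Real.log (1 + ‖ξ‖) := by
        have := Real.log_nonneg (by linarith [norm_nonneg ξ] : (1:ℝ) ≤ 1 + ‖ξ‖)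
        linarith
      exact (hC₁ ξ).trans (mul_le_mul_of_nonneg_right (le_max_left _ _) hl)
    · rw [hgrad ξ]
      exact (norm_integral_le_integral_norm _).trans ((hM ξ).trans (le_max_right _ _))

end Literature.Analysis.GaussianVortexArnold.StretchedVortexRows

end Part3

/-!
## Part 4 — port of `Summits/NavierStokesRegularity/NavierStokesRegularity/Theorems/FilamentSkeletonRssCoreLinearInvertibilityArnoldHighModesToolsA.lean` (7 declarations kept)

# Tools for stub `stub_arnoldHighModes` (crux `CoreLinearInvertibility`,
# stmt-NavierStokesRegularity-17973, route `FilamentSkeletonRss`, line `Sketch`) — part A: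
# the logarithmic energy identity for a CONTINUOUS neutral Gaussian-bounded density

For a continuous density `g` on `ℝ² = EuclideanSpace ℝ (Fin 2)` with `|g(η)| ≤ B e^{−‖η‖²/8}` and
`∫ g = 0`, and its logarithmic potential `ψ = N ∗ g`, `N = (2π)⁻¹ log ‖·‖`:

* `ψ ∈ C¹` with `∇ψ(ξ) = ∫ g(η) DN(ξ − η) dη` — the derivative is GAINED from the kernel for a
  merely measurable bounded density (landed `logPotential_gain`), so no differentiability of `g`
  is needed anywhere below;
* the weak Poisson equation `∫ ⟪∇ψ, ∇φ⟫ = −∫ g φ` for `φ ∈ C¹_c` (Fubini and the gradient-form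
  Green identity `∫ ⟪DN(ξ − η), ∇φ(ξ)⟫ dξ = −φ(η)`, landed `integral_gradLogKernel_inner_gradient`);
* neutrality ⇒ `‖∇ψ(ξ)‖ ≤ C/(1 + ‖ξ‖)²` (landed `norm_gradLogConv_le`), hence `‖∇ψ‖² ∈ L¹`;
  `ψ g ∈ L¹`;
* **the energy identity `∫ ‖∇ψ‖² = −∫ ψ g`** by the cut-off argument of the landed
  `integral_norm_gradient_sq_eq` (which is stated for `C¹` densities): test the weak equation
  against `χ_n ψ` and pass to the limit by dominated convergence.

Everything is adapted from `…StubLogPotentialGreen` / `…StubLogPotentialEnergy` (AnomalousDissipation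
toolkit), with the `C¹` gradient formula replaced by the gained one.

References: Th. Gallay, V. Šverák, arXiv:2110.13739, §2 (2.6)–(2.8) (the energy of an `X₀`
density); folklore potential theory.
-/

section Part4

namespace Literature.Analysis.GaussianVortexArnold

open _root_.Set _root_.Function _root_.Filter _root_.MeasureTheory _root_.Topology _root_.Metric WithLp
open Literature.Analysis.FluidPDE
open Literature.Analysis.GaussianVortexArnold.StretchedVortexRows
open scoped _root_.InnerProductSpace RealInnerProductSpace

/-- **The weak Poisson equation for the logarithmic potential of a CONTINUOUS Gaussian-bounded
density**: `∫ ⟪∇ψ, ∇φ⟫ = −∫ g φ` for every `φ ∈ C¹_c(ℝ²)` (gained gradient formula, Fubini, and the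
gradient-form Green identity). [folklore]
[cite: GallaySverak2021, §2 proof of Thm 2.5, the modes |n| ≥ 2 (source of the ARGUMENT implemented; this declaration is the cell’s own lemma, NOT a printed statement)] -/
theorem highModes_weak_poisson {B : ℝ} {g : EuclideanSpace ℝ (Fin 2) → ℝ} (hgc : Continuous g)
    (hg0 : ∀ η, |g η| ≤ B * Real.exp (-(1 / 8) * ‖η‖ ^ 2))
    {φ : EuclideanSpace ℝ (Fin 2) → ℝ} (hφ : ContDiff ℝ 1 φ) (hφc : HasCompactSupport φ) :
    ∫ ξ, ⟪gradient (fun ξ : EuclideanSpace ℝ (Fin 2) => ∫ η, (2 * Real.pi)⁻¹ * Real.log ‖ξ - η‖ * g η) ξ,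
        gradient φ ξ⟫ = -∫ η, g η * φ η := by
  -- adapted from `integral_inner_gradient_logPotential_gradient` (AnomalousDissipation toolkit)
  have hgrad := (logPotential_gain B g hgc.measurable hg0).2.1
  have hφg : Continuous (gradient φ) :=
    (InnerProductSpace.toDual ℝ (EuclideanSpace ℝ (Fin 2))).symm.continuous.comp (hφ.continuous_fderiv one_ne_zero)
  -- Step 1: the pairing as an iterated integral
  have h1 : ∀ ξ, ⟪gradient (fun ξ : EuclideanSpace ℝ (Fin 2) => ∫ η, (2 * Real.pi)⁻¹ * Real.log ‖ξ - η‖ * g η) ξ,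
      gradient φ ξ⟫ = ∫ η, g η * ((2 * Real.pi * ‖ξ - η‖ ^ 2)⁻¹ * ⟪gradient φ ξ, ξ - η⟫) := by
    intro ξ
    obtain ⟨hint, hgr⟩ := hgrad ξ
    rw [hgr, real_inner_comm, ← integral_inner hint]
    refine integral_congr_ae (Eventually.of_forall fun η => ?_)
    simp only [real_inner_smul_right]
  simp_rw [h1]
  -- Step 2: Fubini
  set F : EuclideanSpace ℝ (Fin 2) → EuclideanSpace ℝ (Fin 2) → ℝ := fun ξ η =>
    g η * ((2 * Real.pi * ‖ξ - η‖ ^ 2)⁻¹ * ⟪gradient φ ξ, ξ - η⟫) with hF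
  have hFmeas : Measurable (uncurry F) := by
    refine (hgc.measurable.comp measurable_snd).mul ((Measurable.inv ?_).mul ?_)
    · exact measurable_const.mul ((measurable_fst.sub measurable_snd).norm.pow_const 2)
    · exact ((hφg.comp continuous_fst).inner (continuous_fst.sub continuous_snd)).measurable
  have hFm : AEStronglyMeasurable (uncurry F)
      ((volume : Measure (EuclideanSpace ℝ (Fin 2))).prod (volume : Measure (EuclideanSpace ℝ (Fin 2)))) :=
    hFmeas.aestronglyMeasurable
  have hnormF : ∀ ξ η, ‖F ξ η‖ ≤ ‖g η • ((2 * Real.pi * ‖ξ - η‖ ^ 2)⁻¹ • (ξ - η))‖ * ‖gradient φ ξ‖ := by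
    intro ξ η
    simp only [hF, norm_mul, norm_smul]
    have := abs_real_inner_le_norm (gradient φ ξ) (ξ - η)
    rw [Real.norm_eq_abs, Real.norm_eq_abs, Real.norm_eq_abs]
    calc |g η| * (|(2 * Real.pi * ‖ξ - η‖ ^ 2)⁻¹| * |⟪gradient φ ξ, ξ - η⟫|)
        ≤ |g η| * (|(2 * Real.pi * ‖ξ - η‖ ^ 2)⁻¹| * (‖gradient φ ξ‖ * ‖ξ - η‖)) := by gcongr
      _ = _ := by ring
  have hrow : ∀ ξ, Integrable (F ξ) := fun ξ =>
    (((integrable_smul_gradLogKernel hgc hg0 ξ).norm.mul_const ‖gradient φ ξ‖)).mono'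
      (hFmeas.comp (measurable_const.prodMk measurable_id)).aestronglyMeasurable
      (Eventually.of_forall (hnormF ξ))
  obtain ⟨M, hM⟩ := exists_integral_norm_smul_gradLogKernel_le hg0 hgc
  have hgradc : HasCompactSupport (gradient φ) :=
    (hφc.fderiv (𝕜 := ℝ)).comp_left
      (g := fun L => (InnerProductSpace.toDual ℝ (EuclideanSpace ℝ (Fin 2))).symm L) (map_zero _)
  have hbd : Integrable fun ξ : EuclideanSpace ℝ (Fin 2) => M * ‖gradient φ ξ‖ :=
    (hφg.norm.integrable_of_hasCompactSupport hgradc.norm).const_mul M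
  have hrowbd : ∀ ξ, ∫ η, ‖F ξ η‖ ≤ M * ‖gradient φ ξ‖ := by
    intro ξ
    calc ∫ η, ‖F ξ η‖ ≤ ∫ η, ‖g η • ((2 * Real.pi * ‖ξ - η‖ ^ 2)⁻¹ • (ξ - η))‖ * ‖gradient φ ξ‖ :=
          integral_mono (hrow ξ).norm
            ((integrable_smul_gradLogKernel hgc hg0 ξ).norm.mul_const _) (hnormF ξ)
      _ = (∫ η, ‖g η • ((2 * Real.pi * ‖ξ - η‖ ^ 2)⁻¹ • (ξ - η))‖) * ‖gradient φ ξ‖ := integral_mul_const _ _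
      _ ≤ M * ‖gradient φ ξ‖ := mul_le_mul_of_nonneg_right (hM ξ) (norm_nonneg _)
  have hGi : Integrable (uncurry F)
      ((volume : Measure (EuclideanSpace ℝ (Fin 2))).prod (volume : Measure (EuclideanSpace ℝ (Fin 2)))) := by
    rw [integrable_prod_iff hFm]
    refine ⟨Eventually.of_forall hrow, hbd.mono' hFm.norm.integral_prod_right' (Eventually.of_forall fun ξ => ?_)⟩
    rw [Real.norm_of_nonneg (integral_nonneg fun η => norm_nonneg _)]
    exact hrowbd ξ
  rw [integral_integral_swap hGi]
  -- Step 3: the inner integral is `−g(η) φ(η)` by the Green identity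
  have h3 : ∀ η, ∫ ξ, F ξ η = -(g η * φ η) := fun η => by
    simp only [hF]
    rw [integral_const_mul, integral_gradLogKernel_inner_gradient hφ hφc η]
    ring
  simp_rw [h3]
  rw [integral_neg]

/-- `ψ ∈ C¹` and `∇ψ` is continuous (derivative gained from the kernel). [folklore]
[cite: GallaySverak2021, §2 proof of Thm 2.5, the modes |n| ≥ 2 (source of the ARGUMENT implemented; this declaration is the cell’s own lemma, NOT a printed statement)] -/
theorem highModes_contDiff_and_continuous_gradient {B : ℝ} {g : EuclideanSpace ℝ (Fin 2) → ℝ} (hgc : Continuous g)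
    (hg0 : ∀ η, |g η| ≤ B * Real.exp (-(1 / 8) * ‖η‖ ^ 2))
    {ψ : EuclideanSpace ℝ (Fin 2) → ℝ}
    (hψ : ψ = fun ξ : EuclideanSpace ℝ (Fin 2) => ∫ η, (2 * Real.pi)⁻¹ * Real.log ‖ξ - η‖ * g η) :
    ContDiff ℝ 1 ψ ∧ Continuous (gradient ψ) := by
  have hC1 : ContDiff ℝ 1 ψ := by rw [hψ]; exact (logPotential_gain B g hgc.measurable hg0).1
  exact ⟨hC1, (InnerProductSpace.toDual ℝ (EuclideanSpace ℝ (Fin 2))).symm.continuous.comp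
    (hC1.continuous_fderiv one_ne_zero)⟩

/-- **Gradient decay from neutrality**: `‖∇ψ(ξ)‖ ≤ C/(1 + ‖ξ‖)²`. [folklore]
[cite: GallaySverak2021, §2 proof of Thm 2.5, the modes |n| ≥ 2 (source of the ARGUMENT implemented; this declaration is the cell’s own lemma, NOT a printed statement)] -/
theorem highModes_gradient_decay {B : ℝ} {g : EuclideanSpace ℝ (Fin 2) → ℝ} (hgc : Continuous g)
    (hg0 : ∀ η, |g η| ≤ B * Real.exp (-(1 / 8) * ‖η‖ ^ 2)) (hneutral : ∫ η, g η = 0)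
    {ψ : EuclideanSpace ℝ (Fin 2) → ℝ}
    (hψ : ψ = fun ξ : EuclideanSpace ℝ (Fin 2) => ∫ η, (2 * Real.pi)⁻¹ * Real.log ‖ξ - η‖ * g η) :
    ∃ C : ℝ, ∀ ξ, ‖gradient ψ ξ‖ ≤ C / (1 + ‖ξ‖) ^ 2 := by
  obtain ⟨C, hC⟩ := norm_gradLogConv_le hgc hg0 hneutral
  refine ⟨C, fun ξ => ?_⟩
  rw [hψ, ((logPotential_gain B g hgc.measurable hg0).2.1 ξ).2]
  exact hC ξ

/-- **`‖∇ψ‖² ∈ L¹(ℝ²)`** for a neutral density (`‖∇ψ‖ ≤ C/(1+‖ξ‖)²`). [folklore]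
[cite: GallaySverak2021, §2 proof of Thm 2.5, the modes |n| ≥ 2 (source of the ARGUMENT implemented; this declaration is the cell’s own lemma, NOT a printed statement)] -/
theorem highModes_integrable_norm_gradient_sq {B : ℝ} {g : EuclideanSpace ℝ (Fin 2) → ℝ} (hgc : Continuous g)
    (hg0 : ∀ η, |g η| ≤ B * Real.exp (-(1 / 8) * ‖η‖ ^ 2)) (hneutral : ∫ η, g η = 0)
    {ψ : EuclideanSpace ℝ (Fin 2) → ℝ}
    (hψ : ψ = fun ξ : EuclideanSpace ℝ (Fin 2) => ∫ η, (2 * Real.pi)⁻¹ * Real.log ‖ξ - η‖ * g η) :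
    Integrable fun ξ => ‖gradient ψ ξ‖ ^ 2 := by
  -- adapted from `integrable_norm_gradient_sq` (AnomalousDissipation toolkit)
  obtain ⟨Cg, hCg⟩ := highModes_gradient_decay hgc hg0 hneutral hψ
  obtain ⟨-, hgradc⟩ := highModes_contDiff_and_continuous_gradient hgc hg0 hψ
  have hJ : Integrable fun x : EuclideanSpace ℝ (Fin 2) => (1 + ‖x‖) ^ (-(4:ℝ)) :=
    integrable_one_add_norm (by rw [finrank_euclideanSpace_fin]; norm_num)
  refine (hJ.const_mul (Cg ^ 2)).mono' (hgradc.norm.pow 2).aestronglyMeasurable (Eventually.of_forall fun ξ => ?_)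
  rw [Real.norm_of_nonneg (sq_nonneg _)]
  have hpos : 0 < 1 + ‖ξ‖ := by positivity
  have h4 : (1 + ‖ξ‖) ^ (-(4:ℝ)) = ((1 + ‖ξ‖) ^ 4)⁻¹ := by
    rw [Real.rpow_neg hpos.le, ← Real.rpow_natCast]; norm_num
  rw [h4]
  calc ‖gradient ψ ξ‖ ^ 2 ≤ (Cg / (1 + ‖ξ‖) ^ 2) ^ 2 := pow_le_pow_left₀ (norm_nonneg _) (hCg ξ) 2
    _ = Cg ^ 2 * ((1 + ‖ξ‖) ^ 4)⁻¹ := by field_simp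

/-- **`ψ g ∈ L¹(ℝ²)`** (`|ψ| ≤ C(1 + log(1+‖ξ‖)) ≤ C(1+‖ξ‖)`, `|g| ≤ B e^{−‖ξ‖²/8}`). [folklore]
[cite: GallaySverak2021, §2 proof of Thm 2.5, the modes |n| ≥ 2 (source of the ARGUMENT implemented; this declaration is the cell’s own lemma, NOT a printed statement)] -/
theorem highModes_integrable_logPotential_mul {B : ℝ} {g : EuclideanSpace ℝ (Fin 2) → ℝ} (hgc : Continuous g)
    (hg0 : ∀ η, |g η| ≤ B * Real.exp (-(1 / 8) * ‖η‖ ^ 2))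
    {ψ : EuclideanSpace ℝ (Fin 2) → ℝ}
    (hψ : ψ = fun ξ : EuclideanSpace ℝ (Fin 2) => ∫ η, (2 * Real.pi)⁻¹ * Real.log ‖ξ - η‖ * g η) :
    Integrable fun ξ => ψ ξ * g ξ := by
  -- adapted from `integrable_logPotential_mul` (AnomalousDissipation toolkit)
  obtain ⟨Cψ, hCψ0, hCψ⟩ : ∃ C : ℝ, 0 ≤ C ∧ ∀ ξ, |ψ ξ| ≤ C * (1 + Real.log (1 + ‖ξ‖)) := by
    rw [hψ]; exact abs_logPotential_le hg0
  obtain ⟨hC1, -⟩ := highModes_contDiff_and_continuous_gradient hgc hg0 hψ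
  refine ((integrable_one_add_norm_pow_mul_exp_eighth 1).const_mul (Cψ * B)).mono'
    (hC1.continuous.mul hgc).aestronglyMeasurable (Eventually.of_forall fun ξ => ?_)
  rw [Real.norm_eq_abs, abs_mul]
  have hlog : Real.log (1 + ‖ξ‖) ≤ ‖ξ‖ := by
    have := Real.log_le_sub_one_of_pos (by positivity : (0:ℝ) < 1 + ‖ξ‖); linarith
  have hL : 0 ≤ Real.log (1 + ‖ξ‖) := Real.log_nonneg (by linarith [norm_nonneg ξ])
  calc |ψ ξ| * |g ξ| ≤ Cψ * (1 + Real.log (1 + ‖ξ‖)) * (B * Real.exp (-(1 / 8) * ‖ξ‖ ^ 2)) :=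
        mul_le_mul (hCψ ξ) (hg0 ξ) (abs_nonneg _) (by positivity)
    _ ≤ Cψ * (1 + ‖ξ‖) ^ 1 * (B * Real.exp (-(1 / 8) * ‖ξ‖ ^ 2)) := by
        gcongr
        · exact (abs_nonneg _).trans (hg0 ξ)
        · rw [pow_one]; linarith
    _ = Cψ * B * ((1 + ‖ξ‖) ^ 1 * Real.exp (-(1 / 8) * ‖ξ‖ ^ 2)) := by ring

/-- **The energy identity `∫ ‖∇ψ‖² = −∫ ψ g`** for a CONTINUOUS neutral Gaussian-bounded density
(cut-off argument on the weak Poisson equation). [folklore]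
[cite: GallaySverak2021, §2 proof of Thm 2.5, the modes |n| ≥ 2 (source of the ARGUMENT implemented; this declaration is the cell’s own lemma, NOT a printed statement)] -/
theorem highModes_integral_norm_gradient_sq_eq {B : ℝ} {g : EuclideanSpace ℝ (Fin 2) → ℝ} (hgc : Continuous g)
    (hg0 : ∀ η, |g η| ≤ B * Real.exp (-(1 / 8) * ‖η‖ ^ 2)) (hneutral : ∫ η, g η = 0)
    {ψ : EuclideanSpace ℝ (Fin 2) → ℝ}
    (hψ : ψ = fun ξ : EuclideanSpace ℝ (Fin 2) => ∫ η, (2 * Real.pi)⁻¹ * Real.log ‖ξ - η‖ * g η) :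
    ∫ ξ, ‖gradient ψ ξ‖ ^ 2 = -∫ ξ, ψ ξ * g ξ := by
  -- adapted from `integral_norm_gradient_sq_eq` (AnomalousDissipation toolkit)
  obtain ⟨hC1, hgradc⟩ := highModes_contDiff_and_continuous_gradient hgc hg0 hψ
  have hψd : Differentiable ℝ ψ := hC1.differentiable one_ne_zero
  obtain ⟨Cψ, hCψ0, hCψ⟩ : ∃ C : ℝ, 0 ≤ C ∧ ∀ ξ, |ψ ξ| ≤ C * (1 + Real.log (1 + ‖ξ‖)) := by
    rw [hψ]; exact abs_logPotential_le hg0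
  obtain ⟨Cg, hCg⟩ := highModes_gradient_decay hgc hg0 hneutral hψ
  have hCg0 : 0 ≤ Cg := by
    have h := (norm_nonneg _).trans (hCg 0)
    simpa using h
  have hweak : ∀ φ : EuclideanSpace ℝ (Fin 2) → ℝ, ContDiff ℝ 1 φ → HasCompactSupport φ →
      ∫ ξ, ⟪gradient ψ ξ, gradient φ ξ⟫ = -∫ η, g η * φ η := by
    rw [hψ]; exact fun φ hφ hφc => highModes_weak_poisson hgc hg0 hφ hφc
  have hI1 := highModes_integrable_norm_gradient_sq hgc hg0 hneutral hψ
  have hI2 := highModes_integrable_logPotential_mul hgc hg0 hψ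
  have hgi : ∀ (f : EuclideanSpace ℝ (Fin 2) → ℝ) (ξ v : EuclideanSpace ℝ (Fin 2)),
      fderiv ℝ f ξ v = ⟪gradient f ξ, v⟫ := fun f ξ v => by
    rw [gradient, InnerProductSpace.toDual_symm_apply]
  -- the cut-offs `c n = χ(·/(n+1))`
  obtain ⟨χ, M, hχ, hχc, h1, h0, h01, hM⟩ := exists_bump
  have hM0 : 0 ≤ M := (norm_nonneg _).trans (hM 0)
  have hRn : ∀ n : ℕ, (1:ℝ) ≤ (n:ℝ) + 1 := fun n => by
    have := n.cast_nonneg (α := ℝ); linarith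
  obtain ⟨c, hc⟩ : ∃ c : ℕ → EuclideanSpace ℝ (Fin 2) → ℝ,
      c = fun (n : ℕ) (x : EuclideanSpace ℝ (Fin 2)) => χ ((((n:ℝ) + 1)⁻¹) • x) := ⟨_, rfl⟩
  have hcp : ∀ n : ℕ, ContDiff ℝ 1 (c n) ∧ HasCompactSupport (c n) ∧
      (∀ x, ‖x‖ < (n:ℝ) + 1 → c n x = 1) ∧ (∀ x, ‖x‖ < (n:ℝ) + 1 → fderiv ℝ (c n) x = 0) ∧
      ∀ x, ‖fderiv ℝ (c n) x‖ ≤ 4 * M / (1 + ‖x‖) := by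
    intro n
    have e : c n = fun x : EuclideanSpace ℝ (Fin 2) => χ ((((n:ℝ) + 1)⁻¹) • x) := by rw [hc]
    rw [e]
    exact scaledCutoff_props hχ hχc h1 h0 hM (hRn n)
  have hc01 : ∀ n x, 0 ≤ c n x ∧ c n x ≤ 1 := fun n x => by rw [hc]; exact h01 _
  -- eventually `‖ξ‖ < n + 1`
  have hev : ∀ ξ : EuclideanSpace ℝ (Fin 2), ∀ᶠ n : ℕ in atTop, ‖ξ‖ < (n:ℝ) + 1 := fun ξ => by
    refine (eventually_ge_atTop ⌈‖ξ‖⌉₊).mono fun n hn => ?_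
    have h1 := Nat.le_ceil ‖ξ‖
    have h2 : (⌈‖ξ‖⌉₊ : ℝ) ≤ n := Nat.cast_le.2 hn
    linarith
  -- the dominating function of the error term
  have hJ : Integrable fun x : EuclideanSpace ℝ (Fin 2) => (8 * M * Cψ * Cg) * (1 + ‖x‖) ^ (-(5 / 2 : ℝ)) :=
    (integrable_one_add_norm (by rw [finrank_euclideanSpace_fin]; norm_num)).const_mul _
  have hEbd : ∀ n ξ, ‖ψ ξ * ⟪gradient (c n) ξ, gradient ψ ξ⟫‖ ≤ (8 * M * Cψ * Cg) * (1 + ‖ξ‖) ^ (-(5 / 2 : ℝ)) := by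
    intro n ξ
    rw [norm_mul, Real.norm_eq_abs]
    have hin := abs_real_inner_le_norm (gradient (c n) ξ) (gradient ψ ξ)
    have hgn : ‖gradient (c n) ξ‖ ≤ 4 * M / (1 + ‖ξ‖) := by
      rw [gradient, LinearIsometryEquiv.norm_map]; exact (hcp n).2.2.2.2 ξ
    have hL : 0 ≤ 1 + Real.log (1 + ‖ξ‖) := by
      have := Real.log_nonneg (by linarith [norm_nonneg ξ] : (1:ℝ) ≤ 1 + ‖ξ‖); linarith
    have hw := log_weight_le_rpow ξ
    have hpos : 0 < 1 + ‖ξ‖ := by positivity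
    calc |ψ ξ| * ‖⟪gradient (c n) ξ, gradient ψ ξ⟫‖
        ≤ (Cψ * (1 + Real.log (1 + ‖ξ‖))) * ((4 * M / (1 + ‖ξ‖)) * (Cg / (1 + ‖ξ‖) ^ 2)) := by
          refine mul_le_mul (hCψ ξ) (hin.trans (mul_le_mul hgn (hCg ξ) (norm_nonneg _) (by positivity)))
            (norm_nonneg _) (by positivity)
      _ = (4 * M * Cψ * Cg) * ((1 + Real.log (1 + ‖ξ‖)) * ((1 + ‖ξ‖)⁻¹ * ((1 + ‖ξ‖) ^ 2)⁻¹)) := by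
          field_simp
      _ ≤ (4 * M * Cψ * Cg) * (2 * (1 + ‖ξ‖) ^ (-(5 / 2 : ℝ))) :=
          mul_le_mul_of_nonneg_left hw (by positivity)
      _ = _ := by ring
  have hEm : ∀ n, AEStronglyMeasurable (fun ξ => ψ ξ * ⟪gradient (c n) ξ, gradient ψ ξ⟫) volume := by
    intro n
    have hgc' : Continuous (gradient (c n)) :=
      (InnerProductSpace.toDual ℝ (EuclideanSpace ℝ (Fin 2))).symm.continuous.comp
        ((hcp n).1.continuous_fderiv one_ne_zero)
    exact (hC1.continuous.mul (hgc'.inner hgradc)).aestronglyMeasurable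
  have hiE : ∀ n, Integrable fun ξ => ψ ξ * ⟪gradient (c n) ξ, gradient ψ ξ⟫ := fun n =>
    hJ.mono' (hEm n) (Eventually.of_forall (hEbd n))
  have hiA : ∀ n, Integrable fun ξ => c n ξ * ‖gradient ψ ξ‖ ^ 2 := fun n =>
    hI1.mono' (((hcp n).1.continuous.mul (hgradc.norm.pow 2)).aestronglyMeasurable)
      (Eventually.of_forall fun ξ => by
        rw [norm_mul, Real.norm_eq_abs, abs_of_nonneg (hc01 n ξ).1, Real.norm_of_nonneg (sq_nonneg _)]
        exact mul_le_of_le_one_left (sq_nonneg _) (hc01 n ξ).2)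
  -- the identity for every `n`
  have hid : ∀ n : ℕ, (∫ ξ, c n ξ * ‖gradient ψ ξ‖ ^ 2) + ∫ ξ, ψ ξ * ⟪gradient (c n) ξ, gradient ψ ξ⟫ =
      -∫ ξ, g ξ * (c n ξ * ψ ξ) := by
    intro n
    have hφd : ContDiff ℝ 1 (fun x => c n x * ψ x) := (hcp n).1.mul hC1
    have hφc : HasCompactSupport (fun x => c n x * ψ x) := (hcp n).2.1.mul_right
    have hpt : ∀ ξ, ⟪gradient ψ ξ, gradient (fun x => c n x * ψ x) ξ⟫ =
        c n ξ * ‖gradient ψ ξ‖ ^ 2 + ψ ξ * ⟪gradient (c n) ξ, gradient ψ ξ⟫ := by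
      intro ξ
      rw [real_inner_comm, ← hgi, fderiv_fun_mul (((hcp n).1.differentiable one_ne_zero) ξ) (hψd ξ),
        _root_.add_apply, FunLike.coe_smul, FunLike.coe_smul, Pi.smul_apply, Pi.smul_apply, smul_eq_mul,
        smul_eq_mul, hgi ψ, hgi (c n), real_inner_self_eq_norm_sq]
    rw [← integral_add (hiA n) (hiE n), ← hweak _ hφd hφc]
    exact integral_congr_ae (Eventually.of_forall fun ξ => (hpt ξ).symm)
  -- the three limits
  have hA : Tendsto (fun n : ℕ => ∫ ξ, c n ξ * ‖gradient ψ ξ‖ ^ 2) atTop (𝓝 (∫ ξ, ‖gradient ψ ξ‖ ^ 2)) := by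
    refine tendsto_integral_of_dominated_convergence (fun ξ => ‖gradient ψ ξ‖ ^ 2)
      (fun n => ((hcp n).1.continuous.mul (hgradc.norm.pow 2)).aestronglyMeasurable) hI1
      (fun n => Eventually.of_forall fun ξ => ?_) (Eventually.of_forall fun ξ => ?_)
    · rw [norm_mul, Real.norm_eq_abs, abs_of_nonneg (hc01 n ξ).1, Real.norm_of_nonneg (sq_nonneg _)]
      exact mul_le_of_le_one_left (sq_nonneg _) (hc01 n ξ).2
    · refine tendsto_const_nhds.congr' ?_
      filter_upwards [hev ξ] with n hn
      rw [(hcp n).2.2.1 ξ hn, one_mul]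
  have hG : Tendsto (fun n : ℕ => ∫ ξ, g ξ * (c n ξ * ψ ξ)) atTop (𝓝 (∫ ξ, ψ ξ * g ξ)) := by
    refine tendsto_integral_of_dominated_convergence (fun ξ => ‖ψ ξ * g ξ‖)
      (fun n => (hgc.mul ((hcp n).1.continuous.mul hC1.continuous)).aestronglyMeasurable) hI2.norm
      (fun n => Eventually.of_forall fun ξ => ?_) (Eventually.of_forall fun ξ => ?_)
    · rw [norm_mul, norm_mul, norm_mul, Real.norm_eq_abs (c n ξ), abs_of_nonneg (hc01 n ξ).1]
      calc ‖g ξ‖ * (c n ξ * ‖ψ ξ‖) ≤ ‖g ξ‖ * (1 * ‖ψ ξ‖) := by gcongr; exact (hc01 n ξ).2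
        _ = ‖ψ ξ‖ * ‖g ξ‖ := by ring
    · refine tendsto_const_nhds.congr' ?_
      filter_upwards [hev ξ] with n hn
      rw [(hcp n).2.2.1 ξ hn, one_mul, mul_comm]
  have hE : Tendsto (fun n : ℕ => ∫ ξ, ψ ξ * ⟪gradient (c n) ξ, gradient ψ ξ⟫) atTop (𝓝 0) := by
    have h := tendsto_integral_of_dominated_convergence (fun ξ => (8 * M * Cψ * Cg) * (1 + ‖ξ‖) ^ (-(5 / 2 : ℝ)))
      hEm hJ (fun n => Eventually.of_forall (hEbd n))
      (Eventually.of_forall fun ξ => (?_ :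
        Tendsto (fun n : ℕ => ψ ξ * ⟪gradient (c n) ξ, gradient ψ ξ⟫) atTop (𝓝 0)))
    · simpa using h
    · refine tendsto_const_nhds.congr' ?_
      filter_upwards [hev ξ] with n hn
      rw [gradient, (hcp n).2.2.2.1 ξ hn, map_zero, inner_zero_left, mul_zero]
  have hlim1 := hA.add hE
  have hlim2 : Tendsto (fun n : ℕ => (∫ ξ, c n ξ * ‖gradient ψ ξ‖ ^ 2) +
      ∫ ξ, ψ ξ * ⟪gradient (c n) ξ, gradient ψ ξ⟫) atTop (𝓝 (-(∫ ξ, ψ ξ * g ξ))) := by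
    simp_rw [hid]
    exact hG.neg
  have := tendsto_nhds_unique hlim1 hlim2
  rwa [add_zero] at this

/-! ### The registered tools stub -/

/-- **Registered tools stub `stub_arnoldHighModesToolsA`** (helpers for `stub_arnoldHighModes`, line
`Sketch` of crux `CoreLinearInvertibility`, stmt-NavierStokesRegularity-17973): for a CONTINUOUS
density `g` with `|g| ≤ B e^{−‖η‖²/8}` and `∫ g = 0`, the logarithmic potential `ψ = N ∗ g`
(`N = (2π)⁻¹ log ‖·‖`) is `C¹` with `‖∇ψ(ξ)‖ ≤ C/(1+‖ξ‖)²`, `‖∇ψ‖² ∈ L¹`, `ψ g ∈ L¹`, and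
`∫ ‖∇ψ‖² = −∫ ψ g`. [folklore]
[cite: GallaySverak2021, §2 proof of Thm 2.5, the modes |n| ≥ 2 (source of the ARGUMENT implemented; this declaration is the cell’s own lemma, NOT a printed statement)] -/
theorem stub_arnoldHighModesToolsA :
    ∀ (B : ℝ) (g : EuclideanSpace ℝ (Fin 2) → ℝ), Continuous g →
      (∀ η, |g η| ≤ B * Real.exp (-(1 / 8) * ‖η‖ ^ 2)) → (∫ η, g η = 0) →
      ∀ ψ : EuclideanSpace ℝ (Fin 2) → ℝ,
        ψ = (fun ξ : EuclideanSpace ℝ (Fin 2) => ∫ η, (2 * Real.pi)⁻¹ * Real.log ‖ξ - η‖ * g η) →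
        ContDiff ℝ 1 ψ ∧ (∃ C : ℝ, ∀ ξ, ‖gradient ψ ξ‖ ≤ C / (1 + ‖ξ‖) ^ 2) ∧
        Integrable (fun ξ => ‖gradient ψ ξ‖ ^ 2) ∧ Integrable (fun ξ => ψ ξ * g ξ) ∧
          ∫ ξ, ‖gradient ψ ξ‖ ^ 2 = -∫ ξ, ψ ξ * g ξ :=
  fun _ _ hgc hg0 hneutral _ hψ =>
    ⟨(highModes_contDiff_and_continuous_gradient hgc hg0 hψ).1, highModes_gradient_decay hgc hg0 hneutral hψ,
      highModes_integrable_norm_gradient_sq hgc hg0 hneutral hψ,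
      highModes_integrable_logPotential_mul hgc hg0 hψ,
      highModes_integral_norm_gradient_sq_eq hgc hg0 hneutral hψ⟩

end Literature.Analysis.GaussianVortexArnold

end Part4

/-!
## Part 5 — port of `Summits/AnomalousDissipation/AnomalousDissipation/Theorems/MarginalStabilityChainStretchedVortexRowsStubHardyWirtingerEven.lean` (2 declarations kept)

# Helper `hardyWirtinger_even` toward stub `stub_coreInverse` of the line `braid-closed-large-circulation-gluing`
# (crux stmt-AnomalousDissipation-3009, `MarginalStabilityChain.StretchedVortexRows`)

The **Hardy–Wirtinger inequality** `∫ φ²/|ξ|² ≤ ¼ ∫ |∇φ|²` on `ℝ² = EuclideanSpace ℝ (Fin 2)` for `C¹` functions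
`φ` that are EVEN (`φ(−ξ) = φ(ξ)`) and have ZERO CIRCULAR MEANS (`∫₀^{2π} φ(r cos θ, r sin θ) dθ = 0` for every
`r > 0`), i.e. carry no angular Fourier modes `m ∈ {0, ±1}`; it converts the rotation energy into coercivity in the
energy method for `stub_coreInverse` (ingredient (I7) of the lead's plan). Proof, circle by circle:

* `wirtinger_periodic`: the SHARP periodic Wirtinger inequality `∫ₐᵇ g² ≤ ((b−a)/2π)² ∫ₐᵇ g'²` for `g ∈ C¹(ℝ)` with
  `g a = g b` and `∫ₐᵇ g = 0`, by Parseval on `(a, b]` (Mathlib `hasSum_sq_fourierCoeffOn`) and the integration by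
  parts formula `ĝ(n) = (b−a)/(2πin) · ĝ'(n)` (`fourierCoeffOn_of_hasDerivAt`, no boundary term since `g a = g b`),
  `ĝ(0) = 0` by the zero mean, and the termwise bound `|ĝ(n)|² ≤ ((b−a)/2π)² |ĝ'(n)|²`.
* `integral_sq_circle_le`: on the circle of radius `r`, `g(θ) = φ(r cos θ, r sin θ)` is `π`-PERIODIC by evenness, has
  zero mean on `[0, π]` and `[−π, 0]` (half of the vanishing `2π`-mean), so Wirtinger with `b − a = π` on both half
  periods gives `∫_{−π}^{π} g² ≤ ¼ ∫_{−π}^{π} g'²`, and `g'(θ) = ⟪∇φ(ξ), ξ^⊥⟫`, `|g'| ≤ r |∇φ(ξ)|` (chain rule and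
  Cauchy–Schwarz): `∫_{−π}^{π} φ(γ_r)² ≤ (r²/4) ∫_{−π}^{π} |∇φ(γ_r)|²`.
* `lintegral_eq_lintegral_polar`: polar coordinates for lower Lebesgue integrals on `EuclideanSpace ℝ (Fin 2)`
  (Mathlib `lintegral_comp_polarCoord_symm` transported along the volume-preserving `ℝ² ≃ ℝ × ℝ`, then Tonelli).
* assembly: `∫⁻ φ²/|ξ|² = ∫₀^∞ (∫ g_r² dθ) r⁻¹ dr ≤ ∫₀^∞ (r/4) ∫ |∇φ(γ_r)|² dθ dr = ∫⁻ |∇φ|²/4 < ∞`, which gives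
  both the integrability of `φ²/|ξ|²` and the inequality (lower integrals first, so no circularity).

References: G. H. Hardy, J. E. Littlewood, G. Pólya, *Inequalities*, Thm. 258 (Wirtinger); Th. Gallay, C. E. Wayne,
Comm. Math. Phys. 255 (2005) §4; Th. Gallay, Y. Maekawa, arXiv:1610.08384 §4.1.

Not carried from this source module (not needed by the declarations re-homed here; their consumers are Summits-side): `integral_sq_circle_le`, `hardyWirtinger_even`.
-/

section Part5

open scoped RealInnerProductSpace _root_.Topology Laplacian _root_.ENNReal
open _root_.MeasureTheory WithLp _root_.Function _root_.Set _root_.Real intervalIntegral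

namespace Literature.Analysis.GaussianVortexArnold.StretchedVortexRows

open Literature.Analysis.FluidPDE

/-! ### The sharp periodic Wirtinger inequality -/

/-- **Wirtinger's inequality (sharp periodic form).** For `g ∈ C¹(ℝ)` with `g a = g b` and `∫ₐᵇ g = 0`:
`∫ₐᵇ g² ≤ ((b − a)/(2π))² ∫ₐᵇ g'²` — Parseval on `(a, b]` plus `ĝ(n) = (b−a)/(2πin)·ĝ'(n)` (`n ≠ 0`), `ĝ(0) = 0`. [folklore]
[cite: GallaySverak2021, §2 and §4.1 (context: potential theory of the planar Biot–Savart / logarithmic potential used in the proof of Thm 2.5; this declaration is the cell’s own lemma, NOT a printed statement)] -/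
theorem wirtinger_periodic {g : ℝ → ℝ} (hg : ContDiff ℝ 1 g) {a b : ℝ} (hab : a < b)
    (hper : g a = g b) (hmean : ∫ x in a..b, g x = 0) :
    ∫ x in a..b, g x ^ 2 ≤ ((b - a) / (2 * π)) ^ 2 * ∫ x in a..b, deriv g x ^ 2 := by
  have hd : Differentiable ℝ g := hg.differentiable (by simp)
  have hgc : Continuous g := hg.continuous
  have hdc : Continuous (deriv g) := hg.continuous_deriv (by simp)
  have hL : 0 < b - a := sub_pos.2 hab
  -- complexification
  set G : ℝ → ℂ := fun x => (g x : ℂ) with hGdef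
  set G' : ℝ → ℂ := fun x => ((deriv g x : ℝ) : ℂ) with hG'def
  have hGd : ∀ x, HasDerivAt G (G' x) x := fun x => (hd x).hasDerivAt.ofReal_comp
  have hGc : Continuous G := Complex.continuous_ofReal.comp hgc
  have hG'c : Continuous G' := Complex.continuous_ofReal.comp hdc
  -- termwise comparison of the Fourier coefficients
  have hcoef : ∀ n : ℤ, ‖fourierCoeffOn hab G n‖ ^ 2 ≤
      ((b - a) / (2 * π)) ^ 2 * ‖fourierCoeffOn hab G' n‖ ^ 2 := by
    intro n
    rcases eq_or_ne n 0 with rfl | hn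
    · have h0 : fourierCoeffOn hab G 0 = 0 := by
        rw [fourierCoeffOn_eq_integral]
        simp [G, intervalIntegral.integral_ofReal, hmean]
      rw [h0, norm_zero, zero_pow two_ne_zero]
      positivity
    · have h := fourierCoeffOn_of_hasDerivAt hab hn (fun x _ => hGd x) (hG'c.intervalIntegrable _ _)
      have hGab : G b - G a = 0 := by simp [G, hper]
      rw [hGab, mul_zero, zero_sub] at h
      have hn1 : (1 : ℝ) ≤ |(n : ℝ)| := by
        rw [← Int.cast_abs]; exact_mod_cast Int.one_le_abs hn
      have hba : ‖((b : ℂ) - a)‖ = b - a := by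
        rw [← Complex.ofReal_sub, Complex.norm_real, Real.norm_eq_abs, abs_of_pos hL]
      have key : ‖fourierCoeffOn hab G n‖ =
          (b - a) / (2 * π * |(n : ℝ)|) * ‖fourierCoeffOn hab G' n‖ := by
        rw [h, norm_mul, norm_neg, norm_mul, hba]
        simp [Complex.norm_real, abs_of_pos Real.pi_pos]
        ring
      have hle : ‖fourierCoeffOn hab G n‖ ≤ (b - a) / (2 * π) * ‖fourierCoeffOn hab G' n‖ := by
        rw [key]
        refine mul_le_mul_of_nonneg_right ?_ (norm_nonneg _)
        refine div_le_div_of_nonneg_left hL.le (by positivity) ?_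
        nlinarith [Real.pi_pos]
      calc ‖fourierCoeffOn hab G n‖ ^ 2 ≤ ((b - a) / (2 * π) * ‖fourierCoeffOn hab G' n‖) ^ 2 :=
            pow_le_pow_left₀ (norm_nonneg _) hle 2
        _ = _ := by ring
  -- Parseval on `(a, b]` for `G` and `G'`
  have hL2 : ∀ {F : ℝ → ℂ}, Continuous F → MemLp F 2 (volume.restrict (Ioc a b)) := by
    intro F hF
    refine (memLp_two_iff_integrable_sq_norm hF.aestronglyMeasurable).2 ?_
    exact (hF.norm.pow 2).integrableOn_Ioc
  have hS := hasSum_sq_fourierCoeffOn hab (hL2 hGc)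
  have hS' := (hasSum_sq_fourierCoeffOn hab (hL2 hG'c)).mul_left (((b - a) / (2 * π)) ^ 2)
  have hcmp := hasSum_le hcoef hS hS'
  have e1 : ∫ x in a..b, ‖G x‖ ^ 2 = ∫ x in a..b, g x ^ 2 := by
    refine intervalIntegral.integral_congr fun x _ => ?_
    simp [G]
  have e2 : ∫ x in a..b, ‖G' x‖ ^ 2 = ∫ x in a..b, deriv g x ^ 2 := by
    refine intervalIntegral.integral_congr fun x _ => ?_
    simp [G']
  rw [e1] at hcmp
  rw [e2] at hcmp
  simp only [smul_eq_mul] at hcmp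
  have := mul_le_mul_of_nonneg_left hcmp hL.le
  have e3 : (b - a) * ((b - a)⁻¹ * ∫ x in a..b, g x ^ 2) = ∫ x in a..b, g x ^ 2 := by
    field_simp
  have e4 : (b - a) * (((b - a) / (2 * π)) ^ 2 * ((b - a)⁻¹ * ∫ x in a..b, deriv g x ^ 2)) =
      ((b - a) / (2 * π)) ^ 2 * ∫ x in a..b, deriv g x ^ 2 := by
    field_simp
  linarith [e3, e4]

/-! ### The circle-wise bound -/

/-- **Polar coordinates on `ℝ²`, lower-integral form**: `∫⁻ f = ∫⁻_{r>0} ∫⁻_{θ∈(−π,π)} r · f(r cos θ, r sin θ)` for measurable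
`f : EuclideanSpace ℝ (Fin 2) → ℝ≥0∞` (Mathlib's `lintegral_comp_polarCoord_symm` on `ℝ × ℝ`, transported along the
volume-preserving identification `ℝ² ≃ ℝ × ℝ`, then Tonelli). [folklore]
[cite: GallaySverak2021, §2 and §4.1 (context: potential theory of the planar Biot–Savart / logarithmic potential used in the proof of Thm 2.5; this declaration is the cell’s own lemma, NOT a printed statement)] -/
theorem lintegral_eq_lintegral_polar (f : EuclideanSpace ℝ (Fin 2) → ℝ≥0∞) (hf : Measurable f) :
    ∫⁻ ξ, f ξ = ∫⁻ r in Ioi (0:ℝ), ∫⁻ θ in Ioo (-π) π,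
      ENNReal.ofReal r * f (toLp 2 ![r * Real.cos θ, r * Real.sin θ]) := by
  set T : EuclideanSpace ℝ (Fin 2) ≃ᵐ ℝ × ℝ :=
    (MeasurableEquiv.toLp 2 (Fin 2 → ℝ)).symm.trans MeasurableEquiv.finTwoArrow with hT
  have hTmp : MeasurePreserving T volume volume :=
    (EuclideanSpace.volume_preserving_symm_measurableEquiv_toLp (Fin 2)).trans
      (volume_preserving_finTwoArrow ℝ)
  have hF : Measurable fun p : ℝ × ℝ =>
      ENNReal.ofReal p.1 * f (toLp 2 ![p.1 * Real.cos p.2, p.1 * Real.sin p.2]) := by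
    have h1 : (fun p : ℝ × ℝ => (toLp 2 ![p.1 * Real.cos p.2, p.1 * Real.sin p.2] :
        EuclideanSpace ℝ (Fin 2))) = T.symm ∘ polarCoord.symm := by
      funext p
      rfl
    have h2 : Measurable fun p : ℝ × ℝ => (toLp 2 ![p.1 * Real.cos p.2, p.1 * Real.sin p.2] :
        EuclideanSpace ℝ (Fin 2)) := by
      rw [h1]; exact T.symm.measurable.comp continuous_polarCoord_symm.measurable
    exact measurable_fst.ennreal_ofReal.mul (hf.comp h2)
  calc ∫⁻ ξ, f ξ = ∫⁻ q : ℝ × ℝ, f (T.symm q) :=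
        (hTmp.symm.lintegral_comp_emb T.symm.measurableEmbedding f).symm
    _ = ∫⁻ p in polarCoord.target, ENNReal.ofReal p.1 • f (T.symm (polarCoord.symm p)) :=
        (lintegral_comp_polarCoord_symm (fun q => f (T.symm q))).symm
    _ = ∫⁻ p in Ioi (0:ℝ) ×ˢ Ioo (-π) π,
          ENNReal.ofReal p.1 * f (toLp 2 ![p.1 * Real.cos p.2, p.1 * Real.sin p.2]) := by
        rfl
    _ = ∫⁻ r in Ioi (0:ℝ), ∫⁻ θ in Ioo (-π) π,
          ENNReal.ofReal r * f (toLp 2 ![r * Real.cos θ, r * Real.sin θ]) := by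
        rw [Measure.volume_eq_prod, ← Measure.prod_restrict, lintegral_prod _ hF.aemeasurable]

/-! ### The Hardy–Wirtinger inequality -/

end Literature.Analysis.GaussianVortexArnold.StretchedVortexRows

end Part5

/-!
## Part 6 — port of `Summits/AnomalousDissipation/AnomalousDissipation/Theorems/MarginalStabilityChainStretchedVortexRowsStubCoreInverseTools.lean` (1 declarations kept)

# Helpers for stub `stub_coreInverse` of the line `braid-closed-large-circulation-gluing`
# (crux stmt-AnomalousDissipation-3009, `MarginalStabilityChain.StretchedVortexRows`)

Two structural facts about the linearisation `Λ_G w = v^G·∇w + (K∗w)·∇G` of the transport term at the Gaussian vortex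
(`G = gaussVortexProfile`, `v^G = gaussVortexVelocity`, `K∗w = biotSavart2D w`), which are the BLOCK STRUCTURE behind the
core inverse (`stub_coreInverse`) and the kernel theorem behind the cell problems (`stub_cellSolvability`):

* **The rotation multiplier, pointwise.** `⟪v^G ξ, ∇w ξ⟫ = Ω(ξ) · ∂_θ w(ξ)` where `∂_θ w(ξ) := Dw(ξ)[ξ^⊥]` is the angular
  derivative and `Ω(ξ) = (8π)⁻¹ φ(|ξ|²/4) > 0` the angular velocity of the Gaussian vortex
  (`inner_gaussVortexVelocity_gradient_eq_mul_angularDeriv`); hence `⟪v^G ξ, ∇w ξ⟫ · ∂_θw(ξ) = Ω(ξ) (∂_θ w(ξ))² ≥ 0`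
  (`inner_gaussVortexVelocity_gradient_mul_angularDeriv_nonneg`): pairing the rotation term `αΛ_G w` with the angular derivative
  `∂_θ w` is COERCIVE on non-radial functions with weight `αΩ` — the energy form of the "fast-rotation stabilising effect" at spectral
  parameter `0` (Li–Wei–Zhang, arXiv:1701.06269, Lemma 5.2 supplies the matching bound for the nonlocal part).
* **Radial functions are in the kernel of `Λ_G`.** For `h` radial (`‖ξ‖ = ‖η‖ → h ξ = h η`), `∂_θ h = 0` (`fderiv_perp_eq_zero_of_radial`:
  `h` is constant along the circle `t ↦ cos t·ξ + sin t·ξ^⊥`), so `⟪v^G ξ, ∇h ξ⟫ = 0`; and the Biot–Savart velocity of a radial density is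
  azimuthal (tree: `inner_biotSavart2D_eq_zero_of_radial`, by the reflection across `ℝξ`), while `∇G(ξ) = −(G(ξ)/2) ξ` is radial, so
  `⟪(K∗h)(ξ), ∇G(ξ)⟫ = 0`. Together: `Λ_G h = 0` pointwise (`lamG_eq_zero_of_radial`) — the `X₀ ⊆ ker Λ` half of Maekawa's kernel
  theorem (Li–Wei–Zhang Lemma 2.3; Gallay–Wayne 2005), with NO differentiability or integrability hypothesis (Mathlib's junk values
  `fderiv = 0` / `∫ = 0` make both sides vanish in the degenerate cases).

References: Th. Gallay, C. E. Wayne, Comm. Math. Phys. 255 (2005) §4.2; T. Li, D. Wei, Z. Zhang, Ann. Sci. ÉNS 53 (2020)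
= arXiv:1701.06269, Lemma 2.3 and Lemma 5.2; Th. Gallay, Y. Maekawa, arXiv:1610.08384 §4.1.

Not carried from this source module (not needed by the declarations re-homed here; their consumers are Summits-side): `hasDerivAt_cos_smul_add_sin_smul_perp`, `fderiv_perp_eq_zero_of_radial`, `inner_gaussVortexVelocity_gradient_eq_mul_angularDeriv`, `inner_gaussVortexVelocity_gradient_mul_angularDeriv_nonneg`, `inner_gaussVortexVelocity_gradient_eq_zero_of_radial`, `inner_gradient_gaussVortexProfile`, `inner_biotSavart2D_gradient_gaussVortexProfile_eq_zero_of_radial`, `lamG_eq_zero_of_radial`.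
-/

section Part6

open scoped RealInnerProductSpace _root_.Topology
open _root_.MeasureTheory WithLp

namespace Literature.Analysis.GaussianVortexArnold.StretchedVortexRows

open Literature.Analysis.FluidPDE

/-! ### The circle through `ξ` and the angular derivative -/

/-- The circle through `ξ`: `γ_ξ(t) = cos t · ξ + sin t · ξ^⊥`. [folklore]
[cite: GallaySverak2021, §2 and §4.1 (context: potential theory of the planar Biot–Savart / logarithmic potential used in the proof of Thm 2.5; this declaration is the cell’s own lemma, NOT a printed statement)] -/
theorem norm_cos_smul_add_sin_smul_perp (ξ : EuclideanSpace ℝ (Fin 2)) (t : ℝ) :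
    ‖Real.cos t • ξ + Real.sin t • perp ξ‖ = ‖ξ‖ := by
  have h0 : ⟪ξ, perp ξ⟫ = 0 := inner_self_perp ξ
  have hsq : ‖Real.cos t • ξ + Real.sin t • perp ξ‖ ^ 2 = ‖ξ‖ ^ 2 := by
    rw [norm_add_sq_real, norm_smul, norm_smul, inner_smul_left, inner_smul_right, h0, norm_perp,
      Real.norm_eq_abs, Real.norm_eq_abs, mul_pow, mul_pow, sq_abs, sq_abs]
    simp only [mul_zero, add_zero]
    nlinarith [Real.cos_sq_add_sin_sq t]
  have h1 : 0 ≤ ‖Real.cos t • ξ + Real.sin t • perp ξ‖ := norm_nonneg _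
  have h2 : 0 ≤ ‖ξ‖ := norm_nonneg _
  nlinarith [hsq, h1, h2, sq_nonneg (‖Real.cos t • ξ + Real.sin t • perp ξ‖ - ‖ξ‖),
    sq_nonneg (‖Real.cos t • ξ + Real.sin t • perp ξ‖ + ‖ξ‖)]

end Literature.Analysis.GaussianVortexArnold.StretchedVortexRows

end Part6

/-!
## Part 7 — port of `Summits/AnomalousDissipation/AnomalousDissipation/Theorems/MarginalStabilityChainStretchedVortexRowsStubCircAvgPolar.lean` (1 declarations kept)

# Circular-mean toolkit (II) toward stub `stub_coreInverse` of the line `braid-closed-large-circulation-gluing`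
# (crux stmt-AnomalousDissipation-3009, `MarginalStabilityChain.StretchedVortexRows`)

Part II of the circular-mean toolkit (part I: `…StubCircAvgTools`, radiality and regularity of
`u₀(ξ) = (2π)⁻¹ ∫₀^{2π} u(cos t · ξ + sin t · ξ^⊥) dt`). Here: the integral facts used by the energy method for
`stub_coreInverse` (helper `circAvg_wirtinger_even` and the background pairing `lamB_pairing_w_bound`):

* mean and variance on an interval: `∫ₐᵇ (f − m)² = ∫ₐᵇ f² − (∫ₐᵇ f)²/(b − a)` for the mean `m`, hence
  `∫ₐᵇ (f − m)² ≤ ∫ₐᵇ f²` (Jensen `(∫ₐᵇ f)² ≤ (b − a)∫ₐᵇ f²` is the tree's `Literature.Analysis.ODE.sq_intervalIntegral_le`);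
* **T4, zero circular means of the remainder**: `∫₀^{2π} (u − u₀)(r cos θ, r sin θ) dθ = 0` for every `r`
  (`intervalIntegral_sub_circularMean_eq_zero`, registered form `circAvg_sub_circularMean_zero`), also over `[−π, π]`;
* **comparison circle by circle** (`integral_le_integral_of_forall_circle`): for continuous nonnegative `F₁, F₂` with
  `F₂ ∈ L¹`, circle-wise inequalities `∫_{−π}^{π} F₁(γ_r) ≤ ∫_{−π}^{π} F₂(γ_r)` (`r > 0`) integrate to `F₁ ∈ L¹` and
  `∫ F₁ ≤ ∫ F₂` — polar coordinates for lower Lebesgue integrals (landed `lintegral_eq_lintegral_polar`) and Tonelli;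
* **T5, `L²` contraction for radial weights**: `∫ ρ u₀² ≤ ∫ ρ u²` and `∫ ρ (u − u₀)² ≤ ∫ ρ u²` for continuous `u` and a
  continuous nonnegative radial weight `ρ` with `ρ u² ∈ L¹` (e.g. `ρ = G`, `ρ = G Ω`), with the integrability of the
  left-hand sides (Jensen on each circle, where `ρ` and `u₀` are constant, then the comparison principle).

References: Th. Gallay, C. E. Wayne, Comm. Math. Phys. 255 (2005) §4.1; G. H. Hardy, J. E. Littlewood, G. Pólya,
*Inequalities*, Thm. 258.

Not carried from this source module (not needed by the declarations re-homed here; their consumers are Summits-side): `intervalIntegral_sub_mean_sq`, `intervalIntegral_sub_mean_sq_le`, `intervalIntegral_circle_zero_two_pi_eq`, `intervalIntegral_sub_circularMean_eq_zero`, `intervalIntegral_sub_circularMean_eq_zero'`, `circAvg_sub_circularMean_zero`, `integral_mul_circularMean_sq_le`, `integral_mul_sub_circularMean_sq_le`.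
-/

section Part7

open scoped RealInnerProductSpace _root_.Topology _root_.ENNReal
open _root_.MeasureTheory WithLp _root_.Function _root_.Set _root_.Real intervalIntegral _root_.Filter

namespace Literature.Analysis.GaussianVortexArnold.StretchedVortexRows

open Literature.Analysis.FluidPDE

/-! ### Mean and variance on an interval -/

/-- **Comparison principle, circle by circle.** For continuous nonnegative `F₁, F₂` on `ℝ²` with `F₂` integrable: if
`∫_{−π}^{π} F₁(r cos θ, r sin θ) dθ ≤ ∫_{−π}^{π} F₂(r cos θ, r sin θ) dθ` for every `r > 0`, then `F₁` is integrable and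
`∫ F₁ ≤ ∫ F₂` (polar coordinates for lower integrals, landed `lintegral_eq_lintegral_polar`, and Tonelli). [folklore]
[cite: GallaySverak2021, §2 and §4.1 (context: potential theory of the planar Biot–Savart / logarithmic potential used in the proof of Thm 2.5; this declaration is the cell’s own lemma, NOT a printed statement)] -/
theorem integral_le_integral_of_forall_circle {F₁ F₂ : EuclideanSpace ℝ (Fin 2) → ℝ}
    (h₁ : Continuous F₁) (h₂ : Continuous F₂) (h₁0 : ∀ ξ, 0 ≤ F₁ ξ) (h₂0 : ∀ ξ, 0 ≤ F₂ ξ)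
    (hint : Integrable F₂)
    (hle : ∀ r, 0 < r → ∫ θ in (-π)..π, F₁ (toLp 2 ![r * Real.cos θ, r * Real.sin θ]) ≤
      ∫ θ in (-π)..π, F₂ (toLp 2 ![r * Real.cos θ, r * Real.sin θ])) :
    Integrable F₁ ∧ ∫ ξ, F₁ ξ ≤ ∫ ξ, F₂ ξ := by
  have hI : ∀ {F : EuclideanSpace ℝ (Fin 2) → ℝ}, Continuous F → ∀ r : ℝ,
      IntegrableOn (fun θ => F (toLp 2 ![r * Real.cos θ, r * Real.sin θ])) (Ioo (-π) π) := fun hF r =>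
    ((hF.comp (continuous_toLp_cos_sin r)).integrableOn_Icc).mono_set Ioo_subset_Icc_self
  have hslice : ∀ r, 0 < r →
      ∫⁻ θ in Ioo (-π) π, ENNReal.ofReal r * ENNReal.ofReal (F₁ (toLp 2 ![r * Real.cos θ, r * Real.sin θ])) ≤
        ∫⁻ θ in Ioo (-π) π, ENNReal.ofReal r * ENNReal.ofReal (F₂ (toLp 2 ![r * Real.cos θ, r * Real.sin θ])) := by
    intro r hr
    rw [lintegral_const_mul' _ _ ENNReal.ofReal_ne_top, lintegral_const_mul' _ _ ENNReal.ofReal_ne_top]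
    refine mul_le_mul_right ?_ _
    rw [← ofReal_integral_eq_lintegral_ofReal (hI h₁ r) (Eventually.of_forall fun θ => h₁0 _),
      ← ofReal_integral_eq_lintegral_ofReal (hI h₂ r) (Eventually.of_forall fun θ => h₂0 _)]
    refine ENNReal.ofReal_le_ofReal ?_
    rw [← integral_Ioc_eq_integral_Ioo, ← intervalIntegral.integral_of_le (by linarith [pi_pos]),
      ← integral_Ioc_eq_integral_Ioo, ← intervalIntegral.integral_of_le (by linarith [pi_pos])]
    exact hle r hr
  have hle' : ∫⁻ ξ, ENNReal.ofReal (F₁ ξ) ≤ ∫⁻ ξ, ENNReal.ofReal (F₂ ξ) := by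
    rw [lintegral_eq_lintegral_polar _ h₁.measurable.ennreal_ofReal,
      lintegral_eq_lintegral_polar _ h₂.measurable.ennreal_ofReal]
    exact setLIntegral_mono' measurableSet_Ioi fun r hr => hslice r hr
  have hfin : ∫⁻ ξ, ENNReal.ofReal (F₂ ξ) < ⊤ := hint.lintegral_lt_top
  have hF₁ : Integrable F₁ :=
    ⟨h₁.aestronglyMeasurable, (hasFiniteIntegral_iff_ofReal (Eventually.of_forall h₁0)).2
      (lt_of_le_of_lt hle' hfin)⟩
  refine ⟨hF₁, ?_⟩
  rw [integral_eq_lintegral_of_nonneg_ae (Eventually.of_forall h₁0) h₁.aestronglyMeasurable,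
    integral_eq_lintegral_of_nonneg_ae (Eventually.of_forall h₂0) h₂.aestronglyMeasurable]
  exact ENNReal.toReal_mono hfin.ne hle'

/-! ### The circular mean is an `L²` contraction for radial weights -/

end Literature.Analysis.GaussianVortexArnold.StretchedVortexRows

end Part7

/-!
## Part 8 — port of `Summits/AnomalousDissipation/AnomalousDissipation/Theorems/MarginalStabilityChainStretchedVortexRowsStubLogPotentialSymmetry.lean` (3 declarations kept)

# Helper `logPotential_even_circMean` toward stub `stub_coreInverse` of the line
# `braid-closed-large-circulation-gluing` (crux stmt-AnomalousDissipation-3009, `MarginalStabilityChain.StretchedVortexRows`)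

Symmetries of the logarithmic potential `ψ = N ∗ g`, `N = (2π)⁻¹ log ‖·‖`, of a continuous Gaussian-bounded density
on `ℝ² = EuclideanSpace ℝ (Fin 2)` (wave 3, toward `logPotential_neutral_energy`):

* `g` even ⇒ `ψ` even (substitution `η ↦ −η`);
* `g` with zero circular means ⇒ `ψ` with zero circular means: for the rotation `R_t z = cos t · z + sin t · z^⊥`
  (a linear isometry), `ψ(R_t ξ) = ∫ N(ξ − η) g(R_t η) dη`; integrating `t` over `[0, 2π]`, Fubini and the angle
  shift `R_t (r u(α)) = r u(t + α)` reduce the inner integral to a circular mean of `g`.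

Not carried from this source module (not needed by the declarations re-homed here; their consumers are Summits-side): `intervalIntegral_rotation_eq_zero`, `logPotential_neg`, `logPotential_circMean_eq_zero`, `logPotential_even_circMean`.
-/

section Part8

open scoped RealInnerProductSpace _root_.Topology
open _root_.MeasureTheory WithLp _root_.Function _root_.Metric _root_.Filter _root_.Set

namespace Literature.Analysis.GaussianVortexArnold.StretchedVortexRows

open Literature.Analysis.FluidPDE

/-! ### The rotations `R_t z = cos t · z + sin t · z^⊥` -/

/-- The circle point `(r cos θ, r sin θ)` is the rotation by `θ` of `(r, 0)`. [folklore]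
[cite: GallaySverak2021, §2 and §4.1 (context: potential theory of the planar Biot–Savart / logarithmic potential used in the proof of Thm 2.5; this declaration is the cell’s own lemma, NOT a printed statement)] -/
theorem circlePoint_eq_rotation (r θ : ℝ) :
    (toLp 2 ![r * Real.cos θ, r * Real.sin θ] : EuclideanSpace ℝ (Fin 2)) =
      Real.cos θ • (toLp 2 ![r, 0] : EuclideanSpace ℝ (Fin 2)) + Real.sin θ • perp (toLp 2 ![r, 0]) := by
  ext i
  fin_cases i <;> simp [perp, mul_comm]

/-- **Angle shift**: for `η ≠ 0` there is an angle `α` with `R_θ η = (‖η‖ cos(θ + α), ‖η‖ sin(θ + α))` for all `θ`.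
[folklore]
[cite: GallaySverak2021, §2 and §4.1 (context: potential theory of the planar Biot–Savart / logarithmic potential used in the proof of Thm 2.5; this declaration is the cell’s own lemma, NOT a printed statement)] -/
theorem exists_angle_rotation_eq {η : EuclideanSpace ℝ (Fin 2)} (hη : η ≠ 0) :
    ∃ α : ℝ, ∀ θ : ℝ, Real.cos θ • η + Real.sin θ • perp η =
      (toLp 2 ![‖η‖ * Real.cos (θ + α), ‖η‖ * Real.sin (θ + α)] : EuclideanSpace ℝ (Fin 2)) := by
  set z : ℂ := ⟨η 0, η 1⟩ with hz
  have hnorm : ‖z‖ = ‖η‖ := by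
    rw [Complex.norm_def, Complex.normSq_mk, EuclideanSpace.norm_eq, Fin.sum_univ_two, Real.norm_eq_abs,
      Real.norm_eq_abs, sq_abs, sq_abs]
    congr 1
    ring
  have hz0 : z ≠ 0 := by
    intro h
    apply hη
    have h0 : η 0 = 0 := by simpa [hz] using congrArg Complex.re h
    have h1 : η 1 = 0 := by simpa [hz] using congrArg Complex.im h
    ext i
    fin_cases i
    · exact h0
    · exact h1
  have hn : ‖η‖ ≠ 0 := norm_ne_zero_iff.2 hη
  have hre : z.re = η 0 := rfl
  have him : z.im = η 1 := rfl
  refine ⟨Complex.arg z, fun θ => ?_⟩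
  have hc : ‖η‖ * Real.cos (Complex.arg z) = η 0 := by
    rw [Complex.cos_arg hz0, hnorm, hre]; field_simp
  have hs : ‖η‖ * Real.sin (Complex.arg z) = η 1 := by
    rw [Complex.sin_arg, hnorm, him]; field_simp
  ext i
  fin_cases i
  · simp [perp, Real.cos_add]
    linear_combination (-Real.cos θ) * hc + (Real.sin θ) * hs
  · simp [perp, Real.sin_add]
    linear_combination (-Real.cos θ) * hs - (Real.sin θ) * hc

section Sym

variable {B : ℝ} {g : EuclideanSpace ℝ (Fin 2) → ℝ} (hgc : Continuous g)
  (hg0 : ∀ η, |g η| ≤ B * Real.exp (-(1 / 8) * ‖η‖ ^ 2))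

include hg0 in
/-- `|N(ξ − η)| e^{−‖η‖²/8}` is integrable in `η`. [folklore]
[cite: GallaySverak2021, §2 and §4.1 (context: potential theory of the planar Biot–Savart / logarithmic potential used in the proof of Thm 2.5; this declaration is the cell’s own lemma, NOT a printed statement)] -/
theorem integrable_abs_logKernel_mul_exp (ξ : EuclideanSpace ℝ (Fin 2)) :
    Integrable fun η : EuclideanSpace ℝ (Fin 2) =>
      |(2 * Real.pi)⁻¹ * Real.log ‖ξ - η‖| * (B * Real.exp (-(1 / 8) * ‖η‖ ^ 2)) := by
  have hB : 0 ≤ B := (abs_nonneg _).trans ((hg0 0).trans (le_of_eq (by simp)))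
  have hi0 : Integrable fun η : EuclideanSpace ℝ (Fin 2) =>
      (ball (0 : EuclideanSpace ℝ (Fin 2)) 1).indicator (fun z => -Real.log ‖z‖) (ξ - η) :=
    integrable_indicator_neg_log_norm.comp_sub_left ξ
  have hi1 := integrable_one_add_norm_pow_mul_exp_eighth 1
  have hmeas : AEStronglyMeasurable (fun η : EuclideanSpace ℝ (Fin 2) =>
      |(2 * Real.pi)⁻¹ * Real.log ‖ξ - η‖| * (B * Real.exp (-(1 / 8) * ‖η‖ ^ 2))) volume :=
    (((measurable_const.mul ((measurable_const.sub measurable_id).norm.log)).abs).mul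
      (by fun_prop)).aestronglyMeasurable
  refine (((hi0.add (hi1.const_mul (Real.log (1 + ‖ξ‖) + 1))).const_mul ((2 * Real.pi)⁻¹ * B))).mono' hmeas
    (Eventually.of_forall fun η => ?_)
  rw [Real.norm_of_nonneg (by positivity), abs_mul, abs_of_pos (by positivity : (0:ℝ) < (2 * Real.pi)⁻¹),
    Pi.add_apply]
  have h1 := abs_log_norm_sub_le ξ η
  have h4 := indicator_neg_log_norm_nonneg (ξ - η)
  have he : Real.exp (-(1 / 8) * ‖η‖ ^ 2) ≤ 1 := Real.exp_le_one_iff.2 (by nlinarith [norm_nonneg η])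
  have he0 : 0 ≤ Real.exp (-(1 / 8) * ‖η‖ ^ 2) := (Real.exp_pos _).le
  have hL : 0 ≤ Real.log (1 + ‖ξ‖) := Real.log_nonneg (by linarith [norm_nonneg ξ])
  set L0 := (ball (0 : EuclideanSpace ℝ (Fin 2)) 1).indicator (fun z => -Real.log ‖z‖) (ξ - η)
  set e := Real.exp (-(1 / 8) * ‖η‖ ^ 2)
  have i1 : L0 * e ≤ L0 := mul_le_of_le_one_right h4 he
  have i2 : (Real.log (1 + ‖ξ‖) + ‖η‖) * e ≤ (Real.log (1 + ‖ξ‖) + 1) * ((1 + ‖η‖) ^ 1 * e) := by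
    rw [pow_one]
    have h := mul_nonneg (add_nonneg (mul_nonneg hL (norm_nonneg η)) zero_le_one) he0
    nlinarith [h]
  calc (2 * Real.pi)⁻¹ * |Real.log ‖ξ - η‖| * (B * e)
      ≤ (2 * Real.pi)⁻¹ * (L0 + Real.log (1 + ‖ξ‖) + ‖η‖) * (B * e) := by gcongr
    _ = (2 * Real.pi)⁻¹ * B * (L0 * e + (Real.log (1 + ‖ξ‖) + ‖η‖) * e) := by ring
    _ ≤ (2 * Real.pi)⁻¹ * B * (L0 + (Real.log (1 + ‖ξ‖) + 1) * ((1 + ‖η‖) ^ 1 * e)) := by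
        gcongr

end Sym

/-! ### The registered helper -/

end Literature.Analysis.GaussianVortexArnold.StretchedVortexRows

end Part8

/-!
## Part 9 — port of `Summits/AnomalousDissipation/AnomalousDissipation/Theorems/MarginalStabilityChainStretchedVortexRowsStubCoreRotationCoercivity.lean` (1 declarations kept)

# Helper `coreRotation_coercivity` toward stub `stub_coreInverse` of the line `braid-closed-large-circulation-gluing`
# (crux stmt-AnomalousDissipation-3009, `MarginalStabilityChain.StretchedVortexRows`)

ROTATION COERCIVITY of the Gaussian vortex at spectral parameter `0`, Biot–Savart part. For even `w = Gu` of the core class put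
`g := ∂_θw = Dw[ξ^⊥]` (a `C¹`, even, NEUTRAL, circular-mean-free density of Gaussian class) and `ψ := N∗g`. Then
`ξ·(K∗w)(ξ) = −ψ(ξ)` (`inner_id_biotSavart2D_eq_neg_logConv_angularDeriv`), so
`J := ∫ (ξ·K∗w) ∂_θw = −∫ ψ g = ‖∇ψ‖²_{L²} ≥ 0` (`logPotential_neutral_energy`), and
`J = −∫ψ g ≤ (∫ GΩ⁻¹ψ²)^{1/2} Θ^{1/2} ≤ (5.6 ∫ψ²/|ξ|²)^{1/2} Θ^{1/2} ≤ (1.4 J)^{1/2} Θ^{1/2}` by the scalar bound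
`G Ω⁻¹ |ξ|² = 8x²/(eˣ−1) ≤ 5.6` (`x = |ξ|²/4`) and the Hardy–Wirtinger inequality for even circular-mean-free functions
(`hardyWirtinger_even`), whence `J ≤ (7/5) Θ`, `Θ = ∫ G⁻¹Ω(∂_θw)²`: the Biot–Savart part of `⟨Λ_G w, ∂_θw⟩_{L²(G⁻¹)} = Θ − J/2`
eats at most `70%` of the local rotation coercivity.

Not carried from this source module (not needed by the declarations re-homed here; their consumers are Summits-side): `gaussVortexProfile_mul_sq_le_omega`, `norm_fderiv_gauss_mul_le`, `fderiv_neg_apply_of_even`, `opNorm_le_of_single_fin_two`, `hasDerivAt_circle`, `abs_mul_le_two_sq_div_add`, `coreRotation_coercivity`.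
-/

section Part9

open scoped RealInnerProductSpace _root_.Topology
open _root_.MeasureTheory WithLp _root_.Function _root_.Metric _root_.Filter _root_.Set

namespace Literature.Analysis.GaussianVortexArnold.StretchedVortexRows

open Literature.Analysis.FluidPDE

/-! ## The scalar bound `8x²/(eˣ − 1) ≤ 5.6` in the form `G Ω⁻¹ ≤ (7/5)·|ξ|⁻²` -/

/-- `(10/7)·8x² ≤ 8(eˣ − 1)`, i.e. `x²/(eˣ−1) ≤ 7/10`, for `x ≥ 0` (Taylor to fourth order; the true maximum is `≈ 0.648`). [folklore]
[cite: GallaySverak2021, §2 and §4.1 (context: potential theory of the planar Biot–Savart / logarithmic potential used in the proof of Thm 2.5; this declaration is the cell’s own lemma, NOT a printed statement)] -/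
theorem sq_le_seven_tenths_mul_exp_sub_one {x : ℝ} (hx : 0 ≤ x) : x ^ 2 ≤ 7 / 10 * (Real.exp x - 1) := by
  have hexp : 1 + x + x ^ 2 / 2 + x ^ 3 / 6 + x ^ 4 / 24 ≤ Real.exp x := by
    have h := Real.sum_le_exp_of_nonneg hx 5
    simp only [Finset.sum_range_succ, Finset.sum_range_zero, Nat.factorial, Nat.cast_one, pow_zero,
      pow_one] at h
    norm_num at h
    linarith
  nlinarith [sq_nonneg (x - 17 / 10), mul_nonneg hx (sq_nonneg (x - 2)), mul_nonneg hx (sq_nonneg x),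
    mul_nonneg (mul_nonneg hx hx) (sq_nonneg (x - 1))]

end Literature.Analysis.GaussianVortexArnold.StretchedVortexRows

end Part9

/-!
## Part 10 — port of `Summits/NavierStokesRegularity/NavierStokesRegularity/Theorems/FilamentSkeletonRssCoreLinearInvertibilityArnoldHighModesToolsB.lean` (5 declarations kept)

# Tools for stub `stub_arnoldHighModes` (crux `CoreLinearInvertibility`,
# stmt-NavierStokesRegularity-17973, route `FilamentSkeletonRss`, line `Sketch`) — part B:
# Hardy–Wirtinger with constant `1/3` for odd functions without `k = ±1` modes

* **Wirtinger with constant `1/3` on a circle.** For `g ∈ C¹(ℝ)` with `g(θ + π) = −g(θ)` and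
  `∫_{−π}^{π} g cos = ∫_{−π}^{π} g sin = 0` (no Fourier modes `k ∈ {0, ±1, ±2, …even}` — an odd
  function carrying only the modes `|k| ≥ 3`): `∫_{−π}^{π} g² ≤ ⅓ ∫_{−π}^{π} g'²`. Elementary proof
  without Fourier series: `p = g cos` and `q = g sin` are `π`-PERIODIC with zero mean over a period,
  so the sharp Wirtinger inequality with period `π` (landed `wirtinger_periodic`) gives
  `∫ p² ≤ ¼ ∫ p'²`, `∫ q² ≤ ¼ ∫ q'²`; and `p² + q² = g²`, `p'² + q'² = g'² + g²`.
* On the circle of radius `r`, for `φ ∈ C¹(ℝ²)` odd with vanishing `k = ±1` circle coefficients: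
  `∫ φ(γ_r)² ≤ (r²/3) ∫ ‖∇φ(γ_r)‖²` (`|(φ ∘ γ_r)'| ≤ r ‖∇φ‖`).
* `Φ(r) r² ≤ 14/5` for the kernel weight `Φ = kerWeight` (`x² ≤ (7/10)(eˣ − 1)`, landed).
* **`∫ Φ(|x|) φ² ≤ (14/15) ∫ ‖∇φ‖²** with `Φ φ² ∈ L¹`, for `φ ∈ C¹` odd with vanishing `k = ±1`
  circle coefficients and `‖∇φ‖² ∈ L¹` (comparison circle by circle, landed
  `integral_le_integral_of_forall_circle`).

References: G. H. Hardy, J. E. Littlewood, G. Pólya, *Inequalities*, Thm. 258 (Wirtinger);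
Th. Gallay, V. Šverák, arXiv:2110.13739, §2.1 (the modes `|k| ≥ 2` of Arnold's form);
Th. Gallay, C. E. Wayne, J. Math. Fluid Mech. 9 (2007), proof of Prop. 3.1 (`sup r²Φ`).

Not carried from this source module (not needed by the declarations re-homed here; their consumers are Summits-side): `stub_arnoldHighModesToolsB`.
-/

section Part10

namespace Literature.Analysis.GaussianVortexArnold

open _root_.Set _root_.Function _root_.Filter _root_.MeasureTheory _root_.Topology _root_.Metric WithLp
open Literature.Analysis.FluidPDE
open Literature.Analysis.GaussianVortexArnold.StretchedVortexRows
open scoped _root_.InnerProductSpace RealInnerProductSpace _root_.Real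

/-! ### Wirtinger with constant `1/3` -/

/-- Wirtinger for a `π`-periodic `C¹` function with zero mean over `[−π, π]`:
`∫_{−π}^{π} h² ≤ ¼ ∫_{−π}^{π} h'²` (the sharp inequality with period `π` on both half intervals). [folklore]
[cite: GallaySverak2021, §2 proof of Thm 2.5, the modes |n| ≥ 2 (source of the ARGUMENT implemented; this declaration is the cell’s own lemma, NOT a printed statement)] -/
theorem highModes_wirtinger_pi_periodic {h : ℝ → ℝ} (hh : ContDiff ℝ 1 h)
    (hper : Function.Periodic h π) (hmean : ∫ x in (-π)..π, h x = 0) :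
    ∫ x in (-π)..π, h x ^ 2 ≤ 1 / 4 * ∫ x in (-π)..π, deriv h x ^ 2 := by
  -- adapted from `integral_sq_circle_le` (AnomalousDissipation toolkit)
  have hc : Continuous h := hh.continuous
  have hdc : Continuous (deriv h) := hh.continuous_deriv le_rfl
  have hii : ∀ a b, IntervalIntegrable h volume a b := fun a b => hc.intervalIntegrable _ _
  have hsplit : ∫ x in (-π)..π, h x = (∫ x in (-π)..0, h x) + ∫ x in (0:ℝ)..π, h x :=
    (intervalIntegral.integral_add_adjacent_intervals (hii _ _) (hii _ _)).symm
  have hshift : ∫ x in (-π)..0, h x = ∫ x in (0:ℝ)..π, h x := by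
    have := hper.intervalIntegral_add_eq (-π) 0
    rwa [neg_add_cancel, zero_add] at this
  have hmean0 : ∫ x in (0:ℝ)..π, h x = 0 := by linarith
  have hmean1 : ∫ x in (-π)..0, h x = 0 := by linarith
  have hW0 := wirtinger_periodic hh Real.pi_pos (by simpa using (hper 0).symm) hmean0
  have hW1 := wirtinger_periodic hh (neg_lt_zero.2 Real.pi_pos) (by simpa using (hper (-π)).symm) hmean1
  have e0 : ((π - 0) / (2 * π)) ^ 2 = 1 / 4 := by field_simp; norm_num
  have e1 : ((0 - -π) / (2 * π)) ^ 2 = 1 / 4 := by field_simp; norm_num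
  rw [e0] at hW0
  rw [e1] at hW1
  have hii2 : ∀ a b, IntervalIntegrable (fun x => h x ^ 2) volume a b := fun a b =>
    (hc.pow 2).intervalIntegrable _ _
  have hii3 : ∀ a b, IntervalIntegrable (fun x => deriv h x ^ 2) volume a b := fun a b =>
    (hdc.pow 2).intervalIntegrable _ _
  rw [← intervalIntegral.integral_add_adjacent_intervals (hii2 (-π) 0) (hii2 0 π),
    ← intervalIntegral.integral_add_adjacent_intervals (hii3 (-π) 0) (hii3 0 π)]
  linarith

/-- **Wirtinger with constant `1/3`.** For `g ∈ C¹(ℝ)` antiperiodic under `θ ↦ θ + π` with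
`∫_{−π}^{π} g cos = ∫_{−π}^{π} g sin = 0`: `∫_{−π}^{π} g² ≤ ⅓ ∫_{−π}^{π} g'²` (`p = g cos`, `q = g sin`
are `π`-periodic with zero mean; `p² + q² = g²`, `p'² + q'² = g'² + g²`). [folklore]
[cite: GallaySverak2021, §2 proof of Thm 2.5, the modes |n| ≥ 2 (source of the ARGUMENT implemented; this declaration is the cell’s own lemma, NOT a printed statement)] -/
theorem highModes_wirtinger_third {g : ℝ → ℝ} (hg : ContDiff ℝ 1 g)
    (hanti : ∀ θ, g (θ + π) = -g θ)
    (hcos : ∫ θ in (-π)..π, g θ * Real.cos θ = 0)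
    (hsin : ∫ θ in (-π)..π, g θ * Real.sin θ = 0) :
    ∫ θ in (-π)..π, g θ ^ 2 ≤ 1 / 3 * ∫ θ in (-π)..π, deriv g θ ^ 2 := by
  obtain ⟨p, hp⟩ : ∃ p : ℝ → ℝ, p = fun θ => g θ * Real.cos θ := ⟨_, rfl⟩
  obtain ⟨q, hq⟩ : ∃ q : ℝ → ℝ, q = fun θ => g θ * Real.sin θ := ⟨_, rfl⟩
  have hpC : ContDiff ℝ 1 p := by rw [hp]; exact hg.mul Real.contDiff_cos
  have hqC : ContDiff ℝ 1 q := by rw [hq]; exact hg.mul Real.contDiff_sin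
  have hpper : Function.Periodic p π := fun θ => by
    simp only [hp, hanti, Real.cos_add_pi]; ring
  have hqper : Function.Periodic q π := fun θ => by
    simp only [hq, hanti, Real.sin_add_pi]; ring
  have hcos' : ∫ θ in (-π)..π, p θ = 0 := by rw [hp]; exact hcos
  have hsin' : ∫ θ in (-π)..π, q θ = 0 := by rw [hq]; exact hsin
  have hWp := highModes_wirtinger_pi_periodic hpC hpper hcos'
  have hWq := highModes_wirtinger_pi_periodic hqC hqper hsin'
  -- derivatives
  have hd : Differentiable ℝ g := hg.differentiable one_ne_zero
  have hdp : ∀ θ, deriv p θ = deriv g θ * Real.cos θ + g θ * -Real.sin θ := fun θ => by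
    rw [hp]; exact ((hd θ).hasDerivAt.mul (Real.hasDerivAt_cos θ)).deriv
  have hdq : ∀ θ, deriv q θ = deriv g θ * Real.sin θ + g θ * Real.cos θ := fun θ => by
    rw [hq]; exact ((hd θ).hasDerivAt.mul (Real.hasDerivAt_sin θ)).deriv
  have hgc : Continuous g := hg.continuous
  have hdc : Continuous (deriv g) := hg.continuous_deriv le_rfl
  have hii : ∀ {u : ℝ → ℝ}, Continuous u → ∀ a b, IntervalIntegrable (fun x => u x ^ 2) volume a b :=
    fun hu a b => (hu.pow 2).intervalIntegrable _ _
  have e1 : ∫ θ in (-π)..π, g θ ^ 2 = (∫ θ in (-π)..π, p θ ^ 2) + ∫ θ in (-π)..π, q θ ^ 2 := by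
    rw [← intervalIntegral.integral_add (hii hpC.continuous _ _) (hii hqC.continuous _ _)]
    refine intervalIntegral.integral_congr fun θ _ => ?_
    simp only [hp, hq]
    have := Real.cos_sq_add_sin_sq θ
    linear_combination (-(g θ ^ 2)) * this
  have e2 : (∫ θ in (-π)..π, deriv p θ ^ 2) + ∫ θ in (-π)..π, deriv q θ ^ 2 =
      (∫ θ in (-π)..π, deriv g θ ^ 2) + ∫ θ in (-π)..π, g θ ^ 2 := by
    rw [← intervalIntegral.integral_add (hii (hpC.continuous_deriv le_rfl) _ _)
        (hii (hqC.continuous_deriv le_rfl) _ _),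
      ← intervalIntegral.integral_add (hii hdc _ _) (hii hgc _ _)]
    refine intervalIntegral.integral_congr fun θ _ => ?_
    simp only [hdp, hdq]
    have := Real.cos_sq_add_sin_sq θ
    linear_combination (deriv g θ ^ 2 + g θ ^ 2) * this
  linarith

/-! ### The circle-wise bound -/

/-- **Circle-wise Hardy–Wirtinger with constant `1/3`.** For `φ ∈ C¹(ℝ²)` odd whose restriction to
the circle of radius `r` has vanishing `k = ±1` coefficients:
`∫_{−π}^{π} φ(γ_r)² ≤ (r²/3) ∫_{−π}^{π} ‖∇φ(γ_r)‖²`, `γ_r(θ) = (r cos θ, r sin θ)` (`φ ∘ γ_r` is antiperiodic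
under `θ ↦ θ + π` by oddness, and `|(φ ∘ γ_r)'| = |⟪∇φ, γ_r^⊥⟫| ≤ r ‖∇φ‖`). [folklore]
[cite: GallaySverak2021, §2 proof of Thm 2.5, the modes |n| ≥ 2 (source of the ARGUMENT implemented; this declaration is the cell’s own lemma, NOT a printed statement)] -/
theorem highModes_sq_circle_le (φ : EuclideanSpace ℝ (Fin 2) → ℝ) (hφ : ContDiff ℝ 1 φ)
    (hodd : ∀ x, φ (-x) = -φ x) {r : ℝ}
    (hcos : ∫ θ in (-π)..π, φ (circlePt r θ) * Real.cos θ = 0)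
    (hsin : ∫ θ in (-π)..π, φ (circlePt r θ) * Real.sin θ = 0) :
    ∫ θ in (-π)..π, φ (circlePt r θ) ^ 2 ≤
      r ^ 2 / 3 * ∫ θ in (-π)..π, ‖gradient φ (circlePt r θ)‖ ^ 2 := by
  obtain ⟨g, hg⟩ : ∃ g : ℝ → ℝ, g = fun θ => φ (circlePt r θ) := ⟨_, rfl⟩
  have hγ : ContDiff ℝ 1 (fun θ : ℝ => circlePt r θ) := by
    rw [show (fun θ : ℝ => circlePt r θ) = fun θ => (r * Real.cos θ) • EuclideanSpace.single (0 : Fin 2) (1 : ℝ) +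
        (r * Real.sin θ) • EuclideanSpace.single (1 : Fin 2) (1 : ℝ) from funext (circlePt_eq_smul_single r)]
    fun_prop
  have hgC : ContDiff ℝ 1 g := by rw [hg]; exact hφ.comp hγ
  have hgd : ∀ θ, HasDerivAt g (fderiv ℝ φ (circlePt r θ) (perp (circlePt r θ))) θ := fun θ => by
    rw [hg]
    exact ((hφ.differentiable one_ne_zero) _).hasFDerivAt.comp_hasDerivAt θ (hasDerivAt_circlePt r θ)
  have hderiv : ∀ θ, deriv g θ = fderiv ℝ φ (circlePt r θ) (perp (circlePt r θ)) := fun θ => (hgd θ).deriv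
  have hneg : ∀ θ, circlePt (-r) θ = -circlePt r θ := fun θ => by
    ext i; fin_cases i <;> simp [circlePt]
  have hanti : ∀ θ, g (θ + π) = -g θ := by
    intro θ
    simp only [hg, circlePt_add_pi, hneg, hodd]
  have hcos' : ∫ θ in (-π)..π, g θ * Real.cos θ = 0 := by rw [hg]; exact hcos
  have hsin' : ∫ θ in (-π)..π, g θ * Real.sin θ = 0 := by rw [hg]; exact hsin
  have hW := highModes_wirtinger_third hgC hanti hcos' hsin'
  -- `|g'| ≤ r ‖∇φ‖`
  have hpt : ∀ θ, deriv g θ ^ 2 ≤ r ^ 2 * ‖gradient φ (circlePt r θ)‖ ^ 2 := by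
    intro θ
    rw [hderiv, show fderiv ℝ φ (circlePt r θ) (perp (circlePt r θ)) =
        ⟪gradient φ (circlePt r θ), perp (circlePt r θ)⟫ by rw [gradient, InnerProductSpace.toDual_symm_apply],
      ← sq_abs]
    have h := abs_real_inner_le_norm (gradient φ (circlePt r θ)) (perp (circlePt r θ))
    rw [Literature.Analysis.FluidPDE.norm_perp, norm_circlePt] at h
    calc |⟪gradient φ (circlePt r θ), perp (circlePt r θ)⟫| ^ 2 ≤ (‖gradient φ (circlePt r θ)‖ * |r|) ^ 2 :=
          pow_le_pow_left₀ (abs_nonneg _) h 2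
      _ = r ^ 2 * ‖gradient φ (circlePt r θ)‖ ^ 2 := by rw [mul_pow, sq_abs]; ring
  have hgrad : Continuous (gradient φ) :=
    (InnerProductSpace.toDual ℝ (EuclideanSpace ℝ (Fin 2))).symm.continuous.comp (hφ.continuous_fderiv one_ne_zero)
  have hmono : ∫ θ in (-π)..π, deriv g θ ^ 2 ≤ ∫ θ in (-π)..π, r ^ 2 * ‖gradient φ (circlePt r θ)‖ ^ 2 :=
    intervalIntegral.integral_mono_on (by linarith [Real.pi_pos])
      (((hgC.continuous_deriv le_rfl).pow 2).intervalIntegrable _ _)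
      ((((hgrad.comp (continuous_circlePt r)).norm.pow 2).const_mul _).intervalIntegrable _ _) fun θ _ => hpt θ
  rw [intervalIntegral.integral_const_mul] at hmono
  have e : ∫ θ in (-π)..π, φ (circlePt r θ) ^ 2 = ∫ θ in (-π)..π, g θ ^ 2 := by rw [hg]
  rw [e]
  calc ∫ θ in (-π)..π, g θ ^ 2 ≤ 1 / 3 * ∫ θ in (-π)..π, deriv g θ ^ 2 := hW
    _ ≤ 1 / 3 * (r ^ 2 * ∫ θ in (-π)..π, ‖gradient φ (circlePt r θ)‖ ^ 2) :=
        mul_le_mul_of_nonneg_left hmono (by norm_num)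
    _ = _ := by ring

/-! ### The kernel weight against `r²` -/

/-- **`Φ(r) r² ≤ 14/5`** for the kernel weight `Φ(r) = (r²/4)/(e^{r²/4} − 1)`: with `x = r²/4`,
`Φ r² = 4x²/(eˣ − 1) ≤ 4 · (7/10)` (`x² ≤ (7/10)(eˣ − 1)`, landed). [folklore]
[cite: GallaySverak2021, §2 proof of Thm 2.5, the modes |n| ≥ 2 (source of the ARGUMENT implemented; this declaration is the cell’s own lemma, NOT a printed statement)] -/
theorem highModes_kerWeight_mul_sq_le (r : ℝ) : kerWeight r * r ^ 2 ≤ 14 / 5 := by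
  rcases eq_or_ne r 0 with h | h
  · rw [h]; norm_num
  rw [kerWeight_eq h]
  have hx : 0 < r ^ 2 / 4 := by positivity
  have hex : 0 < Real.exp (r ^ 2 / 4) - 1 := by
    have := Real.add_one_lt_exp hx.ne'; linarith
  have key := sq_le_seven_tenths_mul_exp_sub_one hx.le
  rw [div_mul_eq_mul_div, div_le_iff₀ hex]
  nlinarith

/-! ### Hardy–Wirtinger against the kernel weight -/

/-- **`∫ Φ(|x|) φ² ≤ (14/15) ∫ ‖∇φ‖²`** (and `Φ φ² ∈ L¹`) for `φ ∈ C¹(ℝ²)` odd with vanishing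
`k = ±1` circle coefficients and `‖∇φ‖² ∈ L¹`: on each circle `Φ(r) ∫ φ(γ_r)² ≤ Φ(r)(r²/3) ∫ ‖∇φ(γ_r)‖²`
and `Φ(r) r² ≤ 14/5`; then the comparison principle circle by circle. [folklore]
[cite: GallaySverak2021, §2 proof of Thm 2.5, the modes |n| ≥ 2 (source of the ARGUMENT implemented; this declaration is the cell’s own lemma, NOT a printed statement)] -/
theorem highModes_integral_kerWeight_mul_sq_le (φ : EuclideanSpace ℝ (Fin 2) → ℝ) (hφ : ContDiff ℝ 1 φ)
    (hodd : ∀ x, φ (-x) = -φ x)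
    (hmode : ∀ r : ℝ, 0 < r →
      ∫ θ in (-π)..π, φ (circlePt r θ) * Real.cos θ = 0 ∧
      ∫ θ in (-π)..π, φ (circlePt r θ) * Real.sin θ = 0)
    (hint : Integrable fun ξ => ‖gradient φ ξ‖ ^ 2) :
    Integrable (fun ξ => kerWeight ‖ξ‖ * φ ξ ^ 2) ∧
      ∫ ξ, kerWeight ‖ξ‖ * φ ξ ^ 2 ≤ 14 / 15 * ∫ ξ, ‖gradient φ ξ‖ ^ 2 := by
  have hΦc : Continuous fun ξ : EuclideanSpace ℝ (Fin 2) => kerWeight ‖ξ‖ :=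
    continuous_kerWeight.comp continuous_norm
  have hgrad : Continuous (gradient φ) :=
    (InnerProductSpace.toDual ℝ (EuclideanSpace ℝ (Fin 2))).symm.continuous.comp (hφ.continuous_fderiv one_ne_zero)
  have h := integral_le_integral_of_forall_circle (F₁ := fun ξ => kerWeight ‖ξ‖ * φ ξ ^ 2)
    (F₂ := fun ξ => 14 / 15 * ‖gradient φ ξ‖ ^ 2) (hΦc.mul (hφ.continuous.pow 2))
    (continuous_const.mul (hgrad.norm.pow 2))
    (fun ξ => mul_nonneg (kerWeight_pos _).le (sq_nonneg _)) (fun ξ => by positivity) (hint.const_mul _)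
    fun r hr => ?_
  · rw [integral_const_mul] at h
    exact h
  -- the circle-wise inequality
  show ∫ θ in (-π)..π, kerWeight ‖circlePt r θ‖ * φ (circlePt r θ) ^ 2 ≤
    ∫ θ in (-π)..π, 14 / 15 * ‖gradient φ (circlePt r θ)‖ ^ 2
  simp_rw [norm_circlePt, kerWeight_abs]
  rw [intervalIntegral.integral_const_mul, intervalIntegral.integral_const_mul]
  obtain ⟨hc, hs⟩ := hmode r hr
  have hA := highModes_sq_circle_le φ hφ hodd hc hs
  have hK := highModes_kerWeight_mul_sq_le r
  have hI : 0 ≤ ∫ θ in (-π)..π, ‖gradient φ (circlePt r θ)‖ ^ 2 :=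
    intervalIntegral.integral_nonneg (by linarith [Real.pi_pos]) fun θ _ => sq_nonneg _
  calc kerWeight r * ∫ θ in (-π)..π, φ (circlePt r θ) ^ 2
      ≤ kerWeight r * (r ^ 2 / 3 * ∫ θ in (-π)..π, ‖gradient φ (circlePt r θ)‖ ^ 2) :=
        mul_le_mul_of_nonneg_left hA (kerWeight_pos r).le
    _ = (kerWeight r * r ^ 2) / 3 * ∫ θ in (-π)..π, ‖gradient φ (circlePt r θ)‖ ^ 2 := by ring
    _ ≤ (14 / 5) / 3 * ∫ θ in (-π)..π, ‖gradient φ (circlePt r θ)‖ ^ 2 := by gcongr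
    _ = 14 / 15 * ∫ θ in (-π)..π, ‖gradient φ (circlePt r θ)‖ ^ 2 := by ring

/-! ### The registered tools stub -/

end Literature.Analysis.GaussianVortexArnold

end Part10

/-!
## Part 11 — port of `Summits/NavierStokesRegularity/NavierStokesRegularity/Theorems/FilamentSkeletonRssCoreLinearInvertibilityArnoldHighModesToolsC.lean` (4 declarations kept)

# Tools for stub `stub_arnoldHighModes` (crux `CoreLinearInvertibility`,
# stmt-NavierStokesRegularity-17973, route `FilamentSkeletonRss`, line `Sketch`) — part C:
# the logarithmic potential inherits vanishing `k = ±1` circle coefficients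

For a continuous Gaussian-bounded density `g` on `ℝ² = EuclideanSpace ℝ (Fin 2)` and its logarithmic
potential `ψ = N ∗ g`, `N = (2π)⁻¹ log ‖·‖`: if `∫_{−π}^{π} g(γ_r) cos = ∫_{−π}^{π} g(γ_r) sin = 0` on
every circle `γ_r(θ) = (r cos θ, r sin θ)`, `r > 0`, then the same holds for `ψ`. Proof (no Fourier
series, no per-mode formula): for the rotation `R_θ z = cos θ · z + sin θ · z^⊥` (a linear isometry),
`ψ(R_θ ξ₀) = ∫ N(ξ₀ − η) g(R_θ η) dη`; multiply by the weight `w(θ) ∈ {cos θ, sin θ}`, integrate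
over `θ ∈ [−π, π]`, and swap the integrals (Fubini, `|N(ξ₀ − η)| B e^{−‖η‖²/8} ∈ L¹`): the inner
angular integral `∫ g(R_θ η) w(θ) dθ` vanishes for `η ≠ 0`, because `R_θ η = γ_{‖η‖}(θ + α)` and after
the shift `θ ↦ θ − α` the weight `w(θ − α)` is a combination of `cos θ` and `sin θ`.
Adapted from the landed `logPotential_circMean_eq_zero` (the `k = 0` case).

References: Th. Gallay, V. Šverák, arXiv:2110.13739, §2.1 (Fourier decomposition of Arnold's form,
the potential acts mode by mode); folklore.

Not carried from this source module (not needed by the declarations re-homed here; their consumers are Summits-side): `stub_arnoldHighModesToolsC`.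
-/

section Part11

namespace Literature.Analysis.GaussianVortexArnold

open _root_.Set _root_.Function _root_.Filter _root_.MeasureTheory _root_.Topology _root_.Metric WithLp
open Literature.Analysis.FluidPDE
open Literature.Analysis.GaussianVortexArnold.StretchedVortexRows
open scoped _root_.InnerProductSpace RealInnerProductSpace _root_.Real

/-! ### Shifting a weight along a circle -/

/-- **Angle shift against a `2π`-periodic weight**: for continuous `G, w`, both `2π`-periodic,
`∫_{−π}^{π} G(θ + α) w(θ) dθ = ∫_{−π}^{π} G(s) w(s − α) ds`. [folklore]
[cite: GallaySverak2021, §2 proof of Thm 2.5, the modes |n| ≥ 2 (source of the ARGUMENT implemented; this declaration is the cell’s own lemma, NOT a printed statement)] -/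
theorem highModes_intervalIntegral_shift {G w : ℝ → ℝ} (hG : Function.Periodic G (2 * π))
    (hw : Function.Periodic w (2 * π)) (α : ℝ) :
    ∫ θ in (-π)..π, G (θ + α) * w θ = ∫ s in (-π)..π, G s * w (s - α) := by
  have h1 : ∫ θ in (-π)..π, G (θ + α) * w θ = ∫ θ in (-π)..π, (fun s => G s * w (s - α)) (θ + α) := by
    simp only [add_sub_cancel_right]
  rw [h1, intervalIntegral.integral_comp_add_right (fun s => G s * w (s - α)) α]
  have hper : Function.Periodic (fun s => G s * w (s - α)) (2 * π) := fun s => by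
    simp only [hG s, show s + 2 * π - α = (s - α) + 2 * π by ring, hw (s - α)]
  have := hper.intervalIntegral_add_eq (-π + α) (-π)
  rw [show -π + α + 2 * π = π + α by ring, show -π + 2 * π = π by ring] at this
  exact this

/-- **The twisted angular integrals vanish along every rotation orbit off the origin**: if
`∫_{−π}^{π} g(γ_r) cos = ∫_{−π}^{π} g(γ_r) sin = 0` for every `r > 0`, then for `η ≠ 0`
`∫_{−π}^{π} g(R_θ η) cos θ dθ = ∫_{−π}^{π} g(R_θ η) sin θ dθ = 0`, `R_θ η = cos θ · η + sin θ · η^⊥`. [folklore]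
[cite: GallaySverak2021, §2 proof of Thm 2.5, the modes |n| ≥ 2 (source of the ARGUMENT implemented; this declaration is the cell’s own lemma, NOT a printed statement)] -/
theorem highModes_intervalIntegral_rotation_eq_zero {g : EuclideanSpace ℝ (Fin 2) → ℝ} (hgc : Continuous g)
    (hmode : ∀ r : ℝ, 0 < r →
      ∫ θ in (-π)..π, g (circlePt r θ) * Real.cos θ = 0 ∧
      ∫ θ in (-π)..π, g (circlePt r θ) * Real.sin θ = 0)
    {η : EuclideanSpace ℝ (Fin 2)} (hη : η ≠ 0) :
    (∫ θ in (-π)..π, g (Real.cos θ • η + Real.sin θ • perp η) * Real.cos θ = 0) ∧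
      ∫ θ in (-π)..π, g (Real.cos θ • η + Real.sin θ • perp η) * Real.sin θ = 0 := by
  obtain ⟨α, hα⟩ := exists_angle_rotation_eq hη
  have hα' : ∀ θ, Real.cos θ • η + Real.sin θ • perp η = circlePt ‖η‖ (θ + α) := hα
  obtain ⟨hc, hs⟩ := hmode ‖η‖ (norm_pos_iff.2 hη)
  obtain ⟨G, hG⟩ : ∃ G : ℝ → ℝ, G = fun s => g (circlePt ‖η‖ s) := ⟨_, rfl⟩
  have hGc : Continuous G := by rw [hG]; exact hgc.comp (continuous_circlePt _)
  have hGper : Function.Periodic G (2 * π) := fun s => by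
    rw [hG]; exact congrArg g (periodic_circlePt ‖η‖ s)
  have hc' : ∫ s in (-π)..π, G s * Real.cos s = 0 := by rw [hG]; exact hc
  have hs' : ∫ s in (-π)..π, G s * Real.sin s = 0 := by rw [hG]; exact hs
  have hGα : ∀ θ, g (Real.cos θ • η + Real.sin θ • perp η) = G (θ + α) := fun θ => by rw [hα', hG]
  simp_rw [hGα]
  have hi1 : IntervalIntegrable (fun s => Real.cos α * (G s * Real.cos s)) volume (-π) π :=
    ((hGc.mul Real.continuous_cos).const_mul _).intervalIntegrable _ _
  have hi2 : IntervalIntegrable (fun s => Real.sin α * (G s * Real.sin s)) volume (-π) π :=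
    ((hGc.mul Real.continuous_sin).const_mul _).intervalIntegrable _ _
  have hi3 : IntervalIntegrable (fun s => Real.cos α * (G s * Real.sin s)) volume (-π) π :=
    ((hGc.mul Real.continuous_sin).const_mul _).intervalIntegrable _ _
  have hi4 : IntervalIntegrable (fun s => Real.sin α * (G s * Real.cos s)) volume (-π) π :=
    ((hGc.mul Real.continuous_cos).const_mul _).intervalIntegrable _ _
  constructor
  · rw [highModes_intervalIntegral_shift hGper Real.cos_periodic α]
    have e : ∀ s, G s * Real.cos (s - α) = Real.cos α * (G s * Real.cos s) + Real.sin α * (G s * Real.sin s) :=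
      fun s => by rw [Real.cos_sub]; ring
    simp_rw [e]
    rw [intervalIntegral.integral_add hi1 hi2, intervalIntegral.integral_const_mul,
      intervalIntegral.integral_const_mul, hc', hs', mul_zero, mul_zero, add_zero]
  · rw [highModes_intervalIntegral_shift hGper Real.sin_periodic α]
    have e : ∀ s, G s * Real.sin (s - α) = Real.cos α * (G s * Real.sin s) - Real.sin α * (G s * Real.cos s) :=
      fun s => by rw [Real.sin_sub]; ring
    simp_rw [e]
    rw [intervalIntegral.integral_sub hi3 hi4, intervalIntegral.integral_const_mul,
      intervalIntegral.integral_const_mul, hc', hs', mul_zero, mul_zero, sub_zero]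

/-! ### The potential against an angular weight -/

section Transfer

variable {B : ℝ} {g : EuclideanSpace ℝ (Fin 2) → ℝ} (hgc : Continuous g)
  (hg0 : ∀ η, |g η| ≤ B * Real.exp (-(1 / 8) * ‖η‖ ^ 2))

include hgc hg0 in
/-- **The potential against an angular weight.** For a continuous bounded weight `w` (`|w| ≤ 1`) whose
twisted angular integrals of `g` vanish along every rotation orbit off the origin,
`∫_{−π}^{π} ψ(γ_r(θ)) w(θ) dθ = 0` for `ψ = N ∗ g` and every `r` (rotate the variable, Fubini). [folklore]
[cite: GallaySverak2021, §2 proof of Thm 2.5, the modes |n| ≥ 2 (source of the ARGUMENT implemented; this declaration is the cell’s own lemma, NOT a printed statement)] -/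
theorem highModes_logPotential_circle_weight_eq_zero {w : ℝ → ℝ} (hw : Continuous w)
    (hw1 : ∀ θ, |w θ| ≤ 1)
    (hrot : ∀ η : EuclideanSpace ℝ (Fin 2), η ≠ 0 →
      ∫ θ in (-π)..π, g (Real.cos θ • η + Real.sin θ • perp η) * w θ = 0) (r : ℝ) :
    ∫ θ in (-π)..π, (∫ η, (2 * Real.pi)⁻¹ * Real.log ‖circlePt r θ - η‖ * g η) * w θ = 0 := by
  -- adapted from `logPotential_circMean_eq_zero` (AnomalousDissipation toolkit)
  have hB : 0 ≤ B := (abs_nonneg _).trans ((hg0 0).trans (le_of_eq (by simp)))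
  have hππ : (-π:ℝ) ≤ π := by linarith [Real.pi_pos]
  obtain ⟨ξ₀, hξ₀⟩ : ∃ x : EuclideanSpace ℝ (Fin 2), x = toLp 2 ![r, 0] := ⟨_, rfl⟩
  have hcirc : ∀ θ : ℝ, circlePt r θ = Real.cos θ • ξ₀ + Real.sin θ • perp ξ₀ := fun θ => by
    rw [hξ₀]; exact circlePoint_eq_rotation r θ
  -- Step 1: rotate the variable of integration
  have hstep : ∀ θ : ℝ, (∫ η, (2 * Real.pi)⁻¹ * Real.log ‖(Real.cos θ • ξ₀ + Real.sin θ • perp ξ₀) - η‖ * g η) =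
      ∫ η, (2 * Real.pi)⁻¹ * Real.log ‖ξ₀ - η‖ * g (Real.cos θ • η + Real.sin θ • perp η) := by
    intro θ
    obtain ⟨R, hR⟩ := exists_planarRotation (Real.cos θ) (Real.sin θ) (Real.cos_sq_add_sin_sq θ)
    have h1 : ∫ η, (2 * Real.pi)⁻¹ * Real.log ‖R ξ₀ - R η‖ * g (R η) =
        ∫ η, (2 * Real.pi)⁻¹ * Real.log ‖R ξ₀ - η‖ * g η :=
      R.measurePreserving.integral_comp R.toHomeomorph.measurableEmbedding
        (fun η => (2 * Real.pi)⁻¹ * Real.log ‖R ξ₀ - η‖ * g η)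
    rw [← hR ξ₀, ← h1]
    refine integral_congr_ae (Eventually.of_forall fun η => ?_)
    beta_reduce
    rw [← map_sub, LinearIsometryEquiv.norm_map, hR η]
  simp_rw [hcirc, hstep]
  -- Step 2: Fubini on `[−π, π] × ℝ²`
  set F : ℝ → EuclideanSpace ℝ (Fin 2) → ℝ := fun θ η =>
    (2 * Real.pi)⁻¹ * Real.log ‖ξ₀ - η‖ * (g (Real.cos θ • η + Real.sin θ • perp η) * w θ) with hF
  have hstep2 : ∀ θ : ℝ, (∫ η, (2 * Real.pi)⁻¹ * Real.log ‖ξ₀ - η‖ * g (Real.cos θ • η + Real.sin θ • perp η)) * w θ =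
      ∫ η, F θ η := fun θ => by
    rw [← integral_mul_const]
    refine integral_congr_ae (Eventually.of_forall fun η => ?_)
    simp only [hF]
    ring
  simp_rw [hstep2]
  have hrotc : Continuous fun p : ℝ × EuclideanSpace ℝ (Fin 2) => Real.cos p.1 • p.2 + Real.sin p.1 • perp p.2 :=
    ((Real.continuous_cos.comp continuous_fst).smul continuous_snd).add
      ((Real.continuous_sin.comp continuous_fst).smul (continuous_perp.comp continuous_snd))
  have hFmeas : Measurable (uncurry F) :=
    ((measurable_const.mul ((measurable_const.sub measurable_snd).norm.log)).mul
      ((hgc.measurable.comp hrotc.measurable).mul (hw.measurable.comp measurable_fst)))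
  have hFm : AEStronglyMeasurable (uncurry F)
      ((volume.restrict (Ioc (-π) π)).prod (volume : Measure (EuclideanSpace ℝ (Fin 2)))) :=
    hFmeas.aestronglyMeasurable
  have hFb : ∀ θ η, ‖F θ η‖ ≤ |(2 * Real.pi)⁻¹ * Real.log ‖ξ₀ - η‖| * (B * Real.exp (-(1 / 8) * ‖η‖ ^ 2)) := by
    intro θ η
    simp only [hF, norm_mul, Real.norm_eq_abs]
    rw [← abs_mul ((2 * Real.pi)⁻¹)]
    refine mul_le_mul_of_nonneg_left ?_ (abs_nonneg _)
    have h1 := hg0 (Real.cos θ • η + Real.sin θ • perp η)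
    rw [norm_cos_smul_add_sin_smul_perp] at h1
    have h2 := hw1 θ
    have h3 : 0 ≤ B * Real.exp (-(1 / 8) * ‖η‖ ^ 2) := by positivity
    calc |g (Real.cos θ • η + Real.sin θ • perp η)| * |w θ|
        ≤ (B * Real.exp (-(1 / 8) * ‖η‖ ^ 2)) * 1 := mul_le_mul h1 h2 (abs_nonneg _) h3
      _ = _ := mul_one _
  have hb := integrable_abs_logKernel_mul_exp hg0 ξ₀
  have hInt : Integrable (uncurry F)
      ((volume.restrict (Ioc (-π) π)).prod (volume : Measure (EuclideanSpace ℝ (Fin 2)))) := by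
    rw [integrable_prod_iff hFm]
    refine ⟨Eventually.of_forall fun θ => hb.mono'
      (hFmeas.comp (measurable_const.prodMk measurable_id)).aestronglyMeasurable
      (Eventually.of_forall (hFb θ)), ?_⟩
    refine (integrable_const (∫ η, |(2 * Real.pi)⁻¹ * Real.log ‖ξ₀ - η‖| *
      (B * Real.exp (-(1 / 8) * ‖η‖ ^ 2)))).mono' hFm.norm.integral_prod_right' (Eventually.of_forall fun θ => ?_)
    rw [Real.norm_of_nonneg (integral_nonneg fun η => norm_nonneg _)]
    exact integral_mono (hb.mono' (hFmeas.comp (measurable_const.prodMk measurable_id)).aestronglyMeasurable.norm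
      (Eventually.of_forall fun η => by rw [norm_norm]; exact hFb θ η)) hb (hFb θ)
  rw [intervalIntegral.integral_of_le hππ, integral_integral_swap hInt]
  -- Step 3: the inner angular integral vanishes off the origin
  refine integral_eq_zero_of_ae ?_
  have hae : ∀ᵐ η ∂(volume : Measure (EuclideanSpace ℝ (Fin 2))), η ≠ 0 := by
    rw [ae_iff]; simp
  filter_upwards [hae] with η hη
  simp only [hF, Pi.zero_apply]
  rw [integral_const_mul, ← intervalIntegral.integral_of_le hππ, hrot η hη, mul_zero]

include hgc hg0 in
/-- **`ψ = N ∗ g` inherits vanishing `k = ±1` circle coefficients from `g`.** [folklore]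
[cite: GallaySverak2021, §2 proof of Thm 2.5, the modes |n| ≥ 2 (source of the ARGUMENT implemented; this declaration is the cell’s own lemma, NOT a printed statement)] -/
theorem highModes_logPotential_modeOne_eq_zero
    (hmode : ∀ r : ℝ, 0 < r →
      ∫ θ in (-π)..π, g (circlePt r θ) * Real.cos θ = 0 ∧
      ∫ θ in (-π)..π, g (circlePt r θ) * Real.sin θ = 0) (r : ℝ) :
    (∫ θ in (-π)..π, (∫ η, (2 * Real.pi)⁻¹ * Real.log ‖circlePt r θ - η‖ * g η) * Real.cos θ = 0) ∧
      ∫ θ in (-π)..π, (∫ η, (2 * Real.pi)⁻¹ * Real.log ‖circlePt r θ - η‖ * g η) * Real.sin θ = 0 :=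
  ⟨highModes_logPotential_circle_weight_eq_zero hgc hg0 Real.continuous_cos Real.abs_cos_le_one
      (fun _ hη => (highModes_intervalIntegral_rotation_eq_zero hgc hmode hη).1) r,
    highModes_logPotential_circle_weight_eq_zero hgc hg0 Real.continuous_sin Real.abs_sin_le_one
      (fun _ hη => (highModes_intervalIntegral_rotation_eq_zero hgc hmode hη).2) r⟩

end Transfer

/-! ### The registered tools stub -/

end Literature.Analysis.GaussianVortexArnold

end Part11

/-!
## Part 12 — port of `Summits/NavierStokesRegularity/NavierStokesRegularity/Theorems/FilamentSkeletonRssCoreLinearInvertibilityArnoldHighModes.lean` (1 declarations kept)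

# Crux `CoreLinearInvertibility` (stmt-NavierStokesRegularity-17973), line `Sketch`, stub
# `stub_arnoldHighModes`: explicit Arnold coercivity on odd densities without `k = ±1` modes

For a continuous, odd, Gaussian-class density `ω_r` on `ℝ² = EuclideanSpace ℝ (Fin 2)` whose `k = ±1`
circle coefficients vanish (`∫_{−π}^{π} ω_r(γ_ρ) cos = ∫_{−π}^{π} ω_r(γ_ρ) sin = 0`, `ρ > 0`) and its
logarithmic potential `ψ = N ∗ ω_r` (`N = (2π)⁻¹ log ‖·‖`):

  `∫ ω_r ψ ≥ −(19/20) ∫ Φ⁻¹ ω_r²`,  `Φ = kerWeight`, `Φ(r) = (r²/4)/(e^{r²/4} − 1) = 1/𝒜`.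

This is the `|k| ≥ 2` (here, by oddness, `|k| ≥ 3`) half of Gallay–Šverák's Theorem 2.5 at the
Gaussian vortex with an explicit constant. Chain of the proof:

1. `ω_r` is neutral (odd), so the energy identity `E := ∫ ‖∇ψ‖² = −∫ ψ ω_r` holds, with
   `‖∇ψ‖² ∈ L¹` (tools A, derivative of `ψ` gained from the kernel — `ω_r` is only continuous);
2. `ψ` is `C¹`, odd, and inherits the vanishing of the `k = ±1` circle coefficients (tools C);
3. Hardy–Wirtinger with constant `1/3` on circles and `Φ r² ≤ 14/5` give
   `∫ Φ ψ² ≤ (14/15) E` (tools B);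
4. weighted Cauchy–Schwarz: `E = |∫ ψ ω_r| ≤ (∫ Φ ψ²)^{1/2} (∫ Φ⁻¹ ω_r²)^{1/2}`, hence
   `E ≤ (14/15) ∫ Φ⁻¹ ω_r² ≤ (19/20) ∫ Φ⁻¹ ω_r²`, i.e. `∫ ω_r ψ = −E ≥ −(19/20) ∫ Φ⁻¹ ω_r²`.

## References

* Th. Gallay, V. Šverák, *Arnold's variational principle and its application to the stability of
  planar vortices*, arXiv:2110.13739 = Analysis & PDE 17 (2024) 681–722, §2.1 (proof of Thm. 2.5:
  Fourier decomposition, the modes `|k| ≥ 2`), §4.1 Lemma 4.1 (the Gaussian weight). [GallaySverak2021]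
* Th. Gallay, C. E. Wayne, Comm. Math. Phys. 255 (2005) §4 (Hardy-type inequalities in the
  stability analysis of the Oseen vortex).
-/

section Part12

namespace Literature.Analysis.GaussianVortexArnold

open _root_.Set _root_.Function _root_.Filter _root_.MeasureTheory _root_.Topology _root_.Metric
open Literature.Analysis.FluidPDE
open scoped _root_.InnerProductSpace _root_.Real

/-- **Explicit Arnold coercivity on odd Gaussian-class densities with no `k = ±1` modes**
(registered stub `stub_arnoldHighModes` of line `Sketch`, crux `CoreLinearInvertibility`):
`∫ ω_r ψ_{ω_r} ≥ −(19/20) ∫ Φ⁻¹ ω_r²` — energy identity for the potential of a neutral continuous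
density, transfer of the vanishing `k = ±1` coefficients to `ψ`, Hardy–Wirtinger with constant `1/3`
and `Φ|x|² ≤ 14/5`, weighted Cauchy–Schwarz.
[cite: GallaySverak2021, §2 proof of Thm 2.5, the modes |n| ≥ 2 (source of the ARGUMENT implemented; this declaration is the cell’s own lemma, NOT a printed statement)] -/
theorem stub_arnoldHighModes :
    ∀ omr : EuclideanSpace ℝ (Fin 2) → ℝ, Continuous omr →
    (∃ (C : ℝ) (N : ℕ), ∀ x, |omr x| ≤ C * (1 + ‖x‖) ^ N * Real.exp (-(‖x‖ ^ 2 / 4))) →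
    (∀ x, omr (-x) = -omr x) →
    (∀ r : ℝ, 0 < r →
      ∫ θ in (-Real.pi)..Real.pi, omr (circlePt r θ) * Real.cos θ = 0 ∧
      ∫ θ in (-Real.pi)..Real.pi, omr (circlePt r θ) * Real.sin θ = 0) →
    -((19 / 20 : ℝ) * ∫ x, (kerWeight ‖x‖)⁻¹ * omr x ^ 2) ≤
      ∫ x, omr x * ∫ y, (2 * Real.pi)⁻¹ * Real.log ‖x - y‖ * omr y := by
  intro omr homc hgc hodd hmode
  -- Gaussian bound and neutrality
  obtain ⟨B, -, hB⟩ := arnold_gc_exp_eighth hgc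
  have hneutral : ∫ x, omr x = 0 := by
    have h1 := integral_neg_eq_self omr volume
    have h2 : ∫ x, omr (-x) = -∫ x, omr x := by
      rw [← integral_neg]
      exact integral_congr_ae (Eventually.of_forall fun x => hodd x)
    linarith
  -- the potential `ψ = N ∗ ω_r`
  obtain ⟨ψ, hψ⟩ : ∃ ψ : EuclideanSpace ℝ (Fin 2) → ℝ,
      ψ = fun x => ∫ y, (2 * Real.pi)⁻¹ * Real.log ‖x - y‖ * omr y := ⟨_, rfl⟩
  have hψx : ∀ x, (∫ y, (2 * Real.pi)⁻¹ * Real.log ‖x - y‖ * omr y) = ψ x := fun x => by rw [hψ]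
  simp_rw [hψx]
  -- Step 1: the energy identity (tools A)
  obtain ⟨hC1, -, hI1, -, hE⟩ := stub_arnoldHighModesToolsA B omr homc hB hneutral ψ hψ
  -- Step 2: `ψ` is odd with vanishing `k = ±1` circle coefficients (tools C)
  have hψodd : ∀ x, ψ (-x) = -ψ x := fun x => by
    rw [← hψx, ← hψx]; exact arnold_logPotential_neg_of_odd hodd x
  have hψmode : ∀ r : ℝ, 0 < r → (∫ θ in (-π)..π, ψ (circlePt r θ) * Real.cos θ = 0) ∧
      ∫ θ in (-π)..π, ψ (circlePt r θ) * Real.sin θ = 0 := fun r _ => by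
    have h := highModes_logPotential_modeOne_eq_zero homc hB hmode r
    simp only [hψx] at h
    exact h
  -- Step 3: Hardy–Wirtinger against the kernel weight (tools B)
  obtain ⟨hΦψ, hHW⟩ := highModes_integral_kerWeight_mul_sq_le ψ hC1 hψodd hψmode hI1
  -- Step 4: weighted Cauchy–Schwarz `|∫ ψ ω_r| ≤ (∫ Φ ψ²)^{1/2} (∫ Φ⁻¹ ω_r²)^{1/2}`
  have hΦpos : ∀ x : EuclideanSpace ℝ (Fin 2), 0 < kerWeight ‖x‖ := fun x => kerWeight_pos _
  have hginv : ∀ x : EuclideanSpace ℝ (Fin 2), 0 ≤ (kerWeight ‖x‖)⁻¹ := fun x => inv_nonneg.2 (hΦpos x).le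
  have hΦc : Continuous fun x : EuclideanSpace ℝ (Fin 2) => kerWeight ‖x‖ :=
    continuous_kerWeight.comp continuous_norm
  have hginvm : AEStronglyMeasurable (fun x : EuclideanSpace ℝ (Fin 2) => (kerWeight ‖x‖)⁻¹) volume :=
    (hΦc.inv₀ fun x => (kerWeight_pos _).ne').aestronglyMeasurable
  have hωΦ : Integrable fun x => (kerWeight ‖x‖)⁻¹ * omr x ^ 2 :=
    arnold_integrable_inv_kerWeight_mul_sq homc.aestronglyMeasurable hgc
  have hpt : ∀ x, (kerWeight ‖x‖)⁻¹ * (kerWeight ‖x‖ * ψ x) ^ 2 = kerWeight ‖x‖ * ψ x ^ 2 := fun x => by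
    have := (hΦpos x).ne'
    field_simp
  have ha : Integrable fun x => (kerWeight ‖x‖)⁻¹ * (kerWeight ‖x‖ * ψ x) ^ 2 :=
    hΦψ.congr (Eventually.of_forall fun x => (hpt x).symm)
  obtain ⟨-, hcs⟩ := abs_integral_weight_mul_mul_le (μ := volume) (a := fun x => kerWeight ‖x‖ * ψ x)
    (b := omr) hginv hginvm (hΦc.mul hC1.continuous).aestronglyMeasurable homc.aestronglyMeasurable ha hωΦ
  have e1 : ∫ x, (kerWeight ‖x‖)⁻¹ * ((kerWeight ‖x‖ * ψ x) * omr x) = ∫ x, ψ x * omr x :=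
    integral_congr_ae (Eventually.of_forall fun x => by
      have := (hΦpos x).ne'
      simp only
      field_simp)
  have e2 : ∫ x, (kerWeight ‖x‖)⁻¹ * (kerWeight ‖x‖ * ψ x) ^ 2 = ∫ x, kerWeight ‖x‖ * ψ x ^ 2 :=
    integral_congr_ae (Eventually.of_forall hpt)
  rw [e1, e2] at hcs
  -- Step 5: the algebra `E ≤ (14/15) ∫ Φ⁻¹ ω_r²`
  obtain ⟨I, hI⟩ : ∃ I : ℝ, I = ∫ x, (kerWeight ‖x‖)⁻¹ * omr x ^ 2 := ⟨_, rfl⟩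
  obtain ⟨E, hEdef⟩ : ∃ E : ℝ, E = ∫ x, ‖gradient ψ x‖ ^ 2 := ⟨_, rfl⟩
  rw [← hI] at hcs ⊢
  rw [← hEdef] at hE hHW
  have hE0 : 0 ≤ E := hEdef ▸ integral_nonneg fun x => sq_nonneg _
  have hI0 : 0 ≤ I := hI ▸ integral_nonneg fun x => mul_nonneg (hginv x) (sq_nonneg _)
  have hJ0 : 0 ≤ ∫ x, kerWeight ‖x‖ * ψ x ^ 2 := integral_nonneg fun x => mul_nonneg (hΦpos x).le (sq_nonneg _)
  have habs : |∫ x, ψ x * omr x| = E := by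
    rw [show (∫ x, ψ x * omr x) = -E by linarith, abs_neg, abs_of_nonneg hE0]
  rw [habs] at hcs
  have h2 : E ^ 2 ≤ (14 / 15 * E) * I := by
    calc E ^ 2 ≤ (Real.sqrt (∫ x, kerWeight ‖x‖ * ψ x ^ 2) * Real.sqrt I) ^ 2 :=
          pow_le_pow_left₀ hE0 hcs 2
      _ = (∫ x, kerWeight ‖x‖ * ψ x ^ 2) * I := by
          rw [mul_pow, Real.sq_sqrt hJ0, Real.sq_sqrt hI0]
      _ ≤ (14 / 15 * E) * I := mul_le_mul_of_nonneg_right hHW hI0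
  have hEle : E ≤ 14 / 15 * I := by
    by_contra hlt
    rw [not_le] at hlt
    have hEpos : 0 < E := lt_of_le_of_lt (by positivity) hlt
    have h3 : E * E ≤ (14 / 15 * I) * E := by nlinarith [h2]
    have := le_of_mul_le_mul_right h3 hEpos
    linarith
  -- conclusion
  have e3 : ∫ x, omr x * ψ x = ∫ x, ψ x * omr x :=
    integral_congr_ae (Eventually.of_forall fun x => mul_comm _ _)
  rw [e3]
  linarith

end Literature.Analysis.GaussianVortexArnold

end Part12

/-!
## Part 13 — port of `Summits/NavierStokesRegularity/NavierStokesRegularity/Theorems/FilamentSkeletonRssCoreLinearInvertibilityArnoldGaussian.lean` (7 declarations kept)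

# Crux `CoreLinearInvertibility` (stmt-NavierStokesRegularity-17973), line `Sketch`, stub
# `stub_gallaySverak2021`: Gallay–Šverák's Theorem 2.5 at the Gaussian vortex, PROVED

The named Literature fact `GallaySverak2021_thm25_gaussian` (coercivity of Arnold's quadratic form
`2J(ω) = ∫ Φ⁻¹ ω² + ∫ ω ψ_ω` on continuous, odd, Gaussian-class densities with vanishing first moments,
`Φ = kerWeight = 1/𝒜`) is assembled from the three landed stubs of wave 3:

* `stub_arnoldModeSplit`: `ω = ω₁ + ω_r` with `ω₁ = (a(|x|) x₀ + b(|x|) x₁)/|x|` the `k = ±1` part;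
  `∫ Φ⁻¹ ω² = π ∫ Φ⁻¹ (a² + b²) r dr + ∫ Φ⁻¹ ω_r²` and
  `∫ ω ψ_ω = −π ∫ ((B₁a) a + (B₁b) b) r dr + ∫ ω_r ψ_{ω_r}`, `(B₁a)(r) = ½ ∫ min(r/s, s/r) a(s) s ds`,
  with the moment constraints `∫ r² a = ∫ r² b = 0` and the vanishing `k = ±1` coefficients of `ω_r`;
* `stub_arnoldModeOne1D`: `γ₁ ∫ Φ⁻¹ a² r ≤ ∫ Φ⁻¹ a² r − ∫ (B₁a) a r` under `∫ r² a = 0` (same for `b`);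
* `stub_arnoldHighModes`: `∫ ω_r ψ_{ω_r} ≥ −(19/20) ∫ Φ⁻¹ ω_r²`.

Hence with `γ = min(γ₁, 1/20)`: `2J(ω) ≥ π γ₁ ∫ Φ⁻¹(a²+b²) r + (1/20) ∫ Φ⁻¹ ω_r² ≥ γ ∫ Φ⁻¹ ω²`.
The only work here is splitting the one-dimensional integrals (integrability of `Φ⁻¹ a² r` and of
`(B₁a) a r` on `(0, ∞)` from the Gaussian bounds on `a`, `b`).

## References

* Th. Gallay, V. Šverák, *Arnold's variational principle and its application to the stability of
  planar vortices*, arXiv:2110.13739 = Analysis & PDE 17 (2024) 681–722, Thm. 2.5, Rem. 2.7,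
  §2.1 (proof: Fourier decomposition in the angle), §4.1 Lemma 4.1. [GallaySverak2021]
-/

section Part13

namespace Literature.Analysis.GaussianVortexArnold

open _root_.Set _root_.Function _root_.Filter _root_.MeasureTheory _root_.Topology _root_.Metric
open Literature.Analysis.FluidPDE
open scoped _root_.InnerProductSpace _root_.Real

/-! ### One-dimensional integrability from Gaussian bounds -/

/-- A measurable function on `(0, ∞)` below a Gaussian-class bound `C (1+r)^k e^{−r²/4}` is integrable
on `(0, ∞)` (`(1+r)^k e^{−r²/4} ≤ K e^{−r²/8}`). [folklore]
[cite: GallaySverak2021, §2 Thm 2.5 with Rem. 2.7 (source of the ARGUMENT implemented; this declaration is the cell’s own lemma, NOT a printed statement)] -/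
theorem arnoldGauss_integrableOn_of_gaussBound {f : ℝ → ℝ}
    (hf : AEStronglyMeasurable f (volume.restrict (Ioi (0:ℝ)))) {C : ℝ} (hC : 0 ≤ C) (k : ℕ)
    (hb : ∀ r, 0 < r → |f r| ≤ C * (1 + r) ^ k * Real.exp (-(r ^ 2 / 4))) :
    IntegrableOn f (Ioi 0) := by
  obtain ⟨K, hK⟩ : ∃ K : ℝ, K = (k.factorial * (4 / (1 / 4 : ℝ)) ^ k * Real.exp ((1 / 4 : ℝ) / 2)) := ⟨_, rfl⟩
  have hG : Integrable fun t : ℝ => Real.exp (-((1 / 4 : ℝ) / 2) * t ^ 2) :=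
    integrable_exp_neg_mul_sq (by norm_num)
  refine Integrable.mono' ((hG.const_mul (C * K)).integrableOn) hf ?_
  refine (ae_restrict_iff' measurableSet_Ioi).2 (Eventually.of_forall fun r hr => ?_)
  rw [Real.norm_eq_abs]
  have h1 := PineauVicol2026.one_add_pow_mul_exp_neg_mul_sq_le (c := 1 / 4) (by norm_num) k (le_of_lt hr)
  rw [← hK] at h1
  have e : Real.exp (-(r ^ 2 / 4)) = Real.exp (-(1 / 4) * r ^ 2) := by congr 1; ring
  calc |f r| ≤ C * ((1 + r) ^ k * Real.exp (-(1 / 4) * r ^ 2)) := by rw [← e, ← mul_assoc]; exact hb r hr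
    _ ≤ C * (K * Real.exp (-((1 / 4) / 2) * r ^ 2)) := mul_le_mul_of_nonneg_left h1 hC
    _ = C * K * Real.exp (-((1 / 4) / 2) * r ^ 2) := by ring

section Radial

variable {a : ℝ → ℝ} (hac : ContinuousOn a (Ici 0)) {C : ℝ} {N : ℕ}
  (hab : ∀ r : ℝ, 0 ≤ r → |a r| ≤ C * (1 + r) ^ N * Real.exp (-(r ^ 2 / 4)))

include hac hab in
/-- `s ↦ |a(s)| s` is integrable on `(0, ∞)`. [folklore]
[cite: GallaySverak2021, §2 Thm 2.5 with Rem. 2.7 (source of the ARGUMENT implemented; this declaration is the cell’s own lemma, NOT a printed statement)] -/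
theorem arnoldGauss_integrableOn_abs_mul : IntegrableOn (fun s => |a s| * s) (Ioi 0) := by
  have hC : 0 ≤ C := by
    have h := hab 0 le_rfl
    simp only [add_zero, one_pow, mul_one, ne_eq, OfNat.ofNat_ne_zero, not_false_eq_true, zero_pow,
      zero_div, neg_zero, Real.exp_zero] at h
    exact (abs_nonneg _).trans h
  refine arnoldGauss_integrableOn_of_gaussBound
    (((continuous_abs.comp_continuousOn (hac.mono Ioi_subset_Ici_self)).mul continuousOn_id).aestronglyMeasurable
      measurableSet_Ioi) hC (N + 1) fun s hs => ?_
  rw [abs_of_nonneg (mul_nonneg (abs_nonneg _) hs.le)]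
  calc |a s| * s ≤ (C * (1 + s) ^ N * Real.exp (-(s ^ 2 / 4))) * (1 + s) :=
        mul_le_mul (hab s hs.le) (by linarith) hs.le (by positivity)
    _ = C * (1 + s) ^ (N + 1) * Real.exp (-(s ^ 2 / 4)) := by ring

include hac hab in
/-- **`r ↦ Φ(r)⁻¹ a(r)² r` is integrable on `(0, ∞)`** (`Φ⁻¹ ≤ e^{r²/4}`). [folklore]
[cite: GallaySverak2021, §2 Thm 2.5 with Rem. 2.7 (source of the ARGUMENT implemented; this declaration is the cell’s own lemma, NOT a printed statement)] -/
theorem arnoldGauss_integrableOn_normIntegrand :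
    IntegrableOn (fun r => (kerWeight r)⁻¹ * a r ^ 2 * r) (Ioi 0) := by
  have hC : 0 ≤ C := by
    have h := hab 0 le_rfl
    simp only [add_zero, one_pow, mul_one, ne_eq, OfNat.ofNat_ne_zero, not_false_eq_true, zero_pow,
      zero_div, neg_zero, Real.exp_zero] at h
    exact (abs_nonneg _).trans h
  have hcont : ContinuousOn (fun r => (kerWeight r)⁻¹ * a r ^ 2 * r) (Ioi 0) :=
    (((continuous_kerWeight.continuousOn.inv₀ fun r _ => (kerWeight_pos r).ne').mul
      ((hac.mono Ioi_subset_Ici_self).pow 2)).mul continuousOn_id)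
  refine arnoldGauss_integrableOn_of_gaussBound (hcont.aestronglyMeasurable measurableSet_Ioi)
    (sq_nonneg C) (2 * N + 1) fun r hr => ?_
  have hΦ := kerWeight_pos r
  rw [abs_of_nonneg (mul_nonneg (mul_nonneg (inv_nonneg.2 hΦ.le) (sq_nonneg _)) hr.le)]
  have h1 := arnold_inv_kerWeight_le r
  have h2 : a r ^ 2 ≤ (C * (1 + r) ^ N * Real.exp (-(r ^ 2 / 4))) ^ 2 := by
    rw [← sq_abs]; exact pow_le_pow_left₀ (abs_nonneg _) (hab r hr.le) 2
  have h3 : Real.exp (r ^ 2 / 4) * Real.exp (-(r ^ 2 / 4)) ^ 2 = Real.exp (-(r ^ 2 / 4)) := by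
    rw [pow_two (Real.exp (-(r ^ 2 / 4))), ← Real.exp_add, ← Real.exp_add]; congr 1; ring
  have h4 : 0 ≤ C ^ 2 * (1 + r) ^ (2 * N) * Real.exp (-(r ^ 2 / 4)) := by positivity
  calc (kerWeight r)⁻¹ * a r ^ 2 * r
      ≤ Real.exp (r ^ 2 / 4) * (C * (1 + r) ^ N * Real.exp (-(r ^ 2 / 4))) ^ 2 * r :=
        mul_le_mul_of_nonneg_right (mul_le_mul h1 h2 (sq_nonneg _) (Real.exp_pos _).le) hr.le
    _ = C ^ 2 * (1 + r) ^ (2 * N) * (Real.exp (r ^ 2 / 4) * Real.exp (-(r ^ 2 / 4)) ^ 2) * r := by ring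
    _ = C ^ 2 * (1 + r) ^ (2 * N) * Real.exp (-(r ^ 2 / 4)) * r := by rw [h3]
    _ ≤ C ^ 2 * (1 + r) ^ (2 * N) * Real.exp (-(r ^ 2 / 4)) * (1 + r) :=
        mul_le_mul_of_nonneg_left (by linarith) h4
    _ = C ^ 2 * (1 + r) ^ (2 * N + 1) * Real.exp (-(r ^ 2 / 4)) := by ring

/-- The mode kernel `min(r/s, s/r) ∈ [0, 1]` for `r, s > 0`. [folklore]
[cite: GallaySverak2021, §2 Thm 2.5 with Rem. 2.7 (source of the ARGUMENT implemented; this declaration is the cell’s own lemma, NOT a printed statement)] -/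
theorem arnoldGauss_min_mem_Icc {r s : ℝ} (hr : 0 < r) (hs : 0 < s) : min (r / s) (s / r) ∈ Icc (0:ℝ) 1 := by
  refine ⟨le_min (div_nonneg hr.le hs.le) (div_nonneg hs.le hr.le), ?_⟩
  rcases le_total r s with h | h
  · exact (min_le_left _ _).trans ((div_le_one hs).2 h)
  · exact (min_le_right _ _).trans ((div_le_one hr).2 h)

include hac in
/-- **Measurability of `B₁a`** on `(0, ∞)`: `r ↦ ∫_{(0,∞)} min(r/s, s/r) a(s) s ds` (the kernel times
`a(s) s` is continuous on `(0,∞)²`; marginal of an a.e.-strongly measurable function). [folklore]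
[cite: GallaySverak2021, §2 Thm 2.5 with Rem. 2.7 (source of the ARGUMENT implemented; this declaration is the cell’s own lemma, NOT a printed statement)] -/
theorem arnoldGauss_aestronglyMeasurable_B1 :
    AEStronglyMeasurable (fun r => ∫ s in Ioi (0:ℝ), min (r / s) (s / r) * a s * s)
      (volume.restrict (Ioi (0:ℝ))) := by
  set F : ℝ × ℝ → ℝ := fun p => min (p.1 / p.2) (p.2 / p.1) * a p.2 * p.2 with hF
  have hFc : ContinuousOn F (Ioi (0:ℝ) ×ˢ Ioi (0:ℝ)) := by
    refine ContinuousOn.mul (ContinuousOn.mul ?_ ?_) continuousOn_snd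
    · exact continuous_min.comp_continuousOn
        ((continuousOn_fst.div continuousOn_snd fun p hp => ne_of_gt hp.2).prodMk
          (continuousOn_snd.div continuousOn_fst fun p hp => ne_of_gt hp.1))
    · exact hac.comp continuousOn_snd fun p hp => Ioi_subset_Ici_self hp.2
  have hFm : AEStronglyMeasurable F ((volume.restrict (Ioi (0:ℝ))).prod (volume.restrict (Ioi (0:ℝ)))) := by
    rw [Measure.prod_restrict]
    exact hFc.aestronglyMeasurable (measurableSet_Ioi.prod measurableSet_Ioi)
  exact hFm.integral_prod_right'

include hac hab in
/-- **`r ↦ (B₁a)(r) a(r) r` is integrable on `(0, ∞)`** (`|(B₁a)(r)| ≤ ½ ∫ |a(s)| s ds`). [folklore]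
[cite: GallaySverak2021, §2 Thm 2.5 with Rem. 2.7 (source of the ARGUMENT implemented; this declaration is the cell’s own lemma, NOT a printed statement)] -/
theorem arnoldGauss_integrableOn_energyIntegrand :
    IntegrableOn (fun r => ((1 / 2 : ℝ) * ∫ s in Ioi (0:ℝ), min (r / s) (s / r) * a s * s) * a r * r) (Ioi 0) := by
  have hC : 0 ≤ C := by
    have h := hab 0 le_rfl
    simp only [add_zero, one_pow, mul_one, ne_eq, OfNat.ofNat_ne_zero, not_false_eq_true, zero_pow,
      zero_div, neg_zero, Real.exp_zero] at h
    exact (abs_nonneg _).trans h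
  have hIabs := arnoldGauss_integrableOn_abs_mul hac hab
  set Ka : ℝ := ∫ s in Ioi (0:ℝ), |a s| * s with hKa
  have hKa0 : 0 ≤ Ka := setIntegral_nonneg measurableSet_Ioi fun s hs => mul_nonneg (abs_nonneg _) hs.le
  have hB1 : ∀ r, 0 < r → |∫ s in Ioi (0:ℝ), min (r / s) (s / r) * a s * s| ≤ Ka := by
    intro r hr
    rw [← Real.norm_eq_abs]
    refine norm_integral_le_of_norm_le hIabs ((ae_restrict_iff' measurableSet_Ioi).2
      (Eventually.of_forall fun s hs => ?_))
    have hm := arnoldGauss_min_mem_Icc hr hs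
    rw [Real.norm_eq_abs, abs_mul, abs_mul, abs_of_nonneg hm.1, abs_of_pos (show (0:ℝ) < s from hs)]
    calc min (r / s) (s / r) * |a s| * s ≤ 1 * |a s| * s :=
          mul_le_mul_of_nonneg_right (mul_le_mul_of_nonneg_right hm.2 (abs_nonneg _)) (le_of_lt hs)
      _ = |a s| * s := by ring
  have hmeas : AEStronglyMeasurable
      (fun r => ((1 / 2 : ℝ) * ∫ s in Ioi (0:ℝ), min (r / s) (s / r) * a s * s) * a r * r)
      (volume.restrict (Ioi (0:ℝ))) :=
    (((aestronglyMeasurable_const (b := (1 / 2 : ℝ))).mul (arnoldGauss_aestronglyMeasurable_B1 hac)).mul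
      ((hac.mono Ioi_subset_Ici_self).aestronglyMeasurable measurableSet_Ioi)).mul
      (continuousOn_id.aestronglyMeasurable measurableSet_Ioi)
  refine arnoldGauss_integrableOn_of_gaussBound hmeas (by positivity : (0:ℝ) ≤ 1 / 2 * Ka * C) (N + 1)
    fun r hr => ?_
  rw [abs_mul, abs_mul, abs_mul, abs_of_pos hr, abs_of_pos (by norm_num : (0:ℝ) < 1 / 2)]
  have h1 := hB1 r hr
  have h2 := hab r hr.le
  calc 1 / 2 * |∫ s in Ioi (0:ℝ), min (r / s) (s / r) * a s * s| * |a r| * r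
      ≤ 1 / 2 * Ka * (C * (1 + r) ^ N * Real.exp (-(r ^ 2 / 4))) * (1 + r) := by
        refine mul_le_mul (mul_le_mul (by gcongr) h2 (abs_nonneg _) (by positivity)) (by linarith) hr.le
          (by positivity)
    _ = 1 / 2 * Ka * C * (1 + r) ^ (N + 1) * Real.exp (-(r ^ 2 / 4)) := by ring

end Radial

/-! ### The assembly -/

/-- **Gallay–Šverák's Theorem 2.5 (with Remark 2.7) at the Gaussian vortex, for odd densities**
(registered skeleton stub `stub_gallaySverak2021` of line `Sketch`, crux `CoreLinearInvertibility`;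
discharges the named Literature fact `GallaySverak2021_thm25_gaussian`): there is `γ > 0` with
`γ ∫ Φ⁻¹ ω² ≤ ∫ Φ⁻¹ ω² + ∫ ω ψ_ω` for every continuous, odd, Gaussian-class `ω` with
`∫ x₀ ω = ∫ x₁ ω = 0`. Proof: `γ = min(γ₁, 1/20)`; split `ω = ω₁ + ω_r` (`stub_arnoldModeSplit`),
apply the one-dimensional constrained coercivity to `a` and `b` (`stub_arnoldModeOne1D`) and the
explicit high-mode coercivity to `ω_r` (`stub_arnoldHighModes`).
[cite: GallaySverak2021, §2 Thm 2.5 with Rem. 2.7 (source of the ARGUMENT implemented; this declaration is the cell’s own lemma, NOT a printed statement)] -/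
theorem stub_gallaySverak2021 : Literature.Analysis.FluidPDE.GallaySverak2021_thm25_gaussian := by
  obtain ⟨γ₁, hγ₁, h1D⟩ := stub_arnoldModeOne1D
  refine ⟨min γ₁ (1 / 20), lt_min hγ₁ (by norm_num), fun om homc homg homo hm0 hm1 => ?_⟩
  -- the splitting data
  obtain ⟨a, ha⟩ : ∃ a : ℝ → ℝ,
      a = fun r => (1 / Real.pi) * ∫ θ in (-Real.pi)..Real.pi, om (circlePt r θ) * Real.cos θ := ⟨_, rfl⟩
  obtain ⟨b, hb⟩ : ∃ b : ℝ → ℝ,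
      b = fun r => (1 / Real.pi) * ∫ θ in (-Real.pi)..Real.pi, om (circlePt r θ) * Real.sin θ := ⟨_, rfl⟩
  obtain ⟨om₁, hom₁⟩ : ∃ om₁ : EuclideanSpace ℝ (Fin 2) → ℝ,
      om₁ = fun x => (a ‖x‖ * x 0 + b ‖x‖ * x 1) / ‖x‖ := ⟨_, rfl⟩
  obtain ⟨omr, homr⟩ : ∃ omr : EuclideanSpace ℝ (Fin 2) → ℝ, omr = fun x => om x - om₁ x := ⟨_, rfl⟩
  obtain ⟨hac, hbc, ⟨C, N, hab⟩, homrc, homrg, homro, homrm, hma, hmb, hnorm, henergy⟩ :=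
    stub_arnoldModeSplit om a b om₁ omr homc homg homo hm0 hm1 (fun r => by rw [ha]) (fun r => by rw [hb])
      (fun x => by rw [hom₁]) (fun x => by rw [homr])
  -- the three coercivities
  have hA := h1D a hac ⟨C, N, fun r hr => (hab r hr).1⟩ hma
  have hB := h1D b hbc ⟨C, N, fun r hr => (hab r hr).2⟩ hmb
  have hR := stub_arnoldHighModes omr homrc homrg homro homrm
  -- splitting the one-dimensional integrals
  have hISa := arnoldGauss_integrableOn_normIntegrand hac (fun r hr => (hab r hr).1)
  have hISb := arnoldGauss_integrableOn_normIntegrand hbc (fun r hr => (hab r hr).2)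
  have hITa := arnoldGauss_integrableOn_energyIntegrand hac (fun r hr => (hab r hr).1)
  have hITb := arnoldGauss_integrableOn_energyIntegrand hbc (fun r hr => (hab r hr).2)
  have hSab : ∫ r in Ioi (0:ℝ), (kerWeight r)⁻¹ * (a r ^ 2 + b r ^ 2) * r =
      (∫ r in Ioi (0:ℝ), (kerWeight r)⁻¹ * a r ^ 2 * r) + ∫ r in Ioi (0:ℝ), (kerWeight r)⁻¹ * b r ^ 2 * r := by
    rw [← integral_add hISa hISb]
    exact integral_congr_ae (Eventually.of_forall fun r => by ring)
  have hTab : ∫ r in Ioi (0:ℝ),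
      (((1 / 2 : ℝ) * ∫ s in Ioi (0:ℝ), min (r / s) (s / r) * a s * s) * a r +
        ((1 / 2 : ℝ) * ∫ s in Ioi (0:ℝ), min (r / s) (s / r) * b s * s) * b r) * r =
      (∫ r in Ioi (0:ℝ), ((1 / 2 : ℝ) * ∫ s in Ioi (0:ℝ), min (r / s) (s / r) * a s * s) * a r * r) +
        ∫ r in Ioi (0:ℝ), ((1 / 2 : ℝ) * ∫ s in Ioi (0:ℝ), min (r / s) (s / r) * b s * s) * b r * r := by
    rw [← integral_add hITa hITb]
    exact integral_congr_ae (Eventually.of_forall fun r => by ring)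
  rw [hnorm, henergy, hSab, hTab]
  -- signs
  have hSa0 : 0 ≤ ∫ r in Ioi (0:ℝ), (kerWeight r)⁻¹ * a r ^ 2 * r :=
    setIntegral_nonneg measurableSet_Ioi fun r hr =>
      mul_nonneg (mul_nonneg (inv_nonneg.2 (kerWeight_pos r).le) (sq_nonneg _)) (le_of_lt hr)
  have hSb0 : 0 ≤ ∫ r in Ioi (0:ℝ), (kerWeight r)⁻¹ * b r ^ 2 * r :=
    setIntegral_nonneg measurableSet_Ioi fun r hr =>
      mul_nonneg (mul_nonneg (inv_nonneg.2 (kerWeight_pos r).le) (sq_nonneg _)) (le_of_lt hr)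
  have hSr0 : 0 ≤ ∫ x, (kerWeight ‖x‖)⁻¹ * omr x ^ 2 :=
    integral_nonneg fun x => mul_nonneg (inv_nonneg.2 (kerWeight_pos _).le) (sq_nonneg _)
  -- bookkeeping
  set Sa := ∫ r in Ioi (0:ℝ), (kerWeight r)⁻¹ * a r ^ 2 * r with hSa
  set Sb := ∫ r in Ioi (0:ℝ), (kerWeight r)⁻¹ * b r ^ 2 * r with hSb
  set Ta := ∫ r in Ioi (0:ℝ), ((1 / 2 : ℝ) * ∫ s in Ioi (0:ℝ), min (r / s) (s / r) * a s * s) * a r * r with hTa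
  set Tb := ∫ r in Ioi (0:ℝ), ((1 / 2 : ℝ) * ∫ s in Ioi (0:ℝ), min (r / s) (s / r) * b s * s) * b r * r with hTb
  set Sr := ∫ x, (kerWeight ‖x‖)⁻¹ * omr x ^ 2 with hSr
  set Jr := ∫ x, omr x * ∫ y, (2 * Real.pi)⁻¹ * Real.log ‖x - y‖ * omr y with hJr
  have hπ := Real.pi_pos
  have k1 : min γ₁ (1 / 20) * (Real.pi * (Sa + Sb)) ≤ γ₁ * (Real.pi * (Sa + Sb)) :=
    mul_le_mul_of_nonneg_right (min_le_left _ _) (by positivity)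
  have k2 : min γ₁ (1 / 20) * Sr ≤ 1 / 20 * Sr := mul_le_mul_of_nonneg_right (min_le_right _ _) hSr0
  have k3 : Real.pi * (Ta + Tb) ≤ Real.pi * ((1 - γ₁) * (Sa + Sb)) :=
    mul_le_mul_of_nonneg_left (by linarith) hπ.le
  have k4 : γ₁ * (Real.pi * (Sa + Sb)) = Real.pi * (Sa + Sb) - Real.pi * ((1 - γ₁) * (Sa + Sb)) := by ring
  calc min γ₁ (1 / 20) * (Real.pi * (Sa + Sb) + Sr)
      = min γ₁ (1 / 20) * (Real.pi * (Sa + Sb)) + min γ₁ (1 / 20) * Sr := by ring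
    _ ≤ γ₁ * (Real.pi * (Sa + Sb)) + 1 / 20 * Sr := add_le_add k1 k2
    _ ≤ Real.pi * (Sa + Sb) + Sr + (-(Real.pi * (Ta + Tb)) + Jr) := by linarith

end Literature.Analysis.GaussianVortexArnold

end Part13

/-! ## Part 14 — the EXACT discharge -/

namespace Literature.Analysis.FluidPDE

open Literature.Analysis in
/-- **The named fact `GallaySverak2021_thm25_gaussian` HOLDS** (`ArnoldCoercivityGaussianVortex.lean`; Gallay–Šverák 2021 Thm 2.5 with
Rem. 2.7, specialised to the Gaussian weight and to continuous odd Gaussian-class densities).  EXACT-name restatement of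
`GaussianVortexArnold.stub_gallaySverak2021` (last Part: mode-one constrained coercivity + explicit high-mode coercivity after the
angular splitting), Literature-side twin of `Summit.NavierStokesRegularity.NavierStokesRegularity.Theorems.stub_gallaySverak2021`
(same proof). [cite: GallaySverak2021, Thm. 2.5 with Rem. 2.7; §4.1 Lemma 4.1] -/
theorem GallaySverak2021_thm25_gaussian_holds : GallaySverak2021_thm25_gaussian :=
  GaussianVortexArnold.stub_gallaySverak2021

end Literature.Analysis.FluidPDE

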